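import Summits.Ventures.HSemireg.Pad4TowerCrossPhase
import Summits.Ventures.HSemireg.Pad4TowerClassScreen
import Literature.AlgebraicGeometry.HodgeTheory.SemiregularityMap
import Literature.LinearAlgebra.IndependentSubspacesDimension
import Mathlib.LinearAlgebra.FiniteDimensional.Lemmas
import Mathlib.LinearAlgebra.Dual.Lemmas
import Mathlib.LinearAlgebra.TensorProduct.Basic

/-!
# C4 — simplicity ∕ μ-(semi)stability of a letter-monad bundle: DESIGN-LEVEL CERTIFICATE SPEC (pub-hsemireg, row C4)

v1.12 (g11, 2026-08-30): § `TwoDoor` appended (LAW «2D-MASS» = the THREE-TERM two-door D-MASS rows behind (H2): categorical kernel `twoDoor_lower|upper`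
(unconditional) ∕ `twoDoor_lift_of_ext_succ_eq_zero|both|sub|quot` (behind the Ext³ switch) over Mathlib's `Abelian.Ext`; counting kernel `twoDoor_count_sub|quot|both`,
`twoDoor_row_Ni|Nii`; aligned cohomology `hVec` ∕ `hPoly` ∕ `hDim`, `SplitDesign.ext3Dim|Ext3Switch`; rows `SplitDesign.dcapA|C|NA|NC`, `TwoDoorRowNi|Nii|Niii|A|C`,
`TwoDoorN|Switched|All`; certificates at the `S′` ∕ `S131` carriers); memo `C4-2DMASS-c4-1-g11.md`. FILE AT THE 200 kB CAP: successors open a second file.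
v1.11 (g10, 2026-08-30): v1.10 + the P-side kernel lemmas `dmass_rank_push` ∕ `finrank_range_comp_le` ∕ `dmass_rank_push_factoring` (ROW D-MASS-P,
memo §1.5); nothing else changed. v1.10 (g10, 2026-08-30): § `DMass` appended (ROW D-MASS = THEOREM P's diagonal criterion (RULE D) WITH MULTIPLICITIES, read as linear rows in the
cell masses: `betaG` ∕ `blockM₁` ∕ `blockM₂` (the `(g,j)`-block of `ob_κ(L_ν)`), `IsNullDiff` ∕ `lineVec` ∕ `gPairing` ∕ `Annihilates` ∕ `Detects` ∕
`DMassValid`, supplier kinds `IsLegBelow` ∕ `IsR2aBelow` ∕ `DMassCounts`, rows `LetterDesign.dmassCapN|P` ∕ `DMassRowN|P` ∕ `DMassN|P` ∕ `DMassAll`;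
kernel-checked core `dmass_functional_push` ∕ `dmass_functional_push_le` ∕ `dmass_push_through_functional` (annihilated suppliers drop out);
numeric certificates of record); memo `C4-DMASS-c4-1-g10.md`. v1.9 content
unchanged above it.
v1.9 (g9, 2026-08-30): § `CapForest` appended (ROW CAP-FOREST = nested capacity: `LetterDesign.CapForest` ∕ `CapForestRow` ∕ `CapForestSharpRow` ∕
`CapForestAll` ∕ `dcap` ∕ `CapForestDown(Row)`, `capForestRow_empty_iff`, `capZeroAll_of_capForestAll`; kernel-checked core
`exists_ne_zero_mem_inf_of_finrank_lt`, `capChain_finrank_map_eq`, `capChain_collision`, `finrank_sup_eq_add_of_disjoint`,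
`finrank_biSup_eq_sum_of_iSupIndep`, `capForest_collision₂`, `capForest_collision`); memo `C4-CAP-FOREST-c4-1-g9.md`. v1.8 content unchanged above it.
v1.8 (g8, 2026-08-30): § `HubLone` appended (THEOREM Y = the `σ`-image of the NON-POLARISED tautological classes
`h·β_ab·id − ob_{ξ_ab}` in coefficients: `lcCoeff`, `lcCoeff_succ_sub`, `hubLone_sigma_coeff`; HUB-LONE LAW = one split hub copy `𝒪(hΘ)` kills
every door, abstract schemas `DirectSumDatum.not_isISemiregular_of_hubLone` ∕ `_of_hubLone_zero`; the general (A1) criterion `HubLoneDoorDead`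
with the LC certificate and the BAND counter-certificate; the rows `LetterDesign.HubCapZeroRow` ∕ `CapZeroRow` ∕ `CapZeroAll` = CAP-0-ALL, their DOWN ∕ three-term forms
`SplitDesign.CapZeroRowMonad` ∕ `CapZeroAllMonad` with the kernel-checked pairing lemma `exists_dual_pairing_ne_zero` behind the three-term split);
memo `C4-CAP0-ALL-c4-1-g8.md`. v1.7 content unchanged above it.
v1.7 (g7, 2026-08-30): § `OrbitStability` appended (ROW X₇ = orbit-stable components: the symmetry group `G = S₄ × C₄` on cells —
`rotPt` ∕ `rotCell` ∕ `permCell` preserve the effective order `le_rotCell_iff` ∕ `le_permCell_iff`, hence live arrows; `SplitDesign.IsSymmetry`,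
`LiveConn`, `OrbitStable` («every cell is live-connected to its translate» = every live component is `g`-stable), `OrbitStable.comp`,
`orbitStable_of_liveConnected`; sheaf-level schema `DirectSumDatum.not_isISemiregular_of_conjugateBlocks` = two forced blocks with EQUAL
class data on a door collide); memo `C4-X7-ORBIT-STABLE-c4-1-g7.md`. v1.6 content unchanged above it.
v1.6 (g5, 2026-08-29): § `LiftLaws` appended (ROW CC = scalar-class collision on a forced splitting, a sharpening of CA1 to
the degrees of ONE door: `DirectSumDatum.not_isISemiregular_of_blockCancellationOn` ∕ `_of_scalarCollision`; BLOCK BUDGET `c ≤ |I|` and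
LINE BUDGET `c ≤ 2` as linear algebra; the colour-1 τ-LIFT law at letter level: `movedFactors`, `LiftLive`, `liftBlockCount`,
`liftBlockCount_eq_one_iff`; the arithmetic heart of LEMMA τ's null clause `one_add_i_dvd_add_of_norm_eq`; lift-invariance of the
class screen `classScreen_nsmul` and of the Bogomolov∕Simpson data; lifted ROW BD certificates); memo `C4-LIFT-LAWS-c4-1-g5.md`.
v1.5 content unchanged above it (one import added: `Pad4TowerClassScreen`, for `ClassScreen`).
v1.5 (g4, 2026-08-29): § `SlopeDiscipline` appended (boundary-slope law of two-term rooms = `DownWindow`∕`UpWindow`, edge-forced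
semistability = `DownEdge`∕`UpEdge`, `SemistableDead`∕`SimpsonClass`, block destabilisers = ROW BD (`BlockDestabDatum.Destabilises`),
ROW HZ; numeric certificates on the live TW-32b addresses); memo `C4-SLOPE-DISCIPLINE-c4-1-g4.md`. v1.4 content unchanged above it.
v1.4 (g3, 2026-08-29): § `SeedEndomorphismStructure` appended (LEMMA C = `End`-centrality of `Ext²` behind a door, kernel-checked
over the tree's `AtiyahTraceAlgebra`; THEOREM CA1 = block obstruction ⟹ no door for ANY `I`; PROP F ∕ TDT = tangent–determinant
floor `ker f = ⋂_{k∈I} ker Φ_k`; the cell's numbers); memo `C4-SEED-END-STRUCTURE-c4-1-g3.md`. v1.3 content unchanged above it.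
v1.3 (g2, 2026-08-29): § `DegeneracyBridge` appended (LEMMA KC-EN, the frame sequence, THEOREM DL = frame obstruction,
COROLLARY DL₀; memo `C4-DEGENERACY-LOCI-c4-1-g2.md`); v1.2∕v1.1 content unchanged above it.
v1.2 (g1, 2026-08-29): §§ `KoszulBridge`, `TwistedVanishing`, `SigmaAvoidance` appended (director R19.202 Q2, R19.218 (c),
R19.222 (4); STRENGTHEN MEMO-03 ASK-2); memo `C4-KOSZUL-COMPAT-c4-1-g1.md`. v1.1 content (g0) unchanged above the new sections.

HONEST FRAMING. This file is a TYPING SPEC of the cell `pub-hsemireg` (unit `hsemireg-c4-1`, MINT req-80 A4∕C4). It defines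
COMBINATORIAL predicates on a letter design (cells of `X = E_i^8` in the balanced frame `BPoint = (α, x, y)` per factor,
`MCell = Fin 4 → BPoint`, live order `MCell.le` = "difference effective on every factor") and records, in docstrings, the
sheaf-level statement each predicate CERTIFIES for the cohomology sheaf `𝓔 = ker q ∕ im i` of ANY monad
`A —i→ N —q→ C` (or any presentation with positive part `N`, negative part `P = A ⊕ C`) realising the design with `𝓔`
torsion-free, w.r.t. the principal product polarisation `Θ = Σ_f (u_f + v_f)` (`μ_Θ(L_Z) = 10080 · slopeUnits Z`).
The proofs are in the memo `pub/pub-hsemireg/hsemireg-c4-1/C4-STABILITY-c4-1-g0.md` §2 (pen, half a page each); NOTHING in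
this file is a theorem about sheaves, nothing is asserted about any explicit variety, and nothing here is a rung toward
`stub_rung_pad4_seedAt` ∕ 18881 ∕ HC. No `sorry`, no new axioms, no instances, no notation.

Dictionary (memo §1): a cell `Z` ↦ the line bundle `L_Z = ⊠_f L_{Z f}` (canonical Pic⁰ lift); `Hom(L_P, L_Z) ≠ 0 ⟺ P ≤ Z`;
under the canonical lift `h⁰(L_Z ⊗ L_P⁻¹) = homDim P Z = ∏_f kFactor (Z f − P f)` with `kFactor 0 = 1`,
`kFactor Δ = gcd(Δ)` for `Δ ≠ 0` isotropic (`Δ = d ·` fibre class of an elliptic fibration, `h⁰ = d`), `kFactor Δ = det Δ`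
for `Δ` positive definite (Mumford index 0). `ν(Z) = m_N(Z) − m_P(Z)`; `rank 𝓔 = Σ ν`; `deg`-numerator
`degNum = Σ ν(Z) · slopeUnits Z = 4 · q₁ = rank · s(𝓔)` (`q₁` = the `H`-coefficient of `c₁(𝓔)`; `s(𝓔) := 4 q₁ ∕ rank` = the slope
of `𝓔` in letter units, `μ_Θ(𝓔) = 10080 · s(𝓔)`; `s(𝓔) = q₁` for rank 4).
-/

namespace Summit.Ventures.HSemireg.Pad4Tower.C4Stability

open Finset Summit.Ventures.HSemireg.Pad4Tower

/-! ## Letter cohomology under the canonical Pic⁰ lift -/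

/-- `h⁰` factor of one balanced block difference `Δ = (Δα, Δx, Δy)` ASSUMED effective: `1` for `Δ = 0`; `gcd(Δα, Δx, Δy)`
for `Δ ≠ 0` isotropic (`Δx² + Δy² = Δα²`: `Δ = d · F`, `F` a fibre class, `h⁰(𝒪(dF)) = d` under the canonical lift);
`det Δ = Δα² − Δx² − Δy²` for `Δ` positive definite (`h⁰ = χ = det`, Mumford index `0`). -/
def kFactor (Δ : BPoint) : ℤ :=
  if Δ = (0, 0, 0) then 1
  else if Δ.2.1 ^ 2 + Δ.2.2 ^ 2 = Δ.1 ^ 2 then (Int.gcd (Int.gcd Δ.1 Δ.2.1 : ℤ) Δ.2.2 : ℤ)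
  else Δ.1 ^ 2 - Δ.2.1 ^ 2 - Δ.2.2 ^ 2

/-- `homDim P Z = dim Hom(L_P, L_Z) = h⁰(L_Z ⊗ L_P⁻¹)` under the CANONICAL Pic⁰ lift: `0` unless `P ≤ Z`, else the
product of the four `kFactor`s (Künneth for `⊠`). Under another Pic⁰ labelling the true value is `≤` this one
(degenerate factors can drop to `0`); every certificate below that uses `homDim` is therefore a CANONICAL-LIFT statement
(director's RULE A: name the labelling), except `MaxCellDestab` ∕ `MinCellDestab`, which are labelling-free. -/
def homDim (P Z : MCell) : ℤ :=
  if MCell.le P Z then ∏ f, kFactor (bsub (Z f) (P f)) else 0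

/-- Slope unit of a cell: `s(Z) = Σ_f α_f`; `μ_Θ(L_Z) = c₁(L_Z) · Θ⁷ = 10080 · s(Z)` on `E_i^8` (`Θ⁸ = 40320`). -/
def slopeUnits (Z : MCell) : ℤ := ∑ f, (Z f).1

/-! ## Designs -/

/-- A (virtual) letter design: finite support and the two multiplicity functions (`N` = middle ∕ positive term,
`P = A ⊕ C` = outer ∕ negative terms). Values off `cells` are ignored by every predicate below. -/
structure LetterDesign where
  cells : Finset MCell
  mN : MCell → ℕ
  mP : MCell → ℕ

/-- A split design: a letter design together with the split `P = A ⊕ C` of a three-term monad `A → N → C`. -/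
structure SplitDesign extends LetterDesign where
  mA : MCell → ℕ
  mC : MCell → ℕ

namespace LetterDesign

/-- `ν(Z) = m_N(Z) − m_P(Z)`. -/
def nu (D : LetterDesign) (Z : MCell) : ℤ := (D.mN Z : ℤ) - D.mP Z

/-- `rank 𝓔 = Σ_Z ν(Z)`. -/
def rank (D : LetterDesign) : ℤ := ∑ Z ∈ D.cells, D.nu Z

/-- `degNum = Σ_Z ν(Z) · s(Z) = 4 · q₁ = rank(𝓔) · s(𝓔)` (`c₁(𝓔) = q₁ H`; `s(𝓔) = 4 q₁ ∕ rank`, `= q₁` for rank 4). -/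
def degNum (D : LetterDesign) : ℤ := ∑ Z ∈ D.cells, D.nu Z * slopeUnits Z

/-- `μ_Θ(L_Z) > μ_Θ(𝓔)` (division-free; meaningful for `0 < rank`). -/
def SlopeAbove (D : LetterDesign) (Z : MCell) : Prop := D.degNum < D.rank * slopeUnits Z

/-- `μ_Θ(L_Z) < μ_Θ(𝓔)`. -/
def SlopeBelow (D : LetterDesign) (Z : MCell) : Prop := D.rank * slopeUnits Z < D.degNum

/-- `Z` is a design cell with no other design cell above it in the live order. -/
def IsMaximalCell (D : LetterDesign) (Z : MCell) : Prop :=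
  Z ∈ D.cells ∧ ∀ W ∈ D.cells, (0 < D.mN W ∨ 0 < D.mP W) → MCell.le Z W → W = Z

/-- `Z` is a design cell with no other design cell below it. -/
def IsMinimalCell (D : LetterDesign) (Z : MCell) : Prop :=
  Z ∈ D.cells ∧ ∀ W ∈ D.cells, (0 < D.mN W ∨ 0 < D.mP W) → MCell.le W Z → W = Z

/-- Canonical-lift UP-count `D(Z) = Σ_{W ≥ Z} h⁰(W − Z) · ν(W) = h⁰(N(−Z)) − h⁰(P(−Z))`. -/
def upCount (D : LetterDesign) (Z : MCell) : ℤ := ∑ W ∈ D.cells, homDim Z W * D.nu W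

/-- Canonical-lift DOWN-count `D∨(Z) = Σ_{W ≤ Z} h⁰(Z − W) · ν(W) = h⁰(N∨(Z)) − h⁰(P∨(Z))`. -/
def downCount (D : LetterDesign) (Z : MCell) : ℤ := ∑ W ∈ D.cells, homDim W Z * D.nu W

/-- **Certificate (A), labelling-free** (memo §2.3, Thm A). If a MAXIMAL design cell `Z` has `ν(Z) > 0` then for every
monad on the design (any maps, ANY Pic⁰ labelling) with `𝓔` torsion-free, `𝓔` contains a nonzero subsheaf of slope
`≥ μ_Θ(L_Z)` (a quotient of copies of `L_Z`); with `μ_Θ(L_Z) > μ_Θ(𝓔)` this makes `𝓔` μ_Θ-UNSTABLE. -/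
def MaxCellDestab (D : LetterDesign) : Prop :=
  ∃ Z ∈ D.cells, D.IsMaximalCell Z ∧ 0 < D.nu Z ∧ D.SlopeAbove Z

/-- **Certificate (A∨), labelling-free** (dual of (A) through the dual monad `C∨ → N∨ → A∨`): a MINIMAL design cell with
`ν > 0` and `μ_Θ(L_Z) < μ_Θ(𝓔)` gives a rank-one torsion-free quotient of `𝓔` of slope `≤ μ_Θ(L_Z)`: `𝓔` μ_Θ-unstable. -/
def MinCellDestab (D : LetterDesign) : Prop :=
  ∃ Z ∈ D.cells, D.IsMinimalCell Z ∧ 0 < D.nu Z ∧ D.SlopeBelow Z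

/-- **Certificate (D), canonical lift** (memo §2.4): `D(Z) > 0 ⟹ Hom(L_Z, 𝓔) ≠ 0` (dimension count through the display:
`dim Hom(L_Z, 𝓔) ≥ h⁰(N(−Z)) − h⁰(C(−Z)) − h⁰(A(−Z))`), hence `L_Z ↪ 𝓔`; with `μ(L_Z) > μ(𝓔)`: unstable. -/
def UpCountDestab (D : LetterDesign) : Prop :=
  ∃ Z ∈ D.cells, 0 < D.upCount Z ∧ D.SlopeAbove Z

/-- **Certificate (D∨), canonical lift**: `D∨(Z) > 0 ⟹ Hom(𝓔, L_Z) ≠ 0`; with `μ(L_Z) < μ(𝓔)`: unstable. -/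
def DownCountDestab (D : LetterDesign) : Prop :=
  ∃ Z ∈ D.cells, 0 < D.downCount Z ∧ D.SlopeBelow Z

/-- **Certificate (NS), canonical lift** (memo §2.5; the rank-one-endomorphism argument of [OSS, Ch. I Lemma 4.1.3]):
`Z' ≤ Z`, `D∨(Z') > 0`, `D(Z) > 0` give `𝓔 → L_{Z'} → L_Z → 𝓔` nonzero of rank one, so `h⁰(End 𝓔) ≥ 2`:
`𝓔` is NOT SIMPLE (for `rank 𝓔 ≥ 2`). -/
def ForcedNonSimple (D : LetterDesign) : Prop :=
  ∃ Z' ∈ D.cells, ∃ Z ∈ D.cells, MCell.le Z' Z ∧ 0 < D.downCount Z' ∧ 0 < D.upCount Z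

/-- The STABILITY CUTS a design must satisfy to leave μ_Θ-stability of `𝓔` possible under the canonical lift (necessary, not
sufficient; linear in `ν` once `degNum`∕`rank` are fixed): no up-count destabiliser and no down-count destabiliser. -/
def StabilityCuts (D : LetterDesign) : Prop := ¬ D.UpCountDestab ∧ ¬ D.DownCountDestab

/-- Bogomolov number `B_r = q₁² − r · q₂` of a rank-`r` class `ch = Σ q_k Hᵏ∕k! + w` (`Δ(𝓔) = c₁² − 2r · ch₂ = B_r · H²`,
`Δ(𝓔) · Θ⁶ = 40320 · B_r`); μ_Θ-semistable torsion-free ⟹ `B_r ≥ 0` [HuybrechtsLehn Thm 3.4.1 + Mehta–Ramanathan]; on an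
(A1)-clean LINE design of height `n`, `B_r = ρ₁²` with `ρ₁ = q₁ − r n` automatically (memo §2.1). -/
def bogomolovNumber (r q₁ q₂ : ℤ) : ℤ := q₁ ^ 2 - r * q₂

/-- The three LINE designs of record: `B_4 = ρ₁²` (S′ ac808a66: `q₁ = −1648, q₂ = −46928, ρ₁ = −1704`). -/
example : bogomolovNumber 4 (-1648) (-46928) = (-1704) ^ 2 := by decide

/-- **Certificate (S)** (memo §2.2): on an (A1)-clean LINE design of height `n` (`ch(𝓔) = e^{nH}(r + ρ₁ H + w)`),
CHARGE BALANCE `ρ₁ = 0` (equivalently `degNum = 4 n · rank`, i.e. `s(𝓔) = s(apex)`) together with `μ ≠ 0` OBSTRUCTS every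
μ_Θ-semistable locally free realisation: `𝓔(−nΘ)` would be semistable with `c₁ = 0`, `ch₂ · Θ⁶ = 0`, hence an extension
of flat bundles [Simpson 1992, Thm 2 ∕ Cor. 3.10], so `ch₄ = 0`, contradicting `w ≠ 0`. (`μ` given by its two integer
coordinates `(Re μ, Im μ)` in `ℤ[i]`.) -/
def SimpsonObstructed (D : LetterDesign) (n : ℕ) (μre μim : ℤ) : Prop :=
  D.degNum = 4 * n * D.rank ∧ (μre ≠ 0 ∨ μim ≠ 0)

end LetterDesign

namespace SplitDesign

/-- Live arrow of the three-term monad: `a → n` (`a ≤ n`, `m_A(a), m_N(n) > 0`) or `n → c` (`n ≤ c`). -/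
def LiveAdj (S : SplitDesign) (X Y : MCell) : Prop :=
  (0 < S.mA X ∧ 0 < S.mN Y ∧ MCell.le X Y) ∨ (0 < S.mN X ∧ 0 < S.mC Y ∧ MCell.le X Y)

/-- The live graph (arrows forgotten) is connected on the design cells. -/
def LiveConnected (S : SplitDesign) : Prop :=
  ∀ X ∈ S.cells, ∀ Y ∈ S.cells, Relation.ReflTransGen (fun a b => S.LiveAdj a b ∨ S.LiveAdj b a) X Y

/-- **Certificate (C)** (memo §2.5): a DISCONNECTED live graph forces the monad, hence `𝓔`, to be a direct sum over the
components for ANY maps; if two components carry positive rank, `𝓔` is decomposable (so not simple, never stable); a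
component of negative rank `Σ ν < 0` shows NO monad exists on the design with these arrows. -/
def ForcedSplitting (S : SplitDesign) : Prop := ¬ S.LiveConnected

/-- An `N`-cell with no `C`-cell above it: `L_n^{m_N} ⊂ ker q` for every `q` (the "C-free" cells of the (B1) reduction). -/
def QInvisible (S : SplitDesign) (Z : MCell) : Prop :=
  Z ∈ S.cells ∧ 0 < S.mN Z ∧ ∀ W ∈ S.cells, 0 < S.mC W → ¬ MCell.le Z W

/-- A FREE SUMMAND: an `N`-cell with no `C`-cell above and no `A`-cell below; then `L_Z^{m_N(Z)}` is a direct summand of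
`𝓔` for any maps (decomposable unless it is everything). -/
def FreeSummand (S : SplitDesign) (Z : MCell) : Prop :=
  S.QInvisible Z ∧ ∀ W ∈ S.cells, 0 < S.mA W → ¬ MCell.le W Z

/-- Hypotheses of the letter-level SIMPLICITY TRANSFER [OSS, Ch. II Lemma 4.1.3] for `M = M'`: `Hom(N, A) = Hom(C, N) = 0`
(no live arrow `n → a`, `c → n`) — the `H¹`∕`H²` hypotheses `H¹(C∨⊗A) = H¹(N∨⊗A) = H¹(C∨⊗N) = H²(C∨⊗A) = 0` are NOT
expressible by the live order alone and FAIL on LINE designs (memo §2.6: `h¹(d · F) = d > 0`), so this predicate is only the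
`Hom`-half; when the full lemma applies, `End 𝓔 = End(monad)`. -/
def OSSHomHalf (S : SplitDesign) : Prop :=
  (∀ n ∈ S.cells, ∀ a ∈ S.cells, 0 < S.mN n → 0 < S.mA a → MCell.le n a → False) ∧
  (∀ c ∈ S.cells, ∀ n ∈ S.cells, 0 < S.mC c → 0 < S.mN n → MCell.le c n → False)

end SplitDesign

/-! ## Sanity of the letter cohomology table (the definitions compute; these are NOT rungs) -/

/-- One LINE step `(1, −1, 0)` (charge drop by one along the line of phase `−1`): isotropic, `h⁰ = gcd = 1`. -/
example : kFactor (1, -1, 0) = 1 := by decide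
/-- Three LINE steps: `h⁰ = 3`. -/
example : kFactor (3, 0, -3) = 3 := by decide
/-- A positive definite difference `(3, 1, 1)`: `h⁰ = det = 7`. -/
example : kFactor (3, 1, 1) = 7 := by decide
/-- The zero difference: `h⁰(𝒪) = 1`. -/
example : kFactor (0, 0, 0) = 1 := by decide

/-! ## Koszul bridge (v1.2, g1): Bloch's map of a zero locus `Z(s_t)` versus the Buchweitz–Flenner map of the bundle

SETTING (memo `C4-KOSZUL-COMPAT-c4-1-g1.md` §1). `X` smooth projective (the anchor `S⁴`, `dim X = 8`), `𝓔` locally free of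
rank `4`, `t ≫ 0` so that `𝓔(t) := 𝓔 ⊗ 𝒪(tH)` is globally generated with `H¹(𝓔(t)) = H²(𝓔(t)) = 0`, `s_t ∈ H⁰(𝓔(t))` regular,
`Z_t = Z(s_t)` smooth of codimension `4`, `N_{Z_t∕X} = 𝓔(t)|_{Z_t}`. The Koszul resolution `Λ•𝓔(t)^∨ → 𝒪_{Z_t}` gives the
KOSZUL ISOMORPHISM `κ_t : H¹(Z_t, N) ≅ Ext²(𝓔, 𝓔)` (hypercohomology spectral sequence: only the `Λ¹ ⊗ 𝓔(t) = End 𝓔` column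
survives in total degree `1`). The two seed doors of record are Bloch-semiregularity of `Z_t` (`IsBlochSemiregular 3`: the
map `π_{Z_t} : H¹(Z_t, N) → H⁵(X, Ω³)` is injective; `HasBlochSeedAt`) and `I`-semiregularity of `𝓔` (`IsISemiregular`;
`HasBFSheafSeedAt … I`). They are compared through ONE identity of linear maps `H¹(Z_t, N) → H⁵(X, Ω³)`:

LEMMA KC (PEN, memo §2; proved from [BF03, Prop. 8.2 + Lemma 8.4 ∕ 8.5] — `π_Z = σ^{𝒪_Z}_{p−1} ∘ ε²` and the Koszul
description of `At(𝒪_Z)` — by the supertrace identity `Σ_j (−1)^j tr_{Λ^j}(Λ^j g · dΛ^j(N)) = −det(1 − g) tr((1 − g)⁻¹ g N)`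
and the splitting principle; three independent checks: the divisor case `p = 1` (classical), the vanishing of the
components below the codimension, and Bloch's formula `π(θ̄) = θ ⌟ [Z]` on Kodaira–Spencer classes via [BF03, Prop. 4.2]):
    `π_{Z_t} ∘ κ_t⁻¹ = ± δc₄(𝓔(t)) := ± Σ_{q=0}^{3} (∂c₄∕∂ch_{q+1})(𝓔(t)) ∪ σ_q = ±( c₃(𝓔(t))∪σ₀ − c₂(𝓔(t))∪σ₁ + 2c₁(𝓔(t))∪σ₂ − 6σ₃ )`,
`σ_q = tr(∗ · (−At)^q)∕q!` the BF components of `𝓔` [BF03, Def. 4.1] (for `𝓔(t)` they differ from those of `𝓔` by a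
unitriangular change, same kernel flags), `c_k(𝓔(t)) = Σ_i C(4−i, k−i) c_i(𝓔) (tH)^{k−i}`; equivalently
`π_{Z_t} ∘ κ_t⁻¹ = ±(R₃ + tH·R₂ + t²H²·R₁ + t³H³·R₀)`, `R_k = δc_{k+1}(𝓔) = Σ_{m ≤ k} (−1)^m m! c_{k−m}(𝓔) ∪ σ_m`. In words:
Bloch's map of the zero locus is the FIRST VARIATION OF THE TOP CHERN CLASS `[Z_t] = c₄(𝓔(t))`, NOT the bare component
`σ₃` (the «naive» form `π = c·σ₃ ∘ κ` asked about in R19.202 Q2 is therefore NOT an identity for `t ≠ 0`; see `IsNaive`).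
The global sign and the normalisation of `κ_t` are convention-dependent; every consequence below is sign-free.

TYPING. The tree's semiregularity layer is the abstract `AtiyahTraceAlgebra` ∕ `SubspaceAtiyahTraceAlgebra` of
`Literature/…/SemiregularityMap.lean` (no cup product on `Coh`, no Chern classes `c_k`), so the coefficient maps
«`∪ (±(−1)^q q! c_{3−q}(𝓔(t)))`» enter as DATA (`ChernMixing`), hypothesis-structure style; `KoszulCompat` is the Prop
«LEMMA KC holds for this data». CONSEQUENCES (all PROVED below, pure linear algebra): (1) DOOR DOMINANCE
`isISemiregular_of_koszulCompat`: `Z_t` Bloch-semiregular ⟹ `𝓔` is `{0,1,2,3}`-semiregular — the cycle door through a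
zero locus is NEVER weaker than the (weakest, `I = {1,2,3,4}`) sheaf door, so for bundle∕monad designs a success at
`HasBlochSeedAt` via `Z(s_t)` is already a success at `HasBFSheafSeedAt … {1,2,3,4}`; (2) EXACT DEFECT
`isBlochSemiregular_iff_injective_deltaC4`: `Z_t` Bloch-semiregular ⟺ `δc₄(𝓔(t))` injective on `Ext²(𝓔, 𝓔)`;
(3) `isBlochSemiregular_iff_isKSemiregular_three_of_naive`: under the naive form the two doors would coincide with
`3`-semiregularity — recorded only to show what the naive form would have meant.
NOTHING here is a theorem about a sheaf or a variety; LEMMA KC itself is pen (memo §2), not kernel-checked; no rung toward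
`stub_rung_pad4_seedAt` ∕ 18881 ∕ 26512 ∕ №4 ∕ H2 ∕ HC.
References: [BF03] Buchweitz–Flenner, Compositio Math. 137 (2003), arXiv:math/9912245, Def. 4.1, Prop. 4.2, §5 (I-semiregular),
(8.1), Prop. 8.2, Lemma 8.4, Lemma 8.5; [IM11] Iacono–Manetti, arXiv:1112.0425, Main Theorem (zero loci of sections: `τ∘π`
annihilates all obstructions); [Blo72] Bloch, Invent. Math. 17 (1972) (cite-only, via BF Prop. 8.2); [Pri12] Pridham,
arXiv:1208.3111 (semiregularity as the derivative of the Chern character; conceptual form of KC).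
-/

section KoszulBridge

universe u v

open Literature.AlgebraicGeometry.HodgeTheory

variable {𝕜 : Type u} [CommRing 𝕜]

/-- The CHERN-MIXING DATA of LEMMA KC for a rank-4 bundle in codimension 4: the three lower coefficient maps
`m_q = ∪ (±(−1)^q q! · c_{3−q}(𝓔(t))) : H^{q+2}(X, Ω^q) → H⁵(X, Ω³)` (`q = 0, 1, 2`; for `𝓔(t)`:
`m₀ = ±∪c₃(𝓔(t))`, `m₁ = ∓∪c₂(𝓔(t))`, `m₂ = ±2∪c₁(𝓔(t))`) and the top scalar `u = ∓6 = ±(−1)³·3!`. Abstract DATA over the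
tree's `AtiyahTraceAlgebra` of `𝓔(t)` (which has no cup product ∕ Chern classes); memo §2 gives the values.
[cite: BuchweitzFlenner2003, Def. 4.1 and Prop. 8.2] -/
structure ChernMixing (A : AtiyahTraceAlgebra.{u, v} 𝕜) where
  /-- `m₀ : H²(𝒪) → H⁵(Ω³)`, for `𝓔(t)`: cup with `±c₃(𝓔(t)) = ±(c₃ + 2c₂·tH + 3c₁·t²H² + 4t³H³)`. -/
  m0 : A.Coh 2 0 →ₗ[𝕜] A.Coh 5 3
  /-- `m₁ : H³(Ω¹) → H⁵(Ω³)`, for `𝓔(t)`: cup with `∓c₂(𝓔(t)) = ∓(c₂ + 3c₁·tH + 6t²H²)`. -/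
  m1 : A.Coh 3 1 →ₗ[𝕜] A.Coh 5 3
  /-- `m₂ : H⁴(Ω²) → H⁵(Ω³)`, for `𝓔(t)`: cup with `±2c₁(𝓔(t)) = ±2(c₁ + 4tH)`. -/
  m2 : A.Coh 4 2 →ₗ[𝕜] A.Coh 5 3
  /-- The top coefficient, for `𝓔(t)`: `∓6` (a unit in characteristic `0`). -/
  u : 𝕜

namespace ChernMixing

variable {A : AtiyahTraceAlgebra.{u, v} 𝕜} (M : ChernMixing A)

/-- `δc₄ := m₀ ∘ σ₀ + m₁ ∘ σ₁ + m₂ ∘ σ₂ + u · σ₃ : Ext²(𝓔, 𝓔) → H⁵(X, Ω³)` — the first variation of the top Chern class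
`c₄(𝓔(t)) = [Z_t]` in the direction of an obstruction class (memo §2: `δc₄ = Σ_q (∂c₄∕∂ch_{q+1}) ∪ σ_q`).
[cite: BuchweitzFlenner2003, Def. 4.1 and Prop. 4.2] -/
noncomputable def deltaC4 : A.Ext 2 0 →ₗ[𝕜] A.Coh 5 3 :=
  M.m0 ∘ₗ A.semiregularityComponent 0 + M.m1 ∘ₗ A.semiregularityComponent 1 +
    M.m2 ∘ₗ A.semiregularityComponent 2 + (M.u • A.semiregularityComponent 3 : A.Ext 2 0 →ₗ[𝕜] A.Coh 5 3)

theorem deltaC4_apply (x : A.Ext 2 0) :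
    M.deltaC4 x = M.m0 (A.semiregularityComponent 0 x) + M.m1 (A.semiregularityComponent 1 x) +
      M.m2 (A.semiregularityComponent 2 x) + M.u • A.semiregularityComponent 3 x :=
  rfl

/-- `δc₄` vanishes on the joint kernel of `σ₀, …, σ₃` (the only input of DOOR DOMINANCE). -/
theorem deltaC4_eq_zero_of_sigma_eq_zero {x : A.Ext 2 0} (h : ∀ k ≤ 3, A.semiregularityComponent k x = 0) :
    M.deltaC4 x = 0 := by
  rw [deltaC4_apply, h 0 (by norm_num), h 1 (by norm_num), h 2 (by norm_num), h 3 le_rfl]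
  simp

/-- The «NAIVE» form of the Koszul compatibility (R19.202 Q2 as first asked: `π_{Z_t} = c · σ₃ ∘ κ_t`, `c` a unit): no
lower mixing. By LEMMA KC this is NOT the case for `𝓔(t)`, `t ≠ 0` (`m₀ = ±∪c₃(𝓔(t))` has leading term `±4t³ ∪H³ ≠ 0` on
`H²(𝒪)` by hard Lefschetz); recorded to make precise what the naive form would have implied (`…_of_naive` below). -/
def IsNaive : Prop :=
  M.m0 = 0 ∧ M.m1 = 0 ∧ M.m2 = 0 ∧ IsUnit M.u

theorem deltaC4_apply_of_isNaive (h : M.IsNaive) (x : A.Ext 2 0) :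
    M.deltaC4 x = M.u • A.semiregularityComponent 3 x := by
  obtain ⟨h0, h1, h2, -⟩ := h
  simp [deltaC4_apply, h0, h1, h2]

end ChernMixing

/-- **`KoszulCompat`** (LEMMA KC as a typed hypothesis; R19.202 Q2 ∕ C7-bis). Data: `A` = the Atiyah–trace algebra of
`𝓔(t)` on `X`, `B` = the subspace algebra of `Z_t = Z(s_t) ⊂ X` (`B.T2 = H¹(Z_t, N)`, `B.blochSemiregularityMap 3 = π_{Z_t}`
by [BF03, Prop. 8.2]), `κ` = the Koszul isomorphism `H¹(Z_t, N) ≅ Ext²(𝓔, 𝓔)` (`t ≫ 0`), `ι` = the identification of the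
common target `H⁵(X, Ω³)` seen from `B` and from `A` (same `X`; injective), `M` = the Chern-mixing data. Statement:
`ι ∘ π_{Z_t} = δc₄ ∘ κ`. PEN-PROVED for zero loci of regular sections with the values of memo §2 (up to a global sign
absorbed in `ι` or `M`); typed here as a Prop so that consumers can take it as a hypothesis.
[cite: BuchweitzFlenner2003, Prop. 8.2, Lemma 8.4, Def. 4.1] [cite: IaconoManetti2011 arXiv:1112.0425, Main Theorem (set-up: `Z = Z(f)`, `rk E = codim`)] -/
def KoszulCompat (A : AtiyahTraceAlgebra.{u, v} 𝕜) (B : SubspaceAtiyahTraceAlgebra.{u, v} 𝕜)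
    (κ : B.T2 ≃ₗ[𝕜] A.Ext 2 0) (ι : B.Coh 5 3 →ₗ[𝕜] A.Coh 5 3) (M : ChernMixing A) : Prop :=
  ∀ t : B.T2, ι (B.blochSemiregularityMap 3 t) = M.deltaC4 (κ t)

variable {A : AtiyahTraceAlgebra.{u, v} 𝕜} {B : SubspaceAtiyahTraceAlgebra.{u, v} 𝕜}
  {κ : B.T2 ≃ₗ[𝕜] A.Ext 2 0} {ι : B.Coh 5 3 →ₗ[𝕜] A.Coh 5 3} {M : ChernMixing A}

/-- **DOOR DOMINANCE** (memo §3 (C1)). Under LEMMA KC: if the zero locus `Z_t` is Bloch-semiregular then the bundle `𝓔` is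
`{0,1,2,3}`-semiregular (form degrees; = BF's `I = {1,2,3,4}`), i.e. `𝓔` passes the WEAKEST sheaf door
`HasBFSheafSeedAt … {1,2,3,4}` whenever `Z(s_t)` passes the cycle door. Proof: `ker(σ₀,…,σ₃) ⊆ ker(δc₄) = κ(ker π_{Z_t})`.
Consequence for the cell: for bundle∕monad∕zero-locus designs the cycle door is REDUNDANT — it can only be harder than the
sheaf door with `I = {1,2,3,4}` (and BF Thm. 5.1 then already moves `ch₄(𝓔) ∋ w` along the Weil family). It says nothing
about cycles `Z` that are not zero loci of regular sections with the Koszul vanishings. -/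
theorem isISemiregular_of_koszulCompat (hKC : KoszulCompat A B κ ι M) (hι : Function.Injective ι)
    (hZ : B.IsBlochSemiregular 3) : A.IsISemiregular {k | k ≤ 3} := by
  intro x hx
  have hδ : M.deltaC4 x = 0 := M.deltaC4_eq_zero_of_sigma_eq_zero fun k hk => hx k hk
  have hπ : B.blochSemiregularityMap 3 (κ.symm x) = 0 := by
    apply hι
    rw [hKC, LinearEquiv.apply_symm_apply, hδ, map_zero]
  have hk : κ.symm x = 0 := hZ (hπ.trans (map_zero _).symm)
  calc x = κ (κ.symm x) := (κ.apply_symm_apply x).symm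
    _ = 0 := by rw [hk, map_zero]

/-- DOOR DOMINANCE for any index set containing the form degrees `0, …, 3` (e.g. the sheaf door's `{q' | q' + 1 ∈ I}` with
`{1,2,3,4} ⊆ I`). [cite: BuchweitzFlenner2003, §5 (I-semiregular)] -/
theorem isISemiregular_of_koszulCompat_of_subset (hKC : KoszulCompat A B κ ι M) (hι : Function.Injective ι)
    (hZ : B.IsBlochSemiregular 3) {J : Set ℕ} (hJ : {k | k ≤ 3} ⊆ J) : A.IsISemiregular J :=
  (isISemiregular_of_koszulCompat hKC hι hZ).mono hJ

/-- **EXACT DEFECT** (memo §3 (C2)). Under LEMMA KC the cycle door is EQUIVALENT to injectivity of `δc₄(𝓔(t))` on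
`Ext²(𝓔, 𝓔)`: `Z_t` Bloch-semiregular ⟺ `δc₄ = m₀σ₀ + m₁σ₁ + m₂σ₂ + u σ₃` injective. (For `t ≫ 0` generic the kernel of
`δc₄(𝓔(t)) = R₃ + tH R₂ + t²H² R₁ + t³H³ R₀` is the generic kernel of a polynomial pencil; on the trace part `H²(𝒪)·id` it is
`0` by hard Lefschetz, memo §3.) -/
theorem isBlochSemiregular_iff_injective_deltaC4 (hKC : KoszulCompat A B κ ι M) (hι : Function.Injective ι) :
    B.IsBlochSemiregular 3 ↔ Function.Injective M.deltaC4 := by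
  constructor
  · intro hπ x y hxy
    have hs : ι (B.blochSemiregularityMap 3 (κ.symm x)) = ι (B.blochSemiregularityMap 3 (κ.symm y)) := by
      rw [hKC, hKC, LinearEquiv.apply_symm_apply, LinearEquiv.apply_symm_apply, hxy]
    have h := hπ (hι hs)
    simpa using congrArg κ h
  · intro hδ s t hst
    have h : M.deltaC4 (κ s) = M.deltaC4 (κ t) := by rw [← hKC, ← hKC, hst]
    exact κ.injective (hδ h)

/-- What the NAIVE form would have meant: the cycle door = `3`-semiregularity of `𝓔` (injectivity of `σ₃` alone). Since
the naive form fails for `t ≠ 0` (LEMMA KC), this equivalence is NOT available; the honest statements are the two above. -/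
theorem isBlochSemiregular_iff_isKSemiregular_three_of_naive (hKC : KoszulCompat A B κ ι M)
    (hι : Function.Injective ι) (hN : M.IsNaive) : B.IsBlochSemiregular 3 ↔ A.IsKSemiregular 3 := by
  rw [isBlochSemiregular_iff_injective_deltaC4 hKC hι]
  have hδ := M.deltaC4_apply_of_isNaive hN
  have hu : IsUnit M.u := hN.2.2.2
  unfold AtiyahTraceAlgebra.IsKSemiregular
  constructor
  · intro h x y hxy
    apply h
    rw [hδ, hδ, hxy]
  · intro h x y hxy
    rw [hδ, hδ] at hxy
    exact h (hu.smul_left_cancel.1 hxy)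

end KoszulBridge

/-! ## Twisted vanishing and the isogeny tower (v1.2, g1): `twistedExt2Vanishes` ∕ `twistedNormalH1Vanishes` (MEMO-03 §3, R19.218)

SETTING. `X = S⁴`, `S = E_i²`; the isogeny `f = [1+i] : X → X`, `G := ker f̂ = X̂[1−i] ≅ (ℤ∕2)^8` (`255` non-trivial
characters `χ`, Poincaré bundles `P_χ`), `f_*𝒪_X = ⊕_{χ ∈ G} P_χ`. ISOGENY–SEMIREGULARITY LEMMA [PEN, STRENGTHEN MEMO-03 §3]:
for `E ∈ Coh X`, `Ext²(f^*E, f^*E) = ⊕_χ Ext²(E, E ⊗ P_χ)`, the BF map of `f^*E` VANISHES on the summands `χ ≠ 0` (translations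
act trivially on `H^*(X, Ω^*)`) and is `f^* ∘ σ_E` on `χ = 0`; hence `f^*E` semiregular ⟺ `E` semiregular ∧
`Ext²(E, E ⊗ P_χ) = 0 ∀ χ ∈ G ∖ 0`; CYCLE VERSION: `f⁻¹Z` Bloch-semiregular ⟺ `Z` Bloch-semiregular ∧
`H¹(Z, N_Z ⊗ P_χ|_Z) = 0 ∀ χ ∈ G ∖ 0` (`f⁻¹Z → Z` étale with group `X[1+i]`). So ONE seed gives a TOWER of seeds
(`[(1+i)^k]^*`, classes dilated along MEMO-02∕03) iff the 255 twisted groups vanish. KOSZUL TRANSLATION (g1, memo §4): for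
`Z_t = Z(s_t)`, `t ≫ 0`, the same Koszul spectral sequence with `𝓔(t) ⊗ P_χ` gives `H¹(Z_t, N ⊗ P_χ|_{Z_t}) ≅ Ext²(𝓔, 𝓔 ⊗ P_χ)`,
so the cycle version and the sheaf version of the condition COINCIDE for zero-locus seeds (`twistedVanishing_iff_of_equiv`).
LITERATURE: for `E` simple semi-homogeneous the jump set `Σ(E) = {χ : H^*(End E ⊗ P_χ) ≠ 0}` is finite [Mukai78, Prop. 7.1 ∕
§6]; for monad bundles the twisted `Ext²` of `End 𝓔` is NOT in print (lit-8 g6 ASK-3). Typed ABSTRACTLY (a finite set `T`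
of characters with neutral element `χ₀`, a family of groups `V χ`); nothing is asserted about any sheaf.
-/

section TwistedVanishing

universe u

variable {𝕜 : Type u} [CommRing 𝕜]

/-- **Twisted vanishing** off the neutral character: `V χ = 0` for every `χ ∈ T`, `χ ≠ χ₀`. INSTANCES OF RECORD (by
docstring, not by construction): `twistedExt2Vanishes 𝓔 := TwistedVanishing X̂[1−i] 0 (χ ↦ Ext²(𝓔, 𝓔 ⊗ P_χ))` [MEMO-03 ASK-2]
and `twistedNormalH1Vanishes Z := TwistedVanishing X̂[1−i] 0 (χ ↦ H¹(Z, N_Z ⊗ P_χ|_Z))` [R19.218 (c)].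
[cite: Mukai1978SemiHomogeneous, Prop. 7.1 (jump sets of semi-homogeneous bundles)] -/
def TwistedVanishing {Χ : Type*} (T : Finset Χ) (χ₀ : Χ) (V : Χ → Type*) [∀ χ, Zero (V χ)] : Prop :=
  ∀ χ ∈ T, χ ≠ χ₀ → ∀ v : V χ, v = 0

/-- KOSZUL TRANSLATION (memo §4): twisted vanishing is transported along any family of injective additive maps — applied to
`H¹(Z_t, N ⊗ P_χ) ≅ Ext²(𝓔, 𝓔 ⊗ P_χ)` (`t ≫ 0`) it identifies `twistedNormalH1Vanishes Z_t` with `twistedExt2Vanishes 𝓔`. -/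
theorem twistedVanishing_of_injective {Χ : Type*} {T : Finset Χ} {χ₀ : Χ} {V W : Χ → Type*}
    [∀ χ, AddCommGroup (V χ)] [∀ χ, AddCommGroup (W χ)] (e : ∀ χ, V χ →+ W χ)
    (he : ∀ χ, Function.Injective (e χ)) (hW : TwistedVanishing T χ₀ W) : TwistedVanishing T χ₀ V :=
  fun χ hχ hne v => he χ (by rw [hW χ hχ hne (e χ v), map_zero])

theorem twistedVanishing_iff_of_equiv {Χ : Type*} {T : Finset Χ} {χ₀ : Χ} {V W : Χ → Type*}
    [∀ χ, AddCommGroup (V χ)] [∀ χ, AddCommGroup (W χ)] (e : ∀ χ, V χ ≃+ W χ) :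
    TwistedVanishing T χ₀ V ↔ TwistedVanishing T χ₀ W :=
  ⟨fun hV => twistedVanishing_of_injective (fun χ => ((e χ).symm : W χ →+ V χ)) (fun χ => (e χ).symm.injective) hV,
    fun hW => twistedVanishing_of_injective (fun χ => (e χ : V χ →+ W χ)) (fun χ => (e χ).injective) hW⟩

/-- **TOWER STEP, linear-algebra skeleton of the isogeny–semiregularity lemma** (MEMO-03 §3): if the obstruction space
upstairs splits as `M × W` (`M` = the `χ = 0` summand = the obstruction space downstairs, `W` = the sum of the twisted
summands) and the semiregularity map upstairs is `π ∘ pr₁` (it kills `W` by translation-equivariance), then it is injective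
iff `π` is injective AND `W = 0`. With `π = π_Z` (resp. `σ_𝓔`) and `W = ⊕_{χ ≠ 0} H¹(Z, N ⊗ P_χ)` (resp. `⊕ Ext²(𝓔, 𝓔 ⊗ P_χ)`):
«`f⁻¹Z` is a seed ⟺ `Z` is a seed ∧ `twistedNormalH1Vanishes Z`» — ONE SEED ⟹ A TOWER exactly under twisted vanishing.
The geometric inputs (the splitting, the equivariance) are PEN (MEMO-03 §3), not constructed here. -/
theorem towerStep_injective_iff {M W C : Type*} [AddCommGroup M] [AddCommGroup W] [AddCommGroup C]
    [Module 𝕜 M] [Module 𝕜 W] [Module 𝕜 C] (π : M →ₗ[𝕜] C) :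
    Function.Injective (fun p : M × W => π p.1) ↔ Function.Injective π ∧ ∀ w : W, w = 0 := by
  constructor
  · intro h
    refine ⟨fun x y hxy => ?_, fun w => ?_⟩
    · have hp : ((x, (0 : W)) : M × W) = (y, 0) := h (by simpa using hxy)
      exact congrArg Prod.fst hp
    · have hp : (((0 : M), w) : M × W) = (0, 0) := h (by simp)
      exact congrArg Prod.snd hp
  · rintro ⟨hπ, hW⟩ ⟨x, w⟩ ⟨y, w'⟩ hxy
    exact Prod.ext (hπ (by simpa using hxy)) (by rw [hW w, hW w'])

end TwistedVanishing

/-! ## Σ-avoidance at letter level (v1.2, g1; R19.222 (4), [Mukai78, Prop. 7.1])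

For a letter `L` (a line bundle `L_Z ⊗ Q`, or a semi-homogeneous piece) write `Σ(L) ⊂ X̂` for its finite JUMP SET (the
characters `χ` at which some `Hⁱ(L ⊗ P_χ)` relevant to the display differs from its generic value; `∅` for a non-degenerate
line bundle, contained in the connected-kernel translate for a degenerate one; finite for simple semi-homogeneous bundles by
[Mukai78, Prop. 7.1]). Σ-AVOIDANCE is the DESIGN-LEVEL PROXY «`(X̂[1−i] ∖ 0) ∩ Σ(letter pair) = ∅` for every pair of letters
of the display»: then every twisted letter-pair group entering the display spectral sequence for `Ext²(𝓔, 𝓔 ⊗ P_χ)` has its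
GENERIC dimension at each `χ ∈ X̂[1−i] ∖ 0`, so `twistedExt2Vanishes 𝓔` reduces to the same bookkeeping as the untwisted
`Ext²` count (it does NOT by itself give vanishing: generic values can be non-zero — LINE designs have `h¹(d·F) = d > 0`
generically, memo §4). Typed abstractly over finite sets; nothing asserted about any sheaf.
-/

section SigmaAvoidance

/-- **Σ-avoidance** of a set of letters (or letter pairs) `letters` with jump sets `jump` (= `Σ(l)`): no non-neutral character of `T`
(= `X̂[1−i]`) lies in any jump set. Decidable on explicit data. [cite: Mukai1978SemiHomogeneous, Prop. 7.1] -/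
def SigmaAvoidance {Χ L : Type*} [DecidableEq Χ] (T : Finset Χ) (χ₀ : Χ) (letters : Finset L)
    (jump : L → Finset Χ) : Prop :=
  ∀ l ∈ letters, Disjoint (T.erase χ₀) (jump l)

/-- Σ-avoidance ⟹ twisted GENERICITY: if the groups `V l χ` of letter `l` take their generic form off `Σ(l)` (here: vanish
off `Σ(l)` — the case of the letter pairs whose generic twisted group is `0`), then under Σ-avoidance they vanish at every
non-neutral character of `T`. (The letters with non-zero generic value are exactly what the proxy cannot discharge.) -/
theorem twistedVanishing_of_sigmaAvoidance {Χ L : Type*} [DecidableEq Χ] {T : Finset Χ} {χ₀ : Χ}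
    {letters : Finset L} {jump : L → Finset Χ} (V : L → Χ → Type*) [∀ l χ, Zero (V l χ)]
    (hgen : ∀ l ∈ letters, ∀ χ, χ ∉ jump l → ∀ v : V l χ, v = 0) (hS : SigmaAvoidance T χ₀ letters jump) :
    ∀ l ∈ letters, TwistedVanishing T χ₀ (V l) := by
  intro l hl χ hχ hne v
  refine hgen l hl χ (fun hmem => ?_) v
  exact Finset.disjoint_left.1 (hS l hl) (Finset.mem_erase.2 ⟨hne, hχ⟩) hmem

end SigmaAvoidance

/-! ## Degeneracy bridge (v1.3, g2): Bloch's map of a corank-one DEGENERACY LOCUS `Z = D₄(φ : V → F₀(t))`, the FRAME SEQUENCE, and the FRAME OBSTRUCTION (THEOREM DL)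

SETTING (memo `C4-DEGENERACY-LOCI-c4-1-g2.md` §1; the rank-8 room of the cell). `X` the abelian 8-fold `S⁴`, `F₀` locally free
of rank `8`, `t ≫ 0`, `G := F₀(t)`, `V` a rank-5 FRAME (`V = 𝒪⁵`, or a Pic⁰-labelled frame `V_ξ = ⊕_k P_{ξ_k}`), `φ : V → G`
general, `Z := D₄(φ) = {rank φ ≤ 4}` — smooth of codimension `4`, `D₃(φ) = ∅`, `[Z] = c₄(G − V) = c₄(G)` (Thom–Porteous;
`c(V) = 1`). PROJECTIVISATION: `g : P := ℙ(V) → X`, `Z ≅ Z̃ := Z(φ̃) ⊂ P`, `φ̃ ∈ H⁰(P, F̃)`, `F̃ := g^*G ⊗ 𝒪_P(1)` of rank `8` on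
the 12-fold `P`; the Koszul hypotheses of LEMMA KC hold on `P` (`𝒪_P(−j)` is `g`-acyclic for `1 ≤ j ≤ 4`), so
`κ_P : H¹(Z̃, N_{Z̃∕P}) ≅ Ext²_P(F̃, F̃) = Ext²_X(F₀, F₀)`, and with `β := H¹(dg) : H¹(N_{Z̃∕P}) → H¹(N_{Z∕X})`:

LEMMA KC-EN (PEN, memo §2 = KC on `P` + the push-forward rule `π_{Z∕X} ∘ β = g_* ∘ π_{Z̃∕P}` [BF03 (8.1): «contract a lift of
the normal vector into the fundamental class and restrict»] + `g_*` = the `h⁴`-coefficient): `π_{Z∕X} ∘ ω = ± δc₄(F₀(t))` on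
`Ext²(F₀, F₀)`, `ω := β ∘ κ_P⁻¹` — the SAME Chern-mixing shape `c₃σ₀ − c₂σ₁ + 2c₁σ₂ − 6σ₃` as LEMMA KC, with the Chern classes of
the RANK-8 bundle `F₀(t)` (`∂e_p∕∂ch_{q+1} = (−1)^q q! e_{p−1−q}` in any number `≥ p` of Chern roots). Typed: `DegeneracyCompat`
(`KoszulCompat` is the case `ω = κ⁻¹`, `degeneracyCompat_of_koszulCompat`).

FRAME SEQUENCE (PEN, memo §3; Koszul on `P` + the relative Euler sequence `0 → 𝒪 → g^*V ⊗ 𝒪_P(1) → T_g → 0`, Lefschetz range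
`dim Z ≥ 3`): `β` is INJECTIVE and `0 → Ext²(F₀,F₀) —ω→ H¹(Z, N_{Z∕X}) —∂₁→ H²(X, 𝒪_X) ⊗ (H⁰(End V)∕ℂ) → 0` is exact
(`H⁰(End V)∕ℂ = 𝔰𝔩₅`, dim `24`, for the trivial frame; `= 𝔥∕ℂ`, dim `4`, for a Pic⁰-generic frame), so
`h¹(N_{Z∕X}) = ext²(F₀,F₀) + 28·24 = ext² + 672` (trivial frame) ∕ `ext² + 112` (Pic⁰-generic frame) — typed as the count
`finrank_eq_of_frameSequence` ∕ `frameCount_le_of_injective` (necessary count for the cycle door: `ext² + 672 ≤ 3136 = h^{3,5}`).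
CONSEQUENCES (PROVED below, linear algebra): DOOR DOMINANCE EXTENDS to degeneracy loci (`isISemiregular_of_degeneracyCompat`:
`Z` Bloch-semiregular ⟹ `F₀` is `{0,1,2,3}`-semiregular, because `ω` is injective), and the BUNDLE-PART CRITERION
(`injOn_range_iff_injective_deltaC4`: `π_{Z∕X}` injective on `im ω` ⟺ `δc₄(F₀(t))` injective on `Ext²(F₀,F₀)`).

THEOREM DL (PEN, memo §4 — the FRAME OBSTRUCTION; uses Bloch's theorem «curvilinear obstructions lie in `ker π_Z`» [Blo72; BF03
Cor. 7.10; all obstructions: IM13 Thm 11.1, Pri12]): for the TRIVIAL frame `V = 𝒪_X^m`, `m ≥ 2` (cell: `m = 5`) the primary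
obstructions `(θ₁∧θ₂) ⊗ [A,B]` of the frame (`θᵢ ∈ H¹(X,𝒪)`, `A, B ∈ 𝔤𝔩_m`; the Kuranishi space of `𝒪^m` on an abelian variety is
the commuting variety) SURVIVE as obstructions of `Z ⊂ X`: with `Φ_* : H²(End V) ⊕ H²(End G) → H¹(Z, N_{Z∕X})` the obstruction map
of «triples ↦ degeneracy locus» (`ker Φ_* = im H²(𝒜)`, `𝒜` = infinitesimal symmetries of `φ`), the detection map
`r : H²(End V ⊕ End G) → H²(Z, T_g|_Z) = H²(Z, Hom(K, V_Z∕K))` kills `im H²(𝒜)` (symmetries preserve `K = ker φ|_Z`) and is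
injective on `O ⊕ 0`, `O := span{(θ₁∧θ₂) ⊗ [A,B]} = H²(X,𝒪) ⊗ 𝔰𝔩_m` (`H^{0,2} = Λ²H^{0,1}` on an abelian variety; commutators span
`𝔰𝔩_m`); so `ker π_{Z∕X} ⊇ Φ_*(O ⊕ 0)` has dimension `≥ h^{0,2}(X)·(m² − 1) = 672`: **`D₄(𝒪⁵ → F₀(t))` is NEVER Bloch-semiregular
(and `Hilb_X` is singular at `[Z]`).** Typed as the linear-algebra skeleton `map_span_le_ker_of_bloch` ∕
`finrank_le_finrank_ker_of_frameObstruction` ∕ `not_injective_of_frameObstruction` (hypothesis-structure style: `Φ`, `r`, `O`, the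
Bloch vanishing are DATA∕HYPOTHESES; the memo proves they hold for `D₄(𝒪⁵ → F₀(t))`). COROLLARY DL₀ (any frame, and zero loci):
`ω(ob_{F₀}(u)) ∈ ker π_{Z∕X}` with `ω` injective ⟹ the cycle door forces every curvilinear obstruction of `F₀` to vanish
(`obstruction_eq_zero_of_isBlochSemiregular`) — «`F₀` UNOBSTRUCTED» is NECESSARY for the cycle door exactly as it is for the sheaf
door [BF03 Thm 7.x]. REPAIR: a Pic⁰-GENERIC frame `V_ξ` has `O = 0` (diagonal classes commute), same class `c₄(G)`, frame quotient
of dimension `112`; its cycle door is OPEN (needs `δc₄(F₀(t))` injective, `F₀` unobstructed, and `π` injective on the 112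
frame-quotient directions, for which the cell has NO instrument). NOTHING here is a theorem about a sheaf or a variety; KC-EN, the
frame sequence and THEOREM DL are pen (memo §§2–4); no rung toward `stub_rung_pad4_seedAt` ∕ 18881 ∕ 26512 ∕ №4 ∕ H2 ∕ HC.
References: [BF03] Buchweitz–Flenner arXiv:math/9912245, (8.1), Prop. 8.2, Cor. 7.10, Rem. 7.11 (1); [Blo72] Bloch, Invent. Math. 17
(1972) §§4–6 (cite-only via [BF03] §1 and [Pri12] §0); [IM13] Iacono–Manetti arXiv:1112.0425 Main Thm ∕ Thm 11.1; [Pri12] Pridham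
arXiv:1208.3111 (all obstructions, perfect complexes); [Ful84] Fulton, Intersection Theory, Thm 14.4 (Thom–Porteous).
-/

section DegeneracyBridge

universe u v

open Literature.AlgebraicGeometry.HodgeTheory

variable {𝕜 : Type u} [CommRing 𝕜]

/-- **`DegeneracyCompat`** (LEMMA KC-EN as a typed hypothesis). Data: `A` = the Atiyah–trace algebra of `F₀(t)` (rank `8`) on `X`,
`B` = the subspace algebra of the degeneracy locus `Z = D₄(φ) ⊂ X` (`B.T2 = H¹(Z, N_{Z∕X})`, `B.blochSemiregularityMap 3 = π_{Z∕X}`),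
`ω = β ∘ κ_P⁻¹ : Ext²(F₀,F₀) → H¹(Z, N_{Z∕X})` (INJECTIVE by the frame sequence, but injectivity is kept as a separate hypothesis
where used), `ι` = the identification of the common target `H⁵(X, Ω³)`, `M` = the Chern-mixing data of the rank-8 bundle `F₀(t)`.
Statement: `ι ∘ π_{Z∕X} ∘ ω = δc₄`. PEN-PROVED for `D₄` of a general `φ : V → F₀(t)`, `t ≫ 0`, any rank-5 frame `V` with `c(V) = 1`
(memo §2), up to a global sign absorbed in `ι` or `M`.
[cite: BuchweitzFlenner2003, (8.1) and Prop. 8.2] [cite: Fulton1984IntersectionTheory, Thm. 14.4 (Thom–Porteous)] -/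
def DegeneracyCompat (A : AtiyahTraceAlgebra.{u, v} 𝕜) (B : SubspaceAtiyahTraceAlgebra.{u, v} 𝕜)
    (ω : A.Ext 2 0 →ₗ[𝕜] B.T2) (ι : B.Coh 5 3 →ₗ[𝕜] A.Coh 5 3) (M : ChernMixing A) : Prop :=
  ∀ x : A.Ext 2 0, ι (B.blochSemiregularityMap 3 (ω x)) = M.deltaC4 x

variable {A : AtiyahTraceAlgebra.{u, v} 𝕜} {B : SubspaceAtiyahTraceAlgebra.{u, v} 𝕜}
  {ω : A.Ext 2 0 →ₗ[𝕜] B.T2} {ι : B.Coh 5 3 →ₗ[𝕜] A.Coh 5 3} {M : ChernMixing A}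

/-- LEMMA KC (zero loci, `κ` an isomorphism) is the special case `ω = κ⁻¹` of `DegeneracyCompat`. -/
theorem degeneracyCompat_of_koszulCompat {κ : B.T2 ≃ₗ[𝕜] A.Ext 2 0} (hKC : KoszulCompat A B κ ι M) :
    DegeneracyCompat A B (κ.symm : A.Ext 2 0 →ₗ[𝕜] B.T2) ι M := by
  intro x
  simpa only [LinearEquiv.coe_coe, LinearEquiv.apply_symm_apply] using hKC (κ.symm x)

/-- Under KC-EN, `δc₄` vanishes wherever `π_{Z∕X} ∘ ω` does (no injectivity needed). -/
theorem deltaC4_eq_zero_of_bloch_omega_eq_zero (hDC : DegeneracyCompat A B ω ι M) {x : A.Ext 2 0}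
    (hx : B.blochSemiregularityMap 3 (ω x) = 0) : M.deltaC4 x = 0 := by
  rw [← hDC, hx, map_zero]

/-- **DOOR DOMINANCE for degeneracy loci** (memo §3 (D1)). Under KC-EN with `ω` injective (frame sequence): if `Z = D₄(φ)` is
Bloch-semiregular then `F₀` is `{0,1,2,3}`-semiregular — the cycle door through a corank-one degeneracy locus of a frame
`V → F₀(t)` is never weaker than the weakest sheaf door `I = {1,2,3,4}` of `F₀`. -/
theorem isISemiregular_of_degeneracyCompat (hDC : DegeneracyCompat A B ω ι M) (hι : Function.Injective ι)
    (hω : Function.Injective ω) (hZ : B.IsBlochSemiregular 3) : A.IsISemiregular {k | k ≤ 3} := by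
  intro x hx
  have hδ : M.deltaC4 x = 0 := M.deltaC4_eq_zero_of_sigma_eq_zero fun k hk => hx k hk
  have hπ : B.blochSemiregularityMap 3 (ω x) = 0 := by
    apply hι
    rw [hDC, hδ, map_zero]
  have hk : ω x = 0 := hZ (hπ.trans (map_zero _).symm)
  exact hω (hk.trans (map_zero ω).symm)

/-- Door dominance for any index set containing the form degrees `0, …, 3`. [cite: BuchweitzFlenner2003, §5 (I-semiregular)] -/
theorem isISemiregular_of_degeneracyCompat_of_subset (hDC : DegeneracyCompat A B ω ι M) (hι : Function.Injective ι)
    (hω : Function.Injective ω) (hZ : B.IsBlochSemiregular 3) {J : Set ℕ} (hJ : {k | k ≤ 3} ⊆ J) : A.IsISemiregular J :=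
  (isISemiregular_of_degeneracyCompat hDC hι hω hZ).mono hJ

/-- **BUNDLE-PART CRITERION** (memo §3 (D2)). Under KC-EN: `π_{Z∕X}` is injective on `im ω` (precisely: `π(ω x) = 0 ⟹ x = 0`)
iff `δc₄(F₀(t))` is injective on `Ext²(F₀,F₀)`. This is only the bundle part of the cycle door: the frame-quotient part of
`H¹(Z, N_{Z∕X})` (dimension `672` ∕ `112`) is not seen by `δc₄`. -/
theorem injOn_range_iff_injective_deltaC4 (hDC : DegeneracyCompat A B ω ι M) (hι : Function.Injective ι) :
    (∀ x : A.Ext 2 0, B.blochSemiregularityMap 3 (ω x) = 0 → x = 0) ↔ Function.Injective M.deltaC4 := by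
  constructor
  · intro h
    refine (injective_iff_map_eq_zero _).2 fun x hx => h x (hι ?_)
    rw [hDC, hx, map_zero]
  · intro hδ x hx
    exact (injective_iff_map_eq_zero _).1 hδ x (deltaC4_eq_zero_of_bloch_omega_eq_zero hDC hx)

/-- Necessary condition (bundle part): the cycle door for `D₄(φ)` forces `δc₄(F₀(t))` injective on `Ext²(F₀,F₀)` (given `ω`
injective). -/
theorem injective_deltaC4_of_isBlochSemiregular (hDC : DegeneracyCompat A B ω ι M) (hι : Function.Injective ι)
    (hω : Function.Injective ω) (hZ : B.IsBlochSemiregular 3) : Function.Injective M.deltaC4 :=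
  (injOn_range_iff_injective_deltaC4 hDC hι).1 fun _ hx =>
    hω ((hZ (hx.trans (map_zero _).symm)).trans (map_zero ω).symm)

/-- **COROLLARY DL₀** (memo §4.3; «unobstructed is necessary»). If an obstruction class `o ∈ Ext²(F₀,F₀)` of the bundle is carried
by `ω` into `ker π_{Z∕X}` (Bloch: every curvilinear obstruction of `Z ⊂ X` lies in `ker π_{Z∕X}`, and `ω(o)` IS the obstruction
of the induced deformation of `Z`), then the cycle door kills it: `o = 0`. So a bundle with a non-zero curvilinear obstruction
passes NEITHER door. [cite: BuchweitzFlenner2003, Cor. 7.10 and Rem. 7.11 (1)] [cite: Bloch1972Semiregularity, §4–§6 (cite-only)] -/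
theorem obstruction_eq_zero_of_isBlochSemiregular (ω : A.Ext 2 0 →ₗ[𝕜] B.T2) (hω : Function.Injective ω)
    (hZ : B.IsBlochSemiregular 3) {o : A.Ext 2 0} (hBloch : B.blochSemiregularityMap 3 (ω o) = 0) : o = 0 :=
  hω ((hZ (hBloch.trans (map_zero _).symm)).trans (map_zero ω).symm)

/-- **FRAME SEQUENCE count** (memo §3): for `0 → E —ω→ T —∂→ Q → 0` exact (`ω` injective, `∂` surjective, `ker ∂ = im ω`) over a
field, `dim T = dim E + dim Q`. Instance of record (by docstring): `E = Ext²(F₀,F₀)`, `T = H¹(Z, N_{Z∕X})`,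
`Q = H²(X,𝒪) ⊗ (H⁰(End V)∕ℂ)` (`dim Q = 672` for the trivial frame, `112` for a Pic⁰-generic frame). -/
theorem finrank_eq_of_frameSequence {K : Type*} [Field K] {E T Q : Type*} [AddCommGroup E] [Module K E]
    [AddCommGroup T] [Module K T] [AddCommGroup Q] [Module K Q] [FiniteDimensional K T]
    (ω : E →ₗ[K] T) (d : T →ₗ[K] Q) (hω : Function.Injective ω) (hd : Function.Surjective d)
    (hex : LinearMap.ker d = LinearMap.range ω) :
    Module.finrank K T = Module.finrank K E + Module.finrank K Q := by
  have h1 := LinearMap.finrank_range_add_finrank_ker d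
  rw [LinearMap.range_eq_top.2 hd, finrank_top, hex, LinearMap.finrank_range_of_inj hω] at h1
  omega

/-- NECESSARY COUNT for the cycle door (memo §3): if moreover Bloch's map `π : T → C` is injective then
`dim E + dim Q ≤ dim C`; for the cell: `ext²(F₀,F₀) + 672 ≤ 3136` (trivial frame — moot by THEOREM DL), `ext² + 112 ≤ 3136`
(Pic⁰-generic frame). -/
theorem frameCount_le_of_injective {K : Type*} [Field K] {E T Q C : Type*} [AddCommGroup E] [Module K E]
    [AddCommGroup T] [Module K T] [AddCommGroup Q] [Module K Q] [AddCommGroup C] [Module K C]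
    [FiniteDimensional K T] [FiniteDimensional K C]
    (ω : E →ₗ[K] T) (d : T →ₗ[K] Q) (π : T →ₗ[K] C) (hω : Function.Injective ω) (hd : Function.Surjective d)
    (hex : LinearMap.ker d = LinearMap.range ω) (hπ : Function.Injective π) :
    Module.finrank K E + Module.finrank K Q ≤ Module.finrank K C := by
  rw [← finrank_eq_of_frameSequence ω d hω hd hex]
  exact LinearMap.finrank_le_finrank_of_injective hπ

/-- BLOCH'S THEOREM as used (memo §4.1): a set `S` of obstruction classes with `π (Φ w) = 0` for `w ∈ S` spans a subspace whose
image under the obstruction map `Φ` lies in `ker π`. [cite: BuchweitzFlenner2003, Cor. 7.10] [cite: Bloch1972Semiregularity, §4–§6 (cite-only)] -/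
theorem map_span_le_ker_of_bloch {K : Type*} [Field K] {W T C : Type*} [AddCommGroup W] [Module K W]
    [AddCommGroup T] [Module K T] [AddCommGroup C] [Module K C] (Φ : W →ₗ[K] T) (π : T →ₗ[K] C) {S : Set W}
    (hS : ∀ w ∈ S, π (Φ w) = 0) : (Submodule.span K S).map Φ ≤ LinearMap.ker π := by
  rw [Submodule.map_le_iff_le_comap]
  refine Submodule.span_le.2 fun w hw => ?_
  simp only [SetLike.mem_coe, Submodule.mem_comap, LinearMap.mem_ker]
  exact hS w hw

/-- **THEOREM DL, linear-algebra skeleton** (memo §4.2). `Φ : W → T` the obstruction map of «triples `(V, G, ψ)` ↦ `D₄(ψ)`»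
(`W = H²(End V) ⊕ H²(End G)`, `T = H¹(Z, N_{Z∕X})`), `r : W → R` the frame-quotient detection map (`R = H²(Z, Hom(K, V_Z∕K))`),
`O ≤ W` the span of the frame obstructions. HYPOTHESES (pen, memo §4.2): (i) `ker Φ ≤ ker r` (both controlled by `im H²(𝒜)`);
(ii) `O ⊓ ker r = ⊥` (`r` restricted to `O = H²(X,𝒪) ⊗ 𝔰𝔩_m` is `η ⊗ C ↦ η ⊗ (C mod ℂ·1)`, injective); (iii) `O.map Φ ≤ ker π`
(Bloch, via `map_span_le_ker_of_bloch`). CONCLUSION: `dim O ≤ dim ker π` — for `D₄(𝒪⁵ → F₀(t))` on the abelian 8-fold: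
`dim ker π_{Z∕X} ≥ 672`. -/
theorem finrank_le_finrank_ker_of_frameObstruction {K : Type*} [Field K] {W T C R : Type*} [AddCommGroup W] [Module K W]
    [AddCommGroup T] [Module K T] [AddCommGroup C] [Module K C] [AddCommGroup R] [Module K R] [FiniteDimensional K T]
    (Φ : W →ₗ[K] T) (π : T →ₗ[K] C) (r : W →ₗ[K] R) (O : Submodule K W)
    (hker : LinearMap.ker Φ ≤ LinearMap.ker r) (hO : O ⊓ LinearMap.ker r = ⊥) (hBloch : O.map Φ ≤ LinearMap.ker π) :
    Module.finrank K O ≤ Module.finrank K (LinearMap.ker π) := by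
  have hinj : Function.Injective (Φ.domRestrict O) := by
    refine (injective_iff_map_eq_zero _).2 fun x hx => ?_
    have hxW : (x : W) ∈ O ⊓ LinearMap.ker r :=
      ⟨x.2, hker (by simpa only [LinearMap.mem_ker, LinearMap.domRestrict_apply] using hx)⟩
    rw [hO, Submodule.mem_bot] at hxW
    exact Subtype.ext hxW
  calc Module.finrank K O = Module.finrank K (LinearMap.range (Φ.domRestrict O)) :=
        (LinearMap.finrank_range_of_inj hinj).symm
    _ = Module.finrank K (O.map Φ) := by rw [LinearMap.range_domRestrict]
    _ ≤ Module.finrank K (LinearMap.ker π) := Submodule.finrank_mono hBloch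

/-- **THEOREM DL, conclusion**: a non-zero frame-obstruction span forces `π_{Z∕X}` NON-injective — `D₄(𝒪⁵ → F₀(t))` is not
Bloch-semiregular (and by [BF03, Cor. 7.10] `Hilb_X` is singular at `[Z]`). -/
theorem not_injective_of_frameObstruction {K : Type*} [Field K] {W T C R : Type*} [AddCommGroup W] [Module K W]
    [AddCommGroup T] [Module K T] [AddCommGroup C] [Module K C] [AddCommGroup R] [Module K R]
    [FiniteDimensional K W] [FiniteDimensional K T]
    (Φ : W →ₗ[K] T) (π : T →ₗ[K] C) (r : W →ₗ[K] R) (O : Submodule K W)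
    (hker : LinearMap.ker Φ ≤ LinearMap.ker r) (hO : O ⊓ LinearMap.ker r = ⊥) (hBloch : O.map Φ ≤ LinearMap.ker π)
    (hne : O ≠ ⊥) : ¬ Function.Injective π := by
  intro hπ
  have h := finrank_le_finrank_ker_of_frameObstruction Φ π r O hker hO hBloch
  rw [LinearMap.ker_eq_bot.2 hπ, finrank_bot, Nat.le_zero, Submodule.finrank_eq_zero] at h
  exact hne h

/-- THEOREM DL in the `IsBlochSemiregular` vocabulary of the tree: with `T = B.T2` and `π = B.blochSemiregularityMap 3`, a non-zero
detected frame-obstruction span refutes Bloch-semiregularity of `Z`. (Over a field `𝕜`.) -/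
theorem not_isBlochSemiregular_of_frameObstruction {𝕜' : Type u} [Field 𝕜'] {B' : SubspaceAtiyahTraceAlgebra.{u, v} 𝕜'}
    {W R : Type v} [AddCommGroup W] [Module 𝕜' W] [AddCommGroup R] [Module 𝕜' R]
    [FiniteDimensional 𝕜' W] [FiniteDimensional 𝕜' B'.T2]
    (Φ : W →ₗ[𝕜'] B'.T2) (r : W →ₗ[𝕜'] R) (O : Submodule 𝕜' W)
    (hker : LinearMap.ker Φ ≤ LinearMap.ker r) (hO : O ⊓ LinearMap.ker r = ⊥)
    (hBloch : O.map Φ ≤ LinearMap.ker (B'.blochSemiregularityMap 3)) (hne : O ≠ ⊥) : ¬ B'.IsBlochSemiregular 3 :=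
  not_injective_of_frameObstruction Φ (B'.blochSemiregularityMap 3) r O hker hO hBloch hne

/-! ### The cell's numbers (abelian 8-fold `X = S⁴`: `h^{p,q}(X) = C(8,p)·C(8,q)`) -/

/-- Hodge number `h^{p,q}` of an abelian `g`-fold: `C(g,p)·C(g,q)`. -/
def hodgeNumberAV (g p q : ℕ) : ℕ := g.choose p * g.choose q

/-- Target of Bloch's map in codimension `4`: `h⁵(X, Ω³) = h^{3,5} = 56·56 = 3136`. -/
example : hodgeNumberAV 8 3 5 = 3136 := by decide
/-- Frame quotient for the trivial frame `𝒪⁵`: `h^{0,2} · dim 𝔰𝔩₅ = 28·24 = 672` (THEOREM DL: `dim ker π ≥ 672`). -/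
example : hodgeNumberAV 8 0 2 * (5 ^ 2 - 1) = 672 := by decide
/-- Frame quotient for a Pic⁰-generic frame `⊕ P_{ξ_k}`: `h^{0,2} · (5 − 1) = 112`. -/
example : hodgeNumberAV 8 0 2 * (5 - 1) = 112 := by decide
/-- First-order frame deformations modulo scalars: `h^{0,1} · 24 = 192` (trivial frame), `h^{0,1} · 4 = 32` (Pic⁰-generic). -/
example : hodgeNumberAV 8 0 1 * (5 ^ 2 - 1) = 192 ∧ hodgeNumberAV 8 0 1 * (5 - 1) = 32 := by decide
/-- Necessary counts `ext²(F₀,F₀) ≤ 3136 − 672 = 2464` (trivial frame, moot) and `≤ 3136 − 112 = 3024` (Pic⁰-generic frame). -/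
example : 3136 - 672 = 2464 ∧ 3136 - 112 = 3024 := by decide

end DegeneracyBridge

/-!
## v1.4 (g3) — `SeedEndomorphismStructure`: what a door forces on `End(𝓔)` and on forced direct-sum decompositions

HONEST FRAMING. As for every section of this file: NOTHING below is a theorem about a sheaf or a variety, nothing is asserted
about any explicit variety, and nothing here is a rung toward `stub_rung_pad4_seedAt` ∕ 18881 ∕ 26512 ∕ №4 ∕ H2 ∕ HC ∕ HC_CM ∕ HC_AV.
What IS kernel-checked below is pure algebra over the tree's `AtiyahTraceAlgebra` (BF03 §4): the two geometric inputs it needs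
are NAMED hypotheses with their sources — `TraceCyclicDegZero` (Illusie's trace is cyclic against degree-`0` endomorphisms,
`Tr(φ ∘ y) = Tr(y ∘ φ)`; [Ill71, V], [HL10, 10.1.3 ff.], [BF03, §4]) and `AtiyahCentral` (naturality of the Atiyah class w.r.t.
endomorphisms, `At ∘ φ = (φ ⊗ 1) ∘ At`; [HL10, 10.1.5 ff.], [BF03, §3]) — and the direct-sum ∕ tangent data are abstract
structures whose intended (and only intended) instances are spelled out in the docstrings (memo §§1–4).

* LEMMA C (`semiregularityComponent_mul_comm`, `mul_comm_of_isISemiregular`, `offDiag_eq_zero_of_isISemiregular`): for every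
  `φ ∈ End(𝓔) = Ext⁰` and `x ∈ Ext²(𝓔,𝓔)`, `σ_k(φ·x) = σ_k(x·φ)` for all `k`; hence behind ANY door (`I`-semiregularity, any `I`)
  `End(𝓔)` acts CENTRALLY on `Ext²(𝓔,𝓔)`, and for an idempotent `e` (a splitting `𝓔 = 𝓔₁ ⊕ 𝓔₂`) the off-diagonal blocks
  `e · Ext² · (1 − e) = Ext²(𝓔₂, 𝓔₁)` vanish. Non-simplicity therefore never kills a door by itself; it imposes commutation.
* THEOREM CA1 (`DirectSumDatum.not_isISemiregular_of_blockObstruction`): if `𝓔 = 𝓔₁ ⊕ 𝓔₂` (e.g. FORCED by the live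
  comparability graph, memo g0 THEOREM C, or by free∕uncovered letters, twisted or not) and some first-order direction `ξ`
  keeps `ch(𝓔)` of type `(p,p)` but NOT `ch(𝓔₁)`, then `x = ob_ξ(𝓔) = ob_ξ(𝓔₁) ⊕ ob_ξ(𝓔₂) ∈ Ext²(𝓔,𝓔)` is non-zero with
  `σ_k(x) = ⟨ξ, ch_{k+1}(𝓔)⟩ = 0` for EVERY `k` (BF03 Prop. 4.2 ∕ Cor. 4.3 blockwise): `𝓔` is `I`-semiregular for NO `I`.
  With PROP W of the memo (the `T_W`-horizontal `(p,p)`-classes on `E_i^8` are exactly `ℚ[H] ⊕ W`) this is ROW CA1: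
  "(A1) must hold COMPONENTWISE on the forced decomposition" — maps-free, twist-free, necessary for every door.
* PROP F ∕ TDT (`ker_eq_iInf_ker_of_isISemiregular`): for the tautological classes `f(α, ξ) = α·id + ⟨ξ, At 𝓔⟩` one has
  `σ_k ∘ f = Φ_k`, `Φ_k(α, ξ) = α ∧ ch_k + ⟨ξ, ch_{k+1}⟩` computable from the DESIGN; behind an `I`-door `ker f = ⋂_{k∈I} ker Φ_k`,
  so `ext²(𝓔,𝓔) ≥ rank Φ_I` and the door must already be injective on `im f`. Cell numbers: `dim (H^{0,2} ⊕ H¹(T_X)) = 92`,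
  `rank Φ = rank Φ_{≤3} = 76 = 92 − 16` on all 20 non-geometric designs of record (`16 = dim T_W`), `rank Φ_{3} = 60`.
References: [BF03] Buchweitz–Flenner, Compositio Math. 137 (2003), arXiv:math/9912245, §3, Def. 4.1, Prop. 4.2, Cor. 4.3, §5;
[Mar25] Markman, arXiv:2502.03415, §7.1 (the commutative triangle `σ ∘ at_E = ⌟ ch(E)` on `H¹(M,TM)`, citing [BF03]);
[HL10] Huybrechts–Lehn, The geometry of moduli spaces of sheaves, 2nd ed., §10.1 (Atiyah class, trace, naturality);
[Ill71] Illusie, Complexe cotangent et déformations I, Ch. V (trace); [Wei77] Weil, Abelian varieties and the Hodge ring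
(Œuvres III, 1977c) and [vG94] van Geemen, An introduction to the Hodge conjecture for abelian varieties, arXiv:alg-geom/9406012,
§§5–6 (Hodge ring of a general Weil-type abelian variety = `⟨θ⟩ ⊕` Weil classes) — used only in the memo's PROP W discussion.
-/

section SeedEndomorphismStructure

universe u v

open Literature.AlgebraicGeometry.HodgeTheory

variable {𝕜 : Type u} [CommRing 𝕜]

/-! ### LEMMA C — degree-zero trace cyclicity + Atiyah naturality ⟹ `End(𝓔)` is central on `Ext²` behind any door -/

/-- HYPOTHESIS `Tr(φ · y) = Tr(y · φ)` for `φ ∈ A^{0,0} = End(F)` and `y ∈ A^{a,b}`: the degree-zero case of the graded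
cyclicity of Illusie's trace (no sign, `φ` has total degree `0`). A property OF the intended instance, taken as a hypothesis
(the structure `AtiyahTraceAlgebra` records no theorem about `Tr`). [cite: BuchweitzFlenner2003, §4 (trace map)]
[cite: Illusie1971CotangentI, Ch. V] -/
def TraceCyclicDegZero (A : AtiyahTraceAlgebra.{u, v} 𝕜) : Prop :=
  ∀ (a b : ℕ) (φ : A.Ext 0 0) (y : A.Ext a b),
    A.trace a b (A.mul (Nat.zero_add a) (Nat.zero_add b) φ y) = A.trace a b (A.mul (Nat.add_zero a) (Nat.add_zero b) y φ)

/-- HYPOTHESIS `φ · At(F) = At(F) · φ` for `φ ∈ End(F)`: naturality of the Atiyah class with respect to endomorphisms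
(`At_F ∘ φ = (φ ⊗ 1) ∘ At_F` in `Ext¹(F, F ⊗ Ω¹)`, i.e. `At` commutes with `A^{0,0}` in BF's algebra `A`).
[cite: BuchweitzFlenner2003, §3 (functoriality of the Atiyah class)] -/
def AtiyahCentral (A : AtiyahTraceAlgebra.{u, v} 𝕜) : Prop :=
  ∀ φ : A.Ext 0 0,
    A.mul (Nat.zero_add 1) (Nat.zero_add 1) φ A.atiyah = A.mul (Nat.add_zero 1) (Nat.add_zero 1) A.atiyah φ

variable {A : AtiyahTraceAlgebra.{u, v} 𝕜}

/-- Every power `At^k` commutes with `End(F)` if `At` does (induction on `k`, associativity of BF's algebra `A`).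
[cite: BuchweitzFlenner2003, §4 (associativity of A)] -/
theorem atiyahPow_central (hA : AtiyahCentral A) (φ : A.Ext 0 0) (k : ℕ) :
    A.mul (Nat.zero_add k) (Nat.zero_add k) φ (A.atiyahPow k) =
      A.mul (Nat.add_zero k) (Nat.add_zero k) (A.atiyahPow k) φ := by
  induction k with
  | zero => exact (A.mul_one φ).trans (A.one_mul φ).symm
  | succ k ih =>
    calc A.mul (Nat.zero_add (k + 1)) (Nat.zero_add (k + 1)) φ (A.atiyahPow (k + 1))
        = A.mul (Eq.refl (k + 1)) (Eq.refl (k + 1)) (A.mul (Nat.zero_add k) (Nat.zero_add k) φ (A.atiyahPow k)) A.atiyah :=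
          (A.mul_assoc (Nat.zero_add k) (Nat.zero_add k) (Eq.refl (k + 1)) (Eq.refl (k + 1)) (Eq.refl (k + 1)) (Eq.refl (k + 1))
            (Nat.zero_add (k + 1)) (Nat.zero_add (k + 1)) φ (A.atiyahPow k) A.atiyah).symm
      _ = A.mul (Eq.refl (k + 1)) (Eq.refl (k + 1)) (A.mul (Nat.add_zero k) (Nat.add_zero k) (A.atiyahPow k) φ) A.atiyah := by
          rw [ih]
      _ = A.mul (Eq.refl (k + 1)) (Eq.refl (k + 1)) (A.atiyahPow k) (A.mul (Nat.zero_add 1) (Nat.zero_add 1) φ A.atiyah) :=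
          A.mul_assoc (Nat.add_zero k) (Nat.add_zero k) (Nat.zero_add 1) (Nat.zero_add 1) (Eq.refl (k + 1)) (Eq.refl (k + 1))
            (Eq.refl (k + 1)) (Eq.refl (k + 1)) (A.atiyahPow k) φ A.atiyah
      _ = A.mul (Eq.refl (k + 1)) (Eq.refl (k + 1)) (A.atiyahPow k) (A.mul (Nat.add_zero 1) (Nat.add_zero 1) A.atiyah φ) := by
          rw [hA φ]
      _ = A.mul (Nat.add_zero (k + 1)) (Nat.add_zero (k + 1)) (A.atiyahPow (k + 1)) φ :=
          (A.mul_assoc (Eq.refl (k + 1)) (Eq.refl (k + 1)) (Nat.add_zero 1) (Nat.add_zero 1) (Nat.add_zero (k + 1))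
            (Nat.add_zero (k + 1)) (Eq.refl (k + 1)) (Eq.refl (k + 1)) (A.atiyahPow k) A.atiyah φ).symm

/-- **LEMMA C.** `σ_k(φ · x) = σ_k(x · φ)` for `φ ∈ End(F)`, `x ∈ Ext²(F,F)`, every `k`:
`Tr(φ x At^k) = Tr(x At^k φ) = Tr(x φ At^k)` (cyclicity against `φ`, then centrality of `At^k`).
[cite: BuchweitzFlenner2003, Def. 4.1, §3, §4] -/
theorem semiregularityComponent_mul_comm (hT : TraceCyclicDegZero A) (hA : AtiyahCentral A) (k : ℕ)
    (φ : A.Ext 0 0) (x : A.Ext 2 0) :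
    A.semiregularityComponent k (A.mul (Nat.zero_add 2) (Nat.zero_add 0) φ x) =
      A.semiregularityComponent k (A.mul (Nat.add_zero 2) (Nat.add_zero 0) x φ) := by
  simp only [AtiyahTraceAlgebra.semiregularityComponent_apply]
  have e1 : A.mul (Nat.add_comm 2 k) (Nat.zero_add k) (A.mul (Nat.zero_add 2) (Nat.zero_add 0) φ x) (A.atiyahPow k)
      = A.mul (Nat.zero_add (k + 2)) (Nat.zero_add k) φ (A.mul (Nat.add_comm 2 k) (Nat.zero_add k) x (A.atiyahPow k)) :=
    A.mul_assoc (Nat.zero_add 2) (Nat.zero_add 0) (Nat.add_comm 2 k) (Nat.zero_add k) (Nat.add_comm 2 k) (Nat.zero_add k)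
      (Nat.zero_add (k + 2)) (Nat.zero_add k) φ x (A.atiyahPow k)
  have e2 : A.mul (Nat.add_zero (k + 2)) (Nat.add_zero k) (A.mul (Nat.add_comm 2 k) (Nat.zero_add k) x (A.atiyahPow k)) φ
      = A.mul (Nat.add_comm 2 k) (Nat.zero_add k) x (A.mul (Nat.add_zero k) (Nat.add_zero k) (A.atiyahPow k) φ) :=
    A.mul_assoc (Nat.add_comm 2 k) (Nat.zero_add k) (Nat.add_zero k) (Nat.add_zero k) (Nat.add_zero (k + 2)) (Nat.add_zero k)
      (Nat.add_comm 2 k) (Nat.zero_add k) x (A.atiyahPow k) φ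
  have e3 : A.mul (Nat.add_comm 2 k) (Nat.zero_add k) x (A.mul (Nat.zero_add k) (Nat.zero_add k) φ (A.atiyahPow k))
      = A.mul (Nat.add_comm 2 k) (Nat.zero_add k) (A.mul (Nat.add_zero 2) (Nat.add_zero 0) x φ) (A.atiyahPow k) :=
    (A.mul_assoc (Nat.add_zero 2) (Nat.add_zero 0) (Nat.zero_add k) (Nat.zero_add k) (Nat.add_comm 2 k) (Nat.zero_add k)
      (Nat.add_comm 2 k) (Nat.zero_add k) x φ (A.atiyahPow k)).symm
  rw [e1, hT, e2, ← atiyahPow_central hA φ k, e3]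

/-- **LEMMA C, door form.** Behind any door (`I`-semiregularity, ANY `I`): `φ · x = x · φ` for all `φ ∈ End(𝓔)`, `x ∈ Ext²(𝓔,𝓔)` —
`End(𝓔)` acts centrally on `Ext²`; a non-simple `𝓔` is not excluded, it is constrained.
[cite: BuchweitzFlenner2003, §5 (I-semiregular)] -/
theorem mul_comm_of_isISemiregular (hT : TraceCyclicDegZero A) (hA : AtiyahCentral A) {I : Set ℕ}
    (hI : A.IsISemiregular I) (φ : A.Ext 0 0) (x : A.Ext 2 0) :
    A.mul (Nat.zero_add 2) (Nat.zero_add 0) φ x = A.mul (Nat.add_zero 2) (Nat.add_zero 0) x φ := by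
  rw [← sub_eq_zero]
  refine hI _ fun k _ ↦ ?_
  rw [map_sub, semiregularityComponent_mul_comm hT hA, sub_self]

/-- **LEMMA C, block form.** For an idempotent `e ∈ End(𝓔)` (`𝓔 = e𝓔 ⊕ (1−e)𝓔`) behind any door the off-diagonal block
`e · Ext²(𝓔,𝓔) · (1 − e) = Ext²((1−e)𝓔, e𝓔)` is zero: `e x (1−e) = e (1−e) x = 0`. So a FORCED splitting `𝓔 = 𝓔₁ ⊕ 𝓔₂`
(live-graph components, free ∕ uncovered letters) needs `Ext²(𝓔₁,𝓔₂) = Ext²(𝓔₂,𝓔₁) = 0` — the CAPACITY ∕ orthogonality rows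
of the cell are instances. [cite: BuchweitzFlenner2003, §5] -/
theorem offDiag_eq_zero_of_isISemiregular (hT : TraceCyclicDegZero A) (hA : AtiyahCentral A) {I : Set ℕ}
    (hI : A.IsISemiregular I) (e : A.Ext 0 0) (he : A.mul (Nat.zero_add 0) (Nat.zero_add 0) e e = e) (x : A.Ext 2 0) :
    A.mul (Nat.zero_add 2) (Nat.zero_add 0) e (A.mul (Nat.add_zero 2) (Nat.add_zero 0) x (A.one - e)) = 0 := by
  rw [← mul_comm_of_isISemiregular hT hA hI (A.one - e) x,
    ← A.mul_assoc (Nat.zero_add 0) (Nat.zero_add 0) (Nat.zero_add 2) (Nat.zero_add 0) (Nat.zero_add 2) (Nat.zero_add 0)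
      (Nat.zero_add 2) (Nat.zero_add 0) e (A.one - e) x,
    map_sub, he]
  have h1 : A.mul (Nat.zero_add 0) (Nat.zero_add 0) e A.one = e := A.mul_one e
  rw [h1, sub_self, LinearMap.map_zero, LinearMap.zero_apply]

/-! ### THEOREM CA1 — a block whose own class moves kills every door -/

/-- DIRECT-SUM DATUM for `𝓔 = 𝓔₁ ⊕ 𝓔₂` (abstract): `A`, `A₁`, `A₂` the Atiyah–trace algebras of `𝓔`, `𝓔₁`, `𝓔₂`; `ι_j` the
inclusions `Ext²(𝓔_j,𝓔_j) ↪ Ext²(𝓔,𝓔)` of the diagonal blocks (jointly injective: `inj`); `c_j k` the identifications of the common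
targets `H^{k+2}(X, Ω^k)` (`c₁` injective — it is an isomorphism in the intended instance); `sigma_ι_j`: `σ^𝓔` restricted to a
diagonal block is `σ^{𝓔_j}` (because `At(𝓔₁ ⊕ 𝓔₂) = At(𝓔₁) ⊕ At(𝓔₂)` and `Tr` is additive on block-diagonal classes).
Only intended instance: a direct sum of coherent sheaves ∕ perfect complexes on one `X`.
[cite: BuchweitzFlenner2003, §3 (additivity of At), Def. 4.1] -/
structure DirectSumDatum (A A₁ A₂ : AtiyahTraceAlgebra.{u, v} 𝕜) where
  /-- `Ext²(𝓔₁,𝓔₁) ↪ Ext²(𝓔,𝓔)`. -/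
  ι₁ : A₁.Ext 2 0 →ₗ[𝕜] A.Ext 2 0
  /-- `Ext²(𝓔₂,𝓔₂) ↪ Ext²(𝓔,𝓔)`. -/
  ι₂ : A₂.Ext 2 0 →ₗ[𝕜] A.Ext 2 0
  /-- `H^{k+2}(Ω^k)` of `𝓔₁`'s algebra → that of `𝓔`'s (the identity of `H^{k+2}(X,Ω^k)` in the instance). -/
  c₁ : (k : ℕ) → (A₁.Coh (k + 2) k →ₗ[𝕜] A.Coh (k + 2) k)
  /-- Same for `𝓔₂`. -/
  c₂ : (k : ℕ) → (A₂.Coh (k + 2) k →ₗ[𝕜] A.Coh (k + 2) k)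
  /-- The two diagonal blocks are independent direct summands of `Ext²(𝓔,𝓔)`. -/
  inj : ∀ (y₁ : A₁.Ext 2 0) (y₂ : A₂.Ext 2 0), ι₁ y₁ + ι₂ y₂ = 0 → y₁ = 0 ∧ y₂ = 0
  /-- `c₁ k` is injective. -/
  c₁_injective : ∀ k, Function.Injective (c₁ k)
  /-- `σ^𝓔_k ∘ ι₁ = σ^{𝓔₁}_k`. -/
  sigma_ι₁ : ∀ (k : ℕ) (y : A₁.Ext 2 0), A.semiregularityComponent k (ι₁ y) = c₁ k (A₁.semiregularityComponent k y)
  /-- `σ^𝓔_k ∘ ι₂ = σ^{𝓔₂}_k`. -/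
  sigma_ι₂ : ∀ (k : ℕ) (y : A₂.Ext 2 0), A.semiregularityComponent k (ι₂ y) = c₂ k (A₂.semiregularityComponent k y)

namespace DirectSumDatum

variable {A A₁ A₂ : AtiyahTraceAlgebra.{u, v} 𝕜} (D : DirectSumDatum A A₁ A₂)

/-- **THEOREM CA1 (block obstruction).** Let `y_j ∈ Ext²(𝓔_j,𝓔_j)` be block classes whose `σ`-images CANCEL in every degree
(`hsum`) while `σ^{𝓔₁}_k(y₁) ≠ 0` for some `k` (`hne`). Then `𝓔` is `I`-semiregular for NO `I`: `x = ι₁ y₁ + ι₂ y₂ ≠ 0` lies in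
`ker σ_k` for all `k`. Intended instance: `y_j = ob_ξ(𝓔_j) = ⟨ξ, ∓At(𝓔_j)⟩` for a first-order direction `ξ ∈ H¹(X, T_X)`, so that
`σ^{𝓔_j}_k(y_j) = ⟨ξ, ch_{k+1}(𝓔_j)⟩` (BF03 Prop. 4.2 ∕ Cor. 4.3; [Mar25, §7.1]); `hsum` ⟸ `⟨ξ, ch(𝓔)⟩ = 0` (the total class stays
`(p,p)` to first order along `ξ` — for an (A1) design and `ξ ∈ T_W` this is PROP W of the memo); `hne` ⟸ `ch(𝓔₁)` does NOT
stay `(p,p)` along `ξ`. ROW CA1 of the cell: (A1) must hold for EVERY forced direct summand.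
[cite: BuchweitzFlenner2003, Prop. 4.2, Cor. 4.3, §5] -/
theorem not_isISemiregular_of_blockObstruction (y₁ : A₁.Ext 2 0) (y₂ : A₂.Ext 2 0)
    (hsum : ∀ k, D.c₁ k (A₁.semiregularityComponent k y₁) + D.c₂ k (A₂.semiregularityComponent k y₂) = 0)
    (hne : ∃ k, A₁.semiregularityComponent k y₁ ≠ 0) (I : Set ℕ) : ¬ A.IsISemiregular I := by
  intro hI
  obtain ⟨k₀, hk₀⟩ := hne
  have hx : D.ι₁ y₁ + D.ι₂ y₂ = 0 :=
    hI _ fun k _ ↦ by rw [map_add, D.sigma_ι₁, D.sigma_ι₂, hsum]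
  exact hk₀ (by rw [(D.inj y₁ y₂ hx).1, map_zero])

/-- CA1, budget form read contrapositively: behind a door every block class detected by `σ^{𝓔₁}` whose image is cancelled by
the other block must vanish — in the instance: `⟨ξ, ch(𝓔)⟩ = 0 ⟹ ⟨ξ, ch(𝓔₁)⟩ = 0` for every `ξ`, i.e. `ker(⌟ch 𝓔) ⊆ ker(⌟ch 𝓔₁)`
on `H¹(X,T_X)`. [cite: BuchweitzFlenner2003, Prop. 4.2, §5] -/
theorem block_sigma_eq_zero_of_isISemiregular {I : Set ℕ} (hI : A.IsISemiregular I) (y₁ : A₁.Ext 2 0) (y₂ : A₂.Ext 2 0)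
    (hsum : ∀ k, D.c₁ k (A₁.semiregularityComponent k y₁) + D.c₂ k (A₂.semiregularityComponent k y₂) = 0) (k : ℕ) :
    A₁.semiregularityComponent k y₁ = 0 := by
  by_contra h
  exact D.not_isISemiregular_of_blockObstruction y₁ y₂ hsum ⟨k, h⟩ I hI

end DirectSumDatum

/-! ### PROP F ∕ TDT — the tautological classes `α·id + ⟨ξ, At⟩` and the tangent–determinant floor -/

/-- TANGENT–DETERMINANT DATUM (abstract): a module `V` (intended: `H²(X,𝒪_X) ⊕ H¹(X,T_X)`, `dim 28 + 64 = 92` on `E_i^8`), the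
tautological map `f : V → Ext²(𝓔,𝓔)`, `f(α, ξ) = α·id_𝓔 + ⟨ξ, At 𝓔⟩` (determinant directions and Kodaira–Spencer obstructions),
and the DESIGN-COMPUTABLE maps `Φ_k : V → H^{k+2}(X,Ω^k)`, `Φ_k(α, ξ) = α ∧ ch_k(𝓔) + ⟨ξ, ch_{k+1}(𝓔)⟩`, with `σ_k ∘ f = Φ_k`
(`σ_k(α·id) = α ∧ ch_k` from Def. 4.1; `σ_k⟨ξ,At⟩ = ⟨ξ, ch_{k+1}⟩` = BF03 Prop. 4.2 ∕ Cor. 4.3, signs absorbed in `f`).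
[cite: BuchweitzFlenner2003, Def. 4.1, Prop. 4.2, Cor. 4.3] -/
structure TangentDeterminantDatum (A : AtiyahTraceAlgebra.{u, v} 𝕜) (V : Type v) [AddCommGroup V] [Module 𝕜 V] where
  /-- `f(α, ξ) = α·id + ⟨ξ, At 𝓔⟩ ∈ Ext²(𝓔,𝓔)` on `V = H²(𝒪_X) ⊕ H¹(T_X)`. -/
  f : V →ₗ[𝕜] A.Ext 2 0
  /-- `Φ_k(α, ξ) = α ∧ ch_k + ⟨ξ, ch_{k+1}⟩ ∈ H^{k+2}(Ω^k)` — read off the design's `ch`. -/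
  Φ : (k : ℕ) → (V →ₗ[𝕜] A.Coh (k + 2) k)
  /-- `σ_k ∘ f = Φ_k` (BF03 Def. 4.1 + Prop. 4.2). -/
  sigma_f : ∀ (k : ℕ) (v : V), A.semiregularityComponent k (f v) = Φ k v

namespace TangentDeterminantDatum

variable {A : AtiyahTraceAlgebra.{u, v} 𝕜} {V : Type v} [AddCommGroup V] [Module 𝕜 V] (T : TangentDeterminantDatum A V)

/-- `ker f ⊆ ker Φ_k` for every `k` (no door needed): a tautological class that vanishes has vanishing `σ`.
[cite: BuchweitzFlenner2003, Prop. 4.2] -/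
theorem ker_f_le_ker_Φ (k : ℕ) : LinearMap.ker T.f ≤ LinearMap.ker (T.Φ k) := by
  intro v hv
  rw [LinearMap.mem_ker] at hv ⊢
  rw [← T.sigma_f, hv, map_zero]

/-- **TDT.** Behind an `I`-door, `ker f = ⋂_{k ∈ I} ker Φ_k`: the door must be injective on the tautological classes, so the
relations among the `f(α,ξ)` are EXACTLY the design-computable ones. Consequences (memo §4): `ext²(𝓔,𝓔) ≥ dim im f = dim V −
dim ⋂_{k∈I} ker Φ_k = rank Φ_I`; a door with `rank Φ_I < rank Φ` is impossible (cell: `rank Φ_{3} = 60 < 76 = rank Φ` on every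
non-geometric design ⟹ no `σ₃`-alone sheaf door; `rank Φ_{≤3} = 76` ⟹ the door of record is consistent, floor `ext² ≥ 76`).
[cite: BuchweitzFlenner2003, Prop. 4.2, §5] -/
theorem ker_eq_iInf_ker_of_isISemiregular {I : Set ℕ} (hI : A.IsISemiregular I) :
    LinearMap.ker T.f = ⨅ k ∈ I, LinearMap.ker (T.Φ k) := by
  refine le_antisymm (le_iInf₂ fun k _ ↦ T.ker_f_le_ker_Φ k) fun v hv ↦ ?_
  rw [LinearMap.mem_ker]
  refine hI _ fun k hk ↦ ?_
  rw [T.sigma_f]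
  exact LinearMap.mem_ker.1 ((Submodule.mem_iInf _).1 ((Submodule.mem_iInf _).1 hv k) hk)

end TangentDeterminantDatum

/-- TDT over a field, counted: behind an `I`-door `finrank (im f) + finrank (⋂_{k∈I} ker Φ_k) = finrank V`, hence
`ext² ≥ finrank V − finrank ⋂_{k∈I} ker Φ_k =: rank Φ_I`. [cite: BuchweitzFlenner2003, Prop. 4.2, §5] -/
theorem TangentDeterminantDatum.finrank_range_f_of_isISemiregular {𝕜' : Type u} [Field 𝕜']
    {A' : AtiyahTraceAlgebra.{u, v} 𝕜'} {V' : Type v} [AddCommGroup V'] [Module 𝕜' V'] [FiniteDimensional 𝕜' V']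
    (T' : TangentDeterminantDatum A' V') {I : Set ℕ} (hI : A'.IsISemiregular I) :
    Module.finrank 𝕜' (LinearMap.range T'.f) + Module.finrank 𝕜' (↥(⨅ k ∈ I, LinearMap.ker (T'.Φ k))) =
      Module.finrank 𝕜' V' := by
  rw [← T'.ker_eq_iInf_ker_of_isISemiregular hI]
  exact LinearMap.finrank_range_add_finrank_ker T'.f

/-! ### The cell's numbers for § v1.4 (`X = E_i^8`, `h^{p,q} = C(8,p)·C(8,q)`) -/

/-- Convolution of coefficient lists (Hilbert series of a tensor product of graded pieces). -/
def hilbConv (a b : List ℕ) : List ℕ :=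
  (List.range (a.length + b.length - 1)).map fun n ↦
    ((List.range (n + 1)).map fun i ↦ a.getD i 0 * b.getD (n - i) 0).sum

/-- PROP W bookkeeping: the letter subalgebra `R ⊂ ⊕_p H^{p,p}(E_i^8)` generated by `u_f, v_f, e_f, ē_f` (per factor Hilbert series
`1 + 4t + t²`: `u², v², e², ē², ue, …` vanish, `uv = p = −eē`) has graded dimensions `(1+4t+t²)⁴ = 1,16,100,304,454,304,100,16,1`
(the ambient `h^{p,p} = C(8,p)²` is `1,64,784,3136,4900,…`); inside either, the `T_W`-horizontal classes are `ℚH^p` (`p ≠ 4`) and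
`ℚH⁴ ⊕ ℚw ⊕ ℚw̄` (memo §3, engine `weiltangent.py`). -/
example : hilbConv (hilbConv [1, 4, 1] [1, 4, 1]) (hilbConv [1, 4, 1] [1, 4, 1]) = [1, 16, 100, 304, 454, 304, 100, 16, 1] := by
  decide

/-- Ambient `h^{p,p}(E_i^8) = C(8,p)²` for `p = 0,…,4`: `1, 64, 784, 3136, 4900`. -/
example : (List.range 5).map (fun p ↦ hodgeNumberAV 8 p p) = [1, 64, 784, 3136, 4900] := by decide

/-- `dim T_W = 16`: the `K`-equivariant polarised first-order directions of `E_i^8 = (E_i^4)_{+i} × (E_i^4)_{−i}` are the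
symmetric `τ` with entries only between the `4` factors of type `+i` and the `4` of type `−i` (the `9`-dimensional Weil moduli of
[Mar25] for `n = 3` become `4·4 = 16` here). -/
example : 4 * 4 = 16 := by decide

/-- `dim V = h^{0,2} + h¹(T_X) = 28 + 8·8 = 92`, and the TDT numbers of the cell: `rank Φ = 92 − 16 = 76` (kernel exactly `T_W`
on the 20 non-geometric designs of record), `rank Φ_{3} = 60`, geometric design TW-32b: `rank Φ = 60`. -/
example : hodgeNumberAV 8 0 2 + 8 * hodgeNumberAV 8 0 1 = 92 ∧ 92 - 16 = 76 ∧ 76 - 16 = 60 := by decide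

/-- Budget of the sheaf door of record (form degrees `k ≤ 3`): `Σ_{k ≤ 3} h^{k,k+2} = 28 + 448 + 1960 + 3136 = 5572`; of the cycle
door `h^{3,5} = 3136`; TDT floor `76 ≤` either. -/
example : ((List.range 4).map fun k ↦ hodgeNumberAV 8 k (k + 2)) = [28, 448, 1960, 3136] ∧
    ((List.range 4).map fun k ↦ hodgeNumberAV 8 k (k + 2)).sum = 5572 ∧ 76 ≤ 3136 := by decide

/-- CA1 on RB16 (hub-16 design of record: sha16 `cff03fec8ca9ad93` = bc5 g12∕c9, `a8bb00d9eddab199` = monad-3 classblind): `17` live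
components = `1` rank-`0` block + `16` free orbit letters `N[(12,−2,0)³,(13,0,1)]` (each a lone summand `L_Z`); ONE such letter has `1038`
e-mixed (A1)-violations (`μ = −8i`), the sixteen together `192` (`μ = −128i` of the design's `−256i`), the rank-`0` rest `192` — DEAD by
ROW CA1 for every choice of maps and of Pic⁰-twists (engines `c4graph.py`, `c4class.py`; `data/ca1-rb16.out`). -/
example : 1 + 16 = 17 ∧ (-128 : ℤ) + (-128) = -256 ∧ 16 * 8 = 128 := by decide

end SeedEndomorphismStructure

/-!
## v1.5 (g4) — `SlopeDiscipline`: the boundary-slope law of two-term rooms, edge-forced semistability, block destabilisers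
(ROW BD), the Simpson class and ROW HZ (memo `C4-SLOPE-DISCIPLINE-c4-1-g4.md` §§A–C)

HONEST FRAMING (as for the whole file). Every `def` below is ARITHMETIC ∕ ORDER on design data; the sheaf-level statement it certifies
is in its docstring and is proved with pen in the memo (half a page each, standard slope theory on the polarised abelian 8-fold
`(X, Θ)`: a rank-`k` subsheaf of a direct sum of line bundles has `Θ`-degree at most the sum of the `k` largest degrees; Bogomolov;
[Simpson 1992, Cor. 3.10]). A TWO-TERM ROOM is a presentation `0 → P —φ→ N → 𝓔 → 0` (orientation UP, `𝓔 = coker φ`) or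
`0 → 𝓔 → N —ψ→ P → 0` (orientation DOWN, `𝓔 = ker ψ`, `ψ` surjective), `N`, `P` direct sums of Pic⁰-translates of letter bundles
`L_Z` with the multiplicities `mN`, `mP` of a `LetterDesign`; ARBITRARY maps, ARBITRARY Pic⁰ labels (twists do not change slopes and only
REMOVE live arrows), `𝓔` torsion-free of rank `rank = Σ ν > 0`. Slopes in letter units: `s(Z) = slopeUnits Z`, `s(𝓔) = degNum ∕ rank`.
Nothing here is a theorem about sheaves; nothing is a rung toward `stub_rung_pad4_seedAt` ∕ 18881 ∕ HC; no `sorry`, no axiom, no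
instance, no notation.
-/

section SlopeDiscipline

namespace LetterDesign

/-- **DOWN law** (memo §A, THEOREM SL (i)): in a DOWN room `𝓔 ⊂ N`, so `μ(𝓔) ≤ μ_max(N)` = the largest slope of an `N`-letter USED:
necessary `degNum ≤ rank · s(Z)` for some `Z` with `mN Z > 0`. Violated ⟹ the design has NO DOWN realisation with `𝓔` torsion-free. -/
def DownWindow (D : LetterDesign) : Prop := ∃ Z ∈ D.cells, 0 < D.mN Z ∧ D.degNum ≤ D.rank * slopeUnits Z

/-- **UP law** (memo §A, THEOREM SL (ii)): in an UP room `𝓔` is a torsion-free quotient of `N`, so `μ(𝓔) ≥ μ_min(N)`: necessary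
`rank · s(Z) ≤ degNum` for some `Z` with `mN Z > 0`. -/
def UpWindow (D : LetterDesign) : Prop := ∃ Z ∈ D.cells, 0 < D.mN Z ∧ D.rank * slopeUnits Z ≤ D.degNum

/-- **DOWN edge** (memo §A, THEOREM SL (iii)): `μ_max(N) ≤ μ(𝓔)`. Together with the DOWN law this forces `μ(𝓔) = μ_max(N)` and then
EVERY subsheaf `F ⊂ 𝓔 ⊂ N` has `μ(F) ≤ μ_max(N) = μ(𝓔)`: in every DOWN realisation `𝓔` is μ_Θ-SEMISTABLE (forced by the design).
Consequences: `bogomolovNumber ≥ 0` is necessary, and `SemistableDead` kills the room (`𝓔 = ker ψ` is locally free automatically). -/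
def DownEdge (D : LetterDesign) : Prop := ∀ Z ∈ D.cells, 0 < D.mN Z → D.rank * slopeUnits Z ≤ D.degNum

/-- **UP edge** (memo §A, THEOREM SL (iv)): `μ(𝓔) ≤ μ_min(N)`; with the UP law, `μ(𝓔) = μ_min(N)` and every torsion-free quotient
`𝓔 ↠ Q` (a quotient of `N`) has `μ(Q) ≥ μ_min(N) = μ(𝓔)`: `𝓔` is μ_Θ-SEMISTABLE in every UP realisation. -/
def UpEdge (D : LetterDesign) : Prop := ∀ Z ∈ D.cells, 0 < D.mN Z → D.degNum ≤ D.rank * slopeUnits Z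

/-- `4 · m₁` of a design read at height `h`: `m₁ := q₁ − rank · h` (`4 q₁ = degNum`); on an (A1)-clean LINE-`h` design
`ch(𝓔 ⊗ 𝒪(−hΘ)) = rank + m₁ · H + w` EXACTLY (all other coefficients vanish: the LC tensor frame, memo §A (1)), so `bogomolovNumber = m₁²`
and `m₁ = 0` is the SIMPSON CLASS of the LINE world. -/
def fourM1 (D : LetterDesign) (h : ℕ) : ℤ := D.degNum - 4 * (h : ℤ) * D.rank

end LetterDesign

/-- The logical skeleton of edge-forcing (THEOREM SL (iii)/(iv)), kernel-checked in the abstract: if every member of a family of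
"sub-objects" has slope `≤ top` and `top ≤ μE`, every member has slope `≤ μE`. (Instance: `S` = subsheaves of `𝓔`, all of which are
subsheaves of `N`; `top = μ_max(N)`; `μE = μ(𝓔)`.) -/
theorem slope_le_of_sub_bound {ι : Type*} (μ : ι → ℚ) (S : Set ι) (top μE : ℚ)
    (hS : ∀ F ∈ S, μ F ≤ top) (hedge : top ≤ μE) : ∀ F ∈ S, μ F ≤ μE :=
  fun F hF => (hS F hF).trans hedge

/-- **Forced-semistable numerics that cannot exist** (memo §A, THEOREM SL-B): a μ_Θ-semistable LOCALLY FREE sheaf with (A1)-clean class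
`ch = Σ q_k Hᵏ∕k! + w`, `w = μ e⁴ + μ̄ ē⁴`, has `B_r = q₁² − r q₂ ≥ 0` (Bogomolov), and `B_r = 0` forces `𝓔nd 𝓔` semistable with
`c₁ = 0 = ch₂ · Θ⁶`, hence an extension of flat bundles [Simpson 1992, Cor. 3.10], hence `ch(𝓔nd 𝓔) = r²`, hence the normalised classes
`z₂ = z₄ = 0` and `ch₄(𝓔) ∈ ℚ H⁴ + H · H⁶(X, ℚ)`, whose Weil coordinate vanishes (`H · ē⁴ = 0`): `μ = 0`. So `B_r < 0`, or
`B_r = 0` with `μ ≠ 0`, is incompatible with forced semistability (an EDGE room) — and with ANY semistable locally free realisation. -/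
def SemistableDead (r q₁ q₂ μre μim : ℤ) : Prop :=
  LetterDesign.bogomolovNumber r q₁ q₂ < 0 ∨ (LetterDesign.bogomolovNumber r q₁ q₂ = 0 ∧ (μre ≠ 0 ∨ μim ≠ 0))

/-- **The Simpson class** (memo §C): `B_r = 0 ∧ μ ≠ 0`. Certifies: (i) NO realisation (any room, any maps, any labels) has
`𝓔` locally free and μ_Θ-semistable on `X₀`; (ii) HORIZONTAL HN LAW — behind any door (Buchweitz–Flenner Thm 5.1 ⟹ a locally free
deformation `(X_t, 𝓔_t)` over the very general fibre of the Weil family, `NS(X_t) = ℤ H_t`, `B^p(X_t) = ℚ H_t^p` for `p ≠ 4`,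
`B⁴ = ℚ H⁴ ⊕ ℚ w ⊕ ℚ w̄` [vanGeemen1994, 6.12]) the bundle `𝓔_t ⊗ 𝒪(−(q₁∕r) H_t)` is μ-UNSTABLE and every Harder–Narasimhan factor
has (A1)-INTEGRAL classes `c₁ = aᵢ H_t (aᵢ ∈ ℤ)`, `ch₂ = mᵢ H_t²∕2 (mᵢ ∈ ℤ)`, `aᵢ² ≥ rᵢ mᵢ`, `Σ aᵢ = 0 = Σ mᵢ`; its flat limit is an
(A1)-clean destabilising subsheaf of `𝓔₀ ⊗ 𝒪(−(q₁∕r)Θ)` of `Θ`-degree `4a · 10080`, `a ≥ 1` (ROW HZ below). On a LINE design this is `m₁ = 0`. -/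
def SimpsonClass (r q₁ q₂ μre μim : ℤ) : Prop :=
  LetterDesign.bogomolovNumber r q₁ q₂ = 0 ∧ (μre ≠ 0 ∨ μim ≠ 0)

theorem semistableDead_of_simpsonClass {r q₁ q₂ μre μim : ℤ} (h : SimpsonClass r q₁ q₂ μre μim) :
    SemistableDead r q₁ q₂ μre μim := Or.inr h

/-- The live TW-32b addresses are Simpson-class (table `data/c4slope-table-g4.txt` 6fb6dd4c…; `μ′ = −256 i` [rbtwist CLASS row]):
TW32b-p32-sharp a1a8405d (`r = 64`, `q₁ = 896`, `q₂ = 12544`). -/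
example : SimpsonClass 64 896 12544 0 (-256) := ⟨by decide, Or.inr (by decide)⟩
/-- TW32b-p8-tau a009d00f ∕ -hub3 98386e74 ∕ -hub4 64b6d3fe (`r = 40`, `q₁ = 560`, `q₂ = 7840`). -/
example : SimpsonClass 40 560 7840 0 (-256) := ⟨by decide, Or.inr (by decide)⟩
/-- TW32b-p40-sharp-u8 5050551f (`r = 72`, `q₁ = 1008`, `q₂ = 14112`). -/
example : SimpsonClass 72 1008 14112 0 (-256) := ⟨by decide, Or.inr (by decide)⟩
/-- RB16 cff03fec is NOT Simpson-class (`B₁₆ = 16 = m₁²`, `m₁ = 4`): semistability is not excluded by class there. -/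
example : LetterDesign.bogomolovNumber 16 228 3248 = 4 ^ 2 := by decide

/-! ### Block destabilisers (ROW BD) and ROW HZ — arithmetic on slope blocks -/

/-- Sum of the `k` largest entries of a finite multiset of integers presented as value blocks `(value, multiplicity)` listed in
DECREASING value order (`SortedDesc`); for such a list this is `top_k` of the memo. -/
def topSum : List (ℤ × ℕ) → ℕ → ℤ
  | [], _ => 0
  | (v, m) :: t, k => v * ((min m k : ℕ) : ℤ) + topSum t (k - min m k)

/-- Boolean test: the block list is in decreasing value order. -/
def sortedDesc : List (ℤ × ℕ) → Bool
  | [] => true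
  | [_] => true
  | a :: b :: t => decide (b.1 ≤ a.1) && sortedDesc (b :: t)

/-- The block list is in decreasing value order (as a `Prop`, via the Boolean test so that `decide` evaluates it). -/
def SortedDesc (l : List (ℤ × ℕ)) : Prop := sortedDesc l = true

/-- Data of ROW BD for an UP room and a set `T` of `N`-cells (memo §B, THEOREM BD): `r = rank 𝓔 > 0`, `degNum = r · s(𝓔)`;
`nT` = number of `N`-copies on `T`, `dT` = the sum of their slopes; `p` = number of `P`-copies, `pBlocks` = their slopes as decreasing
blocks; `pT` = number of `P`-copies ALL of whose cell-live `N`-targets lie in `T` (for every map and every Pic⁰ labelling their image lies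
in `N_T`, twists only removing live arrows). -/
structure BlockDestabDatum where
  r : ℕ
  degNum : ℤ
  nT : ℕ
  dT : ℤ
  pT : ℕ
  p : ℕ
  pBlocks : List (ℤ × ℕ)

namespace BlockDestabDatum

/-- **ROW BD certificate** (memo §B, THEOREM BD). With `p′ := rank φ⁻¹(N_T) ∈ [pT, min(p, nT)]`: the image `𝓔_T` of `N_T` in `𝓔` has
rank `nT − p′` and degree `≥ dT − top_{p′}(P)` (a rank-`p′` subsheaf of `P` has degree `≤ top_{p′}(P)`); `p′ = nT` is impossible when
`dT > top_{nT}(P)` (`𝓔` torsion-free forces `φ⁻¹(N_T) ≅ N_T`). The predicate says: the datum is consistent (`pT ≤ min(p, nT)`, else NO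
realisation: `φ` cannot be injective) and for EVERY admissible `p′` either `𝓔_T ≠ 0` has slope `> μ(𝓔)` (cross-multiplied) or `p′ = nT`
is excluded. Certifies: in every UP realisation (any maps, any labels, `𝓔` torsion-free) `𝓔_T` DESTABILISES `𝓔` — `𝓔` is μ_Θ-UNSTABLE,
with a destabiliser visible in the design. (When instead NO `p′` is admissible the room has no torsion-free realisation at all: the
tight-block degree contradiction of rbtwist R8a.) -/
def Destabilises (B : BlockDestabDatum) : Prop :=
  SortedDesc B.pBlocks ∧ 0 < B.r ∧ B.pT ≤ min B.p B.nT ∧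
  ∀ p' : ℕ, B.pT ≤ p' → p' ≤ min B.p B.nT →
    (p' < B.nT ∧ B.degNum * ((B.nT - p' : ℕ) : ℤ) < (B.dT - topSum B.pBlocks p') * (B.r : ℤ)) ∨
    (p' = B.nT ∧ topSum B.pBlocks B.nT < B.dT)

/-- TW32b-p8-tau a009d00f (also -hub3 98386e74, -hub4 64b6d3fe): `T` = the hub cell, `N_T` = 40 hub copies (slope 56 each),
`P` = 16 × P71 (50) ⊕ 16 × P70 (49) ⊕ 16 × P69 (48), `pT = 32` (P70, P71 have the hub as only cell-live target); `μ(𝓔) = 56`;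
the hub image has slope `≥ 82`. -/
def tw32bP8 : BlockDestabDatum := ⟨40, 2240, 40, 2240, 32, 48, [(50, 16), (49, 16), (48, 16)]⟩

example : tw32bP8.Destabilises := by unfold Destabilises tw32bP8 SortedDesc; decide

/-- TW32b-p32-sharp a1a8405d: 64 hub copies (rescuers), same `P`; hub image slope `≥ 125∕2 > 56`. -/
def tw32bP32 : BlockDestabDatum := ⟨64, 3584, 64, 3584, 32, 48, [(50, 16), (49, 16), (48, 16)]⟩

example : tw32bP32.Destabilises := by unfold Destabilises tw32bP32 SortedDesc; decide

/-- TW32b-p40-sharp-u8 5050551f: 72 hub copies; hub image slope `≥ 306∕5 > 56`. -/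
def tw32bP40 : BlockDestabDatum := ⟨72, 4032, 72, 4032, 32, 48, [(50, 16), (49, 16), (48, 16)]⟩

example : tw32bP40.Destabilises := by unfold Destabilises tw32bP40 SortedDesc; decide

end BlockDestabDatum

/-- **ROW HZ, collapsed form for the Simpson class of a LINE design** (memo §C, THEOREM HZ): with `N`-charges `c(Z) = 4h − s(Z)` as
decreasing blocks, a door needs an (A1)-clean destabiliser of `𝓔₀(−hΘ)` of degree `4a ≥ 4` inside `N(−hΘ) ∕ φ(P(−hΘ))`, which forces
`top_{r−1}(c|N) ≥ 4` (both HZ inequalities coincide when `m₁ = 0`, i.e. `C_N = C_P`). Honest: passes on every live address. -/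
def RowHZ (nChargeBlocks : List (ℤ × ℕ)) (r : ℕ) : Prop := SortedDesc nChargeBlocks ∧ 4 ≤ topSum nChargeBlocks (r - 1)

/-- TW32b-p32-sharp: `N` = 48 × N18 (charge 7) ⊕ 64 hubs (charge 0), `r = 64`: `top_63 = 336 ≥ 4`. -/
example : RowHZ [(7, 48), (0, 64)] 64 := by unfold RowHZ SortedDesc; decide
/-- TW32b-p8-tau: `r = 40`: `top_39 = 273 ≥ 4`. -/
example : RowHZ [(7, 48), (0, 40)] 40 := by unfold RowHZ SortedDesc; decide

end SlopeDiscipline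


/-!
## v1.6 (g5) — `LiftLaws`: ROW CC (scalar-class collision), the block budgets, and the colour-1 τ-lift law
(memo `C4-LIFT-LAWS-c4-1-g5.md` §§1–3; director R19.341; colour-1 LEMMA τ ∕ T1e `T1e-LIFTING-LEMMA-colour1-g2.md` 6b50bd63)

HONEST FRAMING (as for the whole file). Nothing below is a theorem about a sheaf or a variety and nothing is a rung toward
`stub_rung_pad4_seedAt` ∕ 18881 ∕ 26512 ∕ №4 ∕ H2 ∕ HC ∕ HC_CM ∕ HC_AV. Kernel-checked: (i) pure algebra over the tree's
`AtiyahTraceAlgebra` (ROW CC as an INSTANCE SCHEMA of THEOREM CA1 restricted to the degrees of one door), (ii) linear algebra over a field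
(the budgets), (iii) decidable letter combinatorics and integer arithmetic (the lift law's counting, one Gaussian-integer divisibility, the
scaling of the class data, the lifted ROW BD data of the live TW-32b addresses). The sheaf-level dictionary is in the docstrings; the pen
proofs (half a page each) are in the memo.

* ROW CC. On a FORCED splitting `𝓔 = ⊕_Γ 𝓔_Γ` (connected components `Γ` of the live graph; EVERY realisation is block-diagonal because
  `Hom = 0` off the live arrows) the scalar classes `β · id_Γ` (`β ∈ H^{0,2}(X) = H²(𝒪_X)`, `dim = 28` on `E_i^8`) have
  `σ_q(β · id_Γ) = β ∧ ch_q(𝓔_Γ)` [BF03, Def. 4.1 + §3 (σ on `H²(𝒪)·id` is `∧ ch`)]. Blockwise (A1) (ROW CA1) gives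
  `ch_q(𝓔_Γ) = c_{q,Γ} · H^q∕q!` for `q ≤ 3`, and hard Lefschetz (`∧H^q : H^{0,2} → H^{q,q+2}` injective for `q ≤ 6`) turns
  `σ_J(Σ_Γ β_Γ id_Γ) = 0` into `M · (β_Γ)_Γ = 0`, `M = (c_{q,Γ})_{q ∈ J, Γ}`. NECESSARY for the door with form degrees `J`
  (`J = I − 1` in BF indexing; door of record `I = {1,2,3,4}`, `J = {0,1,2,3}`, `σ₀ = trace`): the class vectors
  `v_Γ = (c_{q,Γ})_{q∈J}` of the LIVE blocks (`r_Γ > 0`) are ℚ-linearly independent — BLOCK BUDGET `#live blocks ≤ |J|` (`≤ 4`;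
  `≤ 2` at `I = {3,4}`; `≤ 1` at `I = {4}`), LINE BUDGET `≤ 2` (on a LINE design `v_Γ ∈ span{(1,h,h²,h³), (0,1,2h,3h²)}`).
  Two blocks with EQUAL total class (all degrees, `μ` included) kill EVERY door (CA1-strength).
* τ-LIFTS (colour-1 LEMMA τ). `D♯_F` replaces every copy-class `(cell, t, m)` by the `2^{|F|}` classes `(cell, t + Σ_{f∈F} b_f τ_f, m)`,
  `τ = (P₂,P₂) ∈ Pic⁰(E_i²)[1+i]`; a lifted arrow `(x,b) → (y,c)` is live iff `x → y` is live in `D` and `b_f = c_f` on every `f ∈ F`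
  with `Δ_f = 0` (null and ample factors are bit-blind: `τ ∈ Λ(n)` for EVERY balanced null direction `n` —
  `one_add_i_dvd_add_of_norm_eq` — and `h⁰ = χ` on ample ones). THEOREM LL (voltage graph): under (GEN) «no dead `Δ_f = 0` factor of
  `D` has twist difference exactly `τ`» (automatic without tor atoms; checked by `code∕c4lift.py` otherwise) the lifted blocks over a
  block `Γ` of `D` are the `2^{|F ∖ mov Γ|}` cosets of `G_Γ = ⊕_{f ∈ F ∩ mov Γ} ℤ∕2`, ALL OF THE SAME CLASS `|G_Γ| · ch(𝓔_Γ)`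
  (`mov Γ` = factors moved by some live arrow of `Γ`). Hence: CLASS ∕ (A1) ∕ `ClassDataRankFree`-type rows, CA1, the slope rows of
  § `SlopeDiscipline` (windows, edges, `SemistableDead`, `SimpsonClass`, ROW BD, ROW HZ) are LIFT-INVARIANT, and ROW CC lifts by the law
  «`D♯_F` passes iff `D` passes and `F ⊆ mov Γ` for every live `Γ`; otherwise DEAD AT EVERY DOOR (equal-class cosets)».
  On every design of record (S′ ac808a66 ∕ 08162ddb, S131 bf2edc09, M 1840bf64, TW-32a∕b, TW-18×120, MIN-T4 b3940cff∕7fe678c9, …) the live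
  graph is connected with `mov = {0,1,2,3}` (table `data∕c4lift-table-g5.txt`): all lifts stay forced-connected, CC is vacuous there —
  honest. RB16 (16 uncovered rank-1 blocks) is dead by the budget alone, and every lift of it 2^{|F|} times over.
References: [BF03] Buchweitz–Flenner, Compositio Math. 137 (2003) 135–210, arXiv:math/9912245, §3, Def. 4.1, Prop. 4.2, §5;
[GT80] Gross–Tucker, Topological graph theory (voltage graphs ∕ derived covers, Thm. 2.5.1) for the component count of a `(ℤ∕2)^F`-lift;
[HL10] Huybrechts–Lehn, 2nd ed., §10.1; [Mum70] Mumford, Abelian varieties, §16 (cohomology of line bundles: `h⁰ = χ` for ample,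
`H⁰(P) = 0` for `P ∈ Pic⁰ ∖ 0`) and §13 (pull-back of `Pic⁰` under an isogeny = dual isogeny) for LEMMA τ.
-/

section LiftLaws

/-! ### ROW CC — THEOREM CA1 restricted to the degrees of one door, and its scalar-class instance -/

namespace DirectSumDatum

universe u v

open Literature.AlgebraicGeometry.HodgeTheory

variable {𝕜 : Type u} [CommRing 𝕜] {A A₁ A₂ : AtiyahTraceAlgebra.{u, v} 𝕜} (D : DirectSumDatum A A₁ A₂)

/-- **CA1 at one door** (sharpens `not_isISemiregular_of_blockObstruction`: cancellation is only needed in the degrees `k ∈ I` that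
the door tests, and non-vanishing of EITHER block class suffices). If `y_j ∈ Ext²(𝓔_j, 𝓔_j)` have `σ`-images cancelling in every
degree `k ∈ I` and `(y₁, y₂) ≠ 0`, then `𝓔 = 𝓔₁ ⊕ 𝓔₂` is not `I`-semiregular: `x = ι₁ y₁ + ι₂ y₂ ≠ 0` lies in `ker σ_I`.
[cite: BuchweitzFlenner2003, Def. 4.1, Prop. 4.2, §5 (I-semiregular)] -/
theorem not_isISemiregular_of_blockCancellationOn {I : Set ℕ} (y₁ : A₁.Ext 2 0) (y₂ : A₂.Ext 2 0)
    (hsum : ∀ k ∈ I, D.c₁ k (A₁.semiregularityComponent k y₁) + D.c₂ k (A₂.semiregularityComponent k y₂) = 0)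
    (hne : y₁ ≠ 0 ∨ y₂ ≠ 0) : ¬ A.IsISemiregular I := by
  intro hI
  have hx : D.ι₁ y₁ + D.ι₂ y₂ = 0 :=
    hI _ fun k hk ↦ by rw [map_add, D.sigma_ι₁, D.sigma_ι₂, hsum k hk]
  obtain ⟨h₁, h₂⟩ := D.inj y₁ y₂ hx
  exact hne.elim (fun h ↦ h h₁) (fun h ↦ h h₂)

/-- **ROW CC (scalar-class collision).** Abstract instance schema: `s_j : V → Ext²(𝓔_j, 𝓔_j)` (intended: `V = H^{0,2}(X)`,
`s_j β = β · id_{𝓔_j}`), `w k : V → H^{k+2}(Ω^k)` (intended: `β ↦ β ∧ H^k∕k!`), and scalars `u_j k` with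
`σ^{𝓔_j}_k(s_j β) = u_j k · w k β` read in the common target (intended: `u_j k = c_k(𝓔_j)`, the coefficient of `H^k∕k!` in `ch(𝓔_j)`,
available when the block is (A1)-clean in degree `k` — ROW CA1 — via `σ_k(β · id) = β ∧ ch_k`). A COLLISION `a₁ u₁ k + a₂ u₂ k = 0`
for all `k ∈ I` with `a₁ s₁ β ≠ 0` (or `a₂ s₂ β ≠ 0`) kills the door `I`: `x = a₁ β·id₁ ⊕ a₂ β·id₂ ∈ ker σ_I ∖ 0`. With `c` blocks the
same schema applied to a ℚ-dependence `Σ a_Γ v_Γ = 0` of the vectors `v_Γ = (u_Γ k)_{k∈I}` gives the BLOCK BUDGET below; `a_Γ s_Γ β ≠ 0`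
holds for a live block (`tr(a β · id_Γ) = r_Γ a β ≠ 0`, `r_Γ > 0`, characteristic `0`).
[cite: BuchweitzFlenner2003, §3 (σ on H²(𝒪)·id = ∧ch), Def. 4.1, Prop. 4.2] -/
theorem not_isISemiregular_of_scalarCollision {I : Set ℕ} {V : Type*} [AddCommGroup V] [Module 𝕜 V]
    (s₁ : V →ₗ[𝕜] A₁.Ext 2 0) (s₂ : V →ₗ[𝕜] A₂.Ext 2 0) (w : (k : ℕ) → (V →ₗ[𝕜] A.Coh (k + 2) k)) (u₁ u₂ : ℕ → 𝕜)
    (hσ₁ : ∀ k β, D.c₁ k (A₁.semiregularityComponent k (s₁ β)) = u₁ k • w k β)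
    (hσ₂ : ∀ k β, D.c₂ k (A₂.semiregularityComponent k (s₂ β)) = u₂ k • w k β)
    (a₁ a₂ : 𝕜) (hcol : ∀ k ∈ I, a₁ * u₁ k + a₂ * u₂ k = 0) (β : V) (hne : a₁ • s₁ β ≠ 0 ∨ a₂ • s₂ β ≠ 0) :
    ¬ A.IsISemiregular I := by
  refine D.not_isISemiregular_of_blockCancellationOn (a₁ • s₁ β) (a₂ • s₂ β) (fun k hk ↦ ?_) hne
  rw [map_smul, map_smul, map_smul, map_smul, hσ₁, hσ₂, smul_smul, smul_smul, ← add_smul, hcol k hk, zero_smul]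

end DirectSumDatum

/-! ### The budgets (linear algebra): `c` independent class vectors in `ℚ^{|J|}` need `c ≤ |J|`; inside a 2-plane, `c ≤ 2` -/

/-- **BLOCK BUDGET.** Linearly independent vectors `v : ι → K^d` number at most `d`. ROW CC instance: `K = ℚ`, `d = |J|` (`= 4` at the
door of record, `2` at `I = {3,4}`, `1` at `I = {4}`), `ι` = the live blocks of the forced splitting: a design with more than `|J|`
live forced blocks is dead at that door before any class is computed (RB16 cff03fec: `16 > 4`; every lift `RB16♯_F`: `16 · 2^{|F|} > 4`). -/
theorem blockBudget {K : Type*} [Field K] {ι : Type*} [Fintype ι] {d : ℕ} (v : ι → (Fin d → K))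
    (hv : LinearIndependent K v) : Fintype.card ι ≤ d := by
  simpa using hv.fintype_card_le_finrank

/-- **LINE BUDGET.** If the class vectors factor through a 2-space (`v = A ∘ u`, `u : ι → K²`) — on a LINE design of height `h` every
block has `ch(𝓔_Γ) = e^{hH}(r_Γ + m_{1,Γ} H∕1!·e^{-hH}…)`, i.e. `(c_0,…,c_3)_Γ = r_Γ (1,h,h²,h³) + m_{1,Γ} (0,1,2h,3h²)` — then independence
allows at most TWO live blocks, and two need non-proportional `(r_Γ, m_{1,Γ})`; in particular a free (uncoupled) copy of a letter never
rescues an `m₁ = 0` design at a door containing two degrees. -/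
theorem lineBudget {K : Type*} [Field K] {ι : Type*} [Fintype ι] {W : Type*} [AddCommGroup W] [Module K W]
    (A : (Fin 2 → K) →ₗ[K] W) (u : ι → (Fin 2 → K)) (hv : LinearIndependent K (A ∘ u)) : Fintype.card ι ≤ 2 :=
  blockBudget u (hv.of_comp A)

/-- Two blocks with the same class vector are dependent (the lift law's «equal-class cosets» and every duplicated free letter). -/
theorem not_linearIndependent_of_eq {K : Type*} [Field K] {ι : Type*} {M : Type*} [AddCommGroup M] [Module K M]
    {v : ι → M} {i j : ι} (hij : i ≠ j) (h : v i = v j) : ¬ LinearIndependent K v :=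
  fun hv ↦ hij (hv.injective h)

/-! ### The τ-lift law at letter level (LEMMA τ liveness, moved factors, block count) -/

/-- The factors MOVED by an arrow `P → Z` (`Δ_f ≠ 0`). -/
def movedFactors (P Z : MCell) : Finset (Fin 4) := Finset.univ.filter fun f ↦ Z f ≠ P f

/-- **LEMMA τ liveness** of a lifted arrow `(P, b) → (Z, c)` between PLAIN copies (`b, c` = τ-bits on the lift set `F`): live iff
`P ≤ Z` and the bits agree on every lifted factor that the arrow does not move (`H⁰` of a non-trivial torsion line bundle on `E_i²` is `0`;
on a moved factor `τ ∈ Λ(n)` (null) resp. `h⁰ = χ` (ample) make the bit invisible). For twisted copies replace `P ≤ Z` by the room's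
live relation; the bit clause is the same. [colour-1 LEMMA τ ∕ T1e; Mumford §16, §13] -/
def LiftLive (F : Finset (Fin 4)) (b c : Fin 4 → Bool) (P Z : MCell) : Prop :=
  MCell.le P Z ∧ ∀ f ∈ F, Z f = P f → b f = c f

/-- An arrow moving every factor is bit-blind: all `2^{|F|} × 2^{|F|}` of its lifts are live. -/
theorem liftLive_iff_of_movedFactors_eq_univ {F : Finset (Fin 4)} {b c : Fin 4 → Bool} {P Z : MCell}
    (h : movedFactors P Z = Finset.univ) : LiftLive F b c P Z ↔ MCell.le P Z := by
  refine ⟨fun hl ↦ hl.1, fun hle ↦ ⟨hle, fun f _ hf ↦ ?_⟩⟩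
  have hmem : f ∈ movedFactors P Z := h ▸ Finset.mem_univ f
  exact absurd hf (Finset.mem_filter.1 hmem).2

/-- An arrow moving NO lifted factor preserves every bit: its lifts are the `2^{|F|}` parallel copies `(P,b) → (Z,b)`. -/
theorem liftLive_iff_of_disjoint {F : Finset (Fin 4)} {b c : Fin 4 → Bool} {P Z : MCell}
    (h : ∀ f ∈ F, Z f = P f) : LiftLive F b c P Z ↔ MCell.le P Z ∧ ∀ f ∈ F, b f = c f :=
  ⟨fun hl ↦ ⟨hl.1, fun f hf ↦ hl.2 f hf (h f hf)⟩, fun hr ↦ ⟨hr.1, fun f hf _ ↦ hr.2 f hf⟩⟩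

/-- **THEOREM LL, the count.** Over a live block `Γ` of `D` with moved-factor set `mov`, the lift `D♯_F` has `2^{|F ∖ mov|}` blocks
(the cosets of `G_Γ = (ℤ∕2)^{F ∩ mov}` in `(ℤ∕2)^F`; voltage-graph component count [GT80, Thm. 2.5.1]) … -/
def liftBlockCount (F mov : Finset (Fin 4)) : ℕ := 2 ^ (F \ mov).card

/-- … each of class `2^{|F ∩ mov|} · ch(𝓔_Γ)` (`|G_Γ|` lifted copies of every letter of `Γ` per coset). -/
def liftClassFactor (F mov : Finset (Fin 4)) : ℕ := 2 ^ (F ∩ mov).card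

/-- Blocks × class factor = `2^{|F|}` (mass conservation of the lift). -/
theorem liftBlockCount_mul_liftClassFactor (F mov : Finset (Fin 4)) :
    liftBlockCount F mov * liftClassFactor F mov = 2 ^ F.card := by
  rw [liftBlockCount, liftClassFactor, ← pow_add, Finset.card_sdiff_add_card_inter]

/-- **The CC lift law, combinatorial half.** The lift over `Γ` stays ONE block iff `F ⊆ mov Γ`; otherwise it falls into `≥ 2` blocks of
EQUAL class, which `not_linearIndependent_of_eq` + ROW CC (indeed CA1: all degrees) kill at every door. -/
theorem liftBlockCount_eq_one_iff (F mov : Finset (Fin 4)) : liftBlockCount F mov = 1 ↔ F ⊆ mov := by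
  rw [liftBlockCount, ← Finset.sdiff_eq_empty_iff_subset]
  refine ⟨fun h ↦ ?_, fun h ↦ by rw [h, Finset.card_empty, pow_zero]⟩
  by_contra hne
  have hpos : 0 < (F \ mov).card := Finset.card_pos.2 (Finset.nonempty_iff_ne_empty.2 hne)
  have h2 : 2 ≤ 2 ^ (F \ mov).card := by
    calc (2 : ℕ) = 2 ^ 1 := (pow_one 2).symm
      _ ≤ 2 ^ (F \ mov).card := Nat.pow_le_pow_right (by norm_num) hpos
  omega

/-- TW-32b (and TW-32a, TW-18×120: the same P70-type letter): the arrow `P70 = [12,−2,0]³[13,0,−1] → Hub = [14,0,0]⁴` is live under the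
canonical lift and moves ALL FOUR factors, so `mov(Γ) = {0,1,2,3}` for the unique block and every τ-lift of these addresses stays
forced-connected (CC vacuous there; table `data∕c4lift-table-g5.txt`). [`decide`] -/
def p70Cell : MCell := ![((12 : ℤ), (-2 : ℤ), (0 : ℤ)), (12, -2, 0), (12, -2, 0), (13, 0, -1)]

/-- The hub letter `[14,0,0]⁴` of the LINE-14 addresses. -/
def hubCell : MCell := ![((14 : ℤ), (0 : ℤ), (0 : ℤ)), (14, 0, 0), (14, 0, 0), (14, 0, 0)]

example : MCell.le p70Cell hubCell := by decide

example : ∀ f : Fin 4, hubCell f ≠ p70Cell f := by decide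

example (F : Finset (Fin 4)) : liftBlockCount F Finset.univ = 1 :=
  (liftBlockCount_eq_one_iff F _).2 (Finset.subset_univ F)

/-- RB16-type uncovered letter: a block with NO arrow has `mov = ∅`, so its lift by all four factors splits into `16` equal-class blocks. -/
example : liftBlockCount Finset.univ (∅ : Finset (Fin 4)) = 16 := by decide

/-! ### LEMMA τ, null clause — the arithmetic heart: `τ = (P₂, P₂)` dies on every balanced elliptic curve -/

/-- **`(1+i) ∣ p + q` whenever `N(p) = N(q)`** (`ℤ[i]∕(1+i) = 𝔽₂` and `N(m) ≡ m mod (1+i)`). Dictionary: a primitive null letter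
direction of the BALANCED frame is `n = (|p|², p q̄)` up to scale with `|p|² = |q|²` (equal diagonal entries), its curve is
`C_{p,q} = {(p z, q z)} ⊂ E_i²`, and `τ|_{C_{p,q}} = [p]^*P₂ ⊗ [q]^*P₂ = (p̄ + q̄) · P₂ = 0` because `P₂ = (1+i)∕2` is the `(1+i)`-torsion
point and `(1+i) ∣ p + q` (equivalently `∣ p̄ + q̄`). Hence `τ ∈ Λ(n) = ker(Pic⁰(E_i²) → Pic⁰(C_n))` for EVERY balanced null direction,
chain (`k = 1`) or not (e.g. `(5,4,3)`: `p = 2 − i`, `q = 1 − 2i`) — the null clause of LEMMA τ beyond colour-1's chain directions.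
[cite: Mumford1970AbelianVarieties, §13, §16] -/
theorem one_add_i_dvd_add_of_norm_eq (p q : GaussianInt) (h : p.norm = q.norm) : (⟨1, 1⟩ : GaussianInt) ∣ p + q := by
  obtain ⟨a, b⟩ := p
  obtain ⟨c, d⟩ := q
  have h' : a * a + b * b = c * c + d * d := by
    have := h
    simp only [Zsqrtd.norm_def] at this
    linear_combination this
  obtain ⟨ka, hka⟩ := Int.even_mul_succ_self a
  obtain ⟨kb, hkb⟩ := Int.even_mul_succ_self b
  obtain ⟨kc, hkc⟩ := Int.even_mul_succ_self c
  obtain ⟨kd, hkd⟩ := Int.even_mul_succ_self d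
  rw [mul_add, mul_one] at hka hkb hkc hkd
  obtain ⟨k, hk⟩ : ∃ k : ℤ, a + b + c + d = 2 * k := ⟨(a + b + c + d) / 2, by omega⟩
  refine ⟨⟨k, k - a - c⟩, ?_⟩
  ext
  · simp only [Zsqrtd.re_add, Zsqrtd.re_mul]; omega
  · simp only [Zsqrtd.im_add, Zsqrtd.im_mul]; omega

/-- The non-chain balanced null direction `(5,4,3)`: `p = 2 − i`, `q = 1 − 2i`, `N(p) = N(q) = 5`, `p q̄ = 4 + 3i`, and `(1+i) ∣ p + q = 3 − 3i`. -/
example : (⟨2, -1⟩ : GaussianInt).norm = (⟨1, -2⟩ : GaussianInt).norm ∧ (⟨2, -1⟩ : GaussianInt) * star (⟨1, -2⟩ : GaussianInt) = ⟨4, 3⟩ ∧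
    (⟨1, 1⟩ : GaussianInt) * ⟨0, -3⟩ = ⟨2, -1⟩ + ⟨1, -2⟩ := by decide

/-! ### Lift-invariance of the class rows and of the slope data -/

/-- The class screen (A1) is invariant under any coefficient map fixing `0` … -/
theorem classScreen_comp {R S : Type*} [Zero R] [Zero S] {T : CWord → R} (g : R → S) (hg : g 0 = 0) (h : ClassScreen T) :
    ClassScreen (g ∘ T) :=
  ⟨fun w h₁ h₂ h₃ ↦ by rw [Function.comp_apply, h.1 w h₁ h₂ h₃, hg],
    fun w w' hw hw' hd ↦ by rw [Function.comp_apply, Function.comp_apply, h.2 w w' hw hw' hd]⟩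

/-- … in particular under `T ↦ n • T`: the weighted class tensor of a lift is `wch(D♯_F) = 2^{|F|} • wch(D)` in total and
`|G_Γ| • wch(Γ)` per lifted block, so `Clean`, the per-block screen (ROW CA1) and `μ ≠ 0` (`μ♯ = 2^{|F|} μ`) — i.e. the tree's
`ClassDataRankFree D := D.Clean ∧ D.mu ≠ 0` (SeedChecker) — are LIFT-INVARIANT, while `ClassData` ∕ `ClassDataR 4` pin the presented
rank and see `rank♯ = 2^{|F|} · rank` (director R19.341's reading: CONFIRMED). -/
theorem classScreen_nsmul {R : Type*} [AddMonoid R] {T : CWord → R} (n : ℕ) (h : ClassScreen T) : ClassScreen (n • T) :=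
  ⟨fun w h₁ h₂ h₃ ↦ by rw [Pi.smul_apply, h.1 w h₁ h₂ h₃, smul_zero],
    fun w w' hw hw' hd ↦ by rw [Pi.smul_apply, Pi.smul_apply, h.2 w w' hw hw' hd]⟩

/-- Bogomolov number of a lifted block: `B(n r, n q₁, n q₂) = n² B(r, q₁, q₂)` — sign and vanishing are lift-invariant. -/
theorem bogomolovNumber_lift (n r q₁ q₂ : ℤ) :
    LetterDesign.bogomolovNumber (n * r) (n * q₁) (n * q₂) = n ^ 2 * LetterDesign.bogomolovNumber r q₁ q₂ := by
  unfold LetterDesign.bogomolovNumber; ring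

/-- The Simpson class is lift-invariant (`n ≠ 0`): `B♯ = n² B = 0`, `μ♯ = n μ ≠ 0`. -/
theorem simpsonClass_lift {n r q₁ q₂ μre μim : ℤ} (hn : n ≠ 0) (h : SimpsonClass r q₁ q₂ μre μim) :
    SimpsonClass (n * r) (n * q₁) (n * q₂) (n * μre) (n * μim) := by
  refine ⟨by rw [bogomolovNumber_lift, h.1, mul_zero], ?_⟩
  rcases h.2 with hre | him
  · exact Or.inl (mul_ne_zero hn hre)
  · exact Or.inr (mul_ne_zero hn him)

/-- `SemistableDead` is lift-invariant (`n ≠ 0`). -/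
theorem semistableDead_lift {n r q₁ q₂ μre μim : ℤ} (hn : n ≠ 0) (h : SemistableDead r q₁ q₂ μre μim) :
    SemistableDead (n * r) (n * q₁) (n * q₂) (n * μre) (n * μim) := by
  rcases h with hneg | hS
  · left; rw [bogomolovNumber_lift]; exact mul_neg_of_pos_of_neg (by positivity) hneg
  · exact Or.inr (simpsonClass_lift hn hS)

namespace BlockDestabDatum

/-- The ROW BD datum of the connected lift `D♯` of a room, `|G| = n`: every count and every degree sum scales by `n`, slopes do not.
(THEOREM BD♯ of the memo §3: `top♯_{p′} = n · top_{p′∕n}` piecewise-linearly, the BD inequalities are linear on each unit interval,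
so `Destabilises` is lift-invariant; below, the lifted data of the live TW-32b addresses are simply re-certified.) -/
def lift (n : ℕ) (B : BlockDestabDatum) : BlockDestabDatum :=
  ⟨n * B.r, n * B.degNum, n * B.nT, n * B.dT, n * B.pT, n * B.p, B.pBlocks.map fun vm ↦ (vm.1, n * vm.2)⟩

/-- TW32b-p8-tau♯_{F}, `|F| = 1` (`|G| = 2`: rank `80`, `80` hub copies, `96` P-copies): the hub image still destabilises. -/
example : (tw32bP8.lift 2).Destabilises := by unfold Destabilises lift tw32bP8 SortedDesc; decide

/-- TW32b-p8-tau♯_{F}, `|F| = 2` (`|G| = 4`, rank `160`). -/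
example : (tw32bP8.lift 4).Destabilises := by unfold Destabilises lift tw32bP8 SortedDesc; decide

/-- TW32b-p32-sharp♯_{F}, `|F| = 1` (`|G| = 2`, rank `128`). -/
example : (tw32bP32.lift 2).Destabilises := by unfold Destabilises lift tw32bP32 SortedDesc; decide

end BlockDestabDatum

/-- The Simpson class of the lifted TW32b-p32-sharp♯_{{0}} (`r = 2·64 = 128`, `q₁ = 2·896`, `q₂ = 2·12544`, `μ′ = 2·(−256 i)`). -/
example : SimpsonClass (2 * 64) (2 * 896) (2 * 12544) (2 * 0) (2 * (-256)) :=
  simpsonClass_lift two_ne_zero ⟨by decide, Or.inr (by decide)⟩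

end LiftLaws

/-!
## v1.7 (g7) — `OrbitStability`: ROW X₇ (orbit-stable components of the live graph)
(memo `C4-X7-ORBIT-STABLE-c4-1-g7.md` §§2–3; engine `code∕x7orbit.py`; law-level corollary of THEOREM CA1 (§ v1.4) and ROW CC (§ v1.6))

HONEST FRAMING (as for the whole file). Nothing below is a theorem about a sheaf or a variety and nothing is a rung toward
`stub_rung_pad4_seedAt` ∕ 18881 ∕ 26512 ∕ №4 ∕ H2 ∕ HC ∕ HC_CM ∕ HC_AV. Kernel-checked: (i) elementary letter combinatorics — the balanced
rotation `(α; x, y) ↦ (α; −y, x)` (the class action of the automorphism `i` of `E_i` on one factor, applied to all four factors at once) and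
the factor permutations preserve the effective order `MCell.le`, hence every live arrow of every design they preserve; the predicate
`OrbitStable` («every cell is live-connected to its translate», i.e. every connected component `Γ` of the live graph satisfies `gΓ = Γ`), its
closure under composition (so the two generators of `S₄` and the rotation suffice for `G = S₄ × C₄`) and its vacuity on forced-connected designs;
(ii) pure algebra over the tree's `AtiyahTraceAlgebra`: two forced blocks whose scalar classes have EQUAL `σ`-data on the degrees of a door
collide (`a₁ = 1`, `a₂ = −1` in `not_isISemiregular_of_scalarCollision`).

LAW X₇ (pen proof memo §3, one paragraph). Let the design `D` be ORBIT-CONSTANT under `G` (masses constant on `G`-orbits; `G` fixes the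
product polarisation `H`) and let `Γ` be a connected component of its live graph with `gΓ ≠ Γ` for some `g ∈ G`. Every realisation splits
`𝓔 ⊇ 𝓔_Γ ⊕ 𝓔_{gΓ}` (g0 THEOREM C: all differentials are block-diagonal along components) with `ch(𝓔_{gΓ}) = g · ch(𝓔_Γ)` (maps do not
enter the class). If `ch(𝓔_Γ)` is not (A1), THEOREM CA1 kills every door. If it is, `ch_{≤3}(𝓔_Γ) = Σ_{q≤3} c_q H^q∕q!` and `g` fixes `H`, so
`𝓔_{gΓ}` has the SAME `(c_0,…,c_3)`: the scalar classes `β·id_Γ`, `β·id_{gΓ}` (`β ∈ H^{0,2} ∖ 0`) have equal `σ`-data on `J = {0,1,2,3}` and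
`x = β·(id_Γ − id_{gΓ}) ∈ ker σ_{≤3} ∖ 0` — ROW CC, in the instance `not_isISemiregular_of_conjugateBlocks` below. Hence at the door of
record every live component is `G`-stable; equivalently every `G`-orbit of cells lies in ONE component. Necessary, maps-free, atom-free
(plain room; twisted rooms need `G`-invariant labels); silent on a `G`-fixed singleton (a lone HUB copy — that is the LONE-SUMMAND RULE's
case). MILP form (lazy, on support indicators): `Σ_{o ∈ B(Γ)} y_o ≥ 1 − Σ_{o ∈ O(Γ)} (1 − y_o)` (memo §3).
-/

section OrbitStability

/-! ### `G = S₄ × C₄` on cells: factor permutations and the simultaneous balanced rotation preserve the effective order -/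

/-- The balanced rotation of one factor point, `(α; x, y) ↦ (α; −y, x)`: the class action of the automorphism `i` of `E_i` in the balanced
frame; it fixes `α` and the norm `x² + y²`, hence effectivity, isotropy, `gcd` and `det` of differences. -/
def rotPt (b : BPoint) : BPoint := (b.1, -b.2.2, b.2.1)

/-- The `C₄` generator of `G`: rotate all four factors at once. -/
def rotCell (Z : MCell) : MCell := fun f ↦ rotPt (Z f)

/-- The `S₄` part of `G`: permute the factors, `(permCell σ Z) f = Z (σ f)`. -/
def permCell (σ : Equiv.Perm (Fin 4)) (Z : MCell) : MCell := fun f ↦ Z (σ f)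

/-- Rotation commutes with differences. -/
theorem bsub_rotPt (z p : BPoint) : bsub (rotPt z) (rotPt p) = rotPt (bsub z p) := by
  obtain ⟨a, b, c⟩ := z
  obtain ⟨d, e, f⟩ := p
  simp only [bsub, rotPt, neg_sub_neg, neg_sub]

/-- Rotation preserves effectivity (`(−y)² + x² = x² + y²`). -/
theorem effective_rotPt_iff (Δ : BPoint) : Effective (rotPt Δ) ↔ Effective Δ := by
  simp only [Effective, rotPt, neg_sq]
  constructor <;> rintro ⟨h₁, h₂⟩ <;> exact ⟨h₁, by linarith⟩

/-- The effective order `P ≤ Z` (= «`Hom(L_P, L_Z) ≠ 0`», the live-arrow test) is invariant under the simultaneous rotation. -/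
theorem le_rotCell_iff (P Z : MCell) : MCell.le (rotCell P) (rotCell Z) ↔ MCell.le P Z := by
  simp only [MCell.le, rotCell, bsub_rotPt, effective_rotPt_iff]

/-- … and under every factor permutation. -/
theorem le_permCell_iff (σ : Equiv.Perm (Fin 4)) (P Z : MCell) :
    MCell.le (permCell σ P) (permCell σ Z) ↔ MCell.le P Z := by
  simp only [MCell.le, permCell]
  exact ⟨fun h f ↦ by simpa using h (σ.symm f), fun h f ↦ h (σ f)⟩

/-- Sanity (the dresser pair of memo §2, orbits P43 → N12 on S′): the matched arrow `p → n` is live (`n − p = (3,3,0)` null on factor 0,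
zero elsewhere), its rotation `rot p → rot n` is live, but `p → rot n` is not (`(3,5,−2)` is not effective) — the 48 matched pairs are 48
components permuted by `G`, none `G`-stable. The definitions compute; this is NOT a rung. -/
example :
    let p : MCell := ![((9 : ℤ), (-5 : ℤ), (0 : ℤ)), (11, 0, 3), (14, 0, 0), (14, 0, 0)]
    let n : MCell := ![((12 : ℤ), (-2 : ℤ), (0 : ℤ)), (11, 0, 3), (14, 0, 0), (14, 0, 0)]
    MCell.le p n ∧ MCell.le (rotCell p) (rotCell n) ∧ ¬ MCell.le p (rotCell n) := by
  decide

namespace SplitDesign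

/-- A SYMMETRY of a split design: a self-map of cells preserving the support, the three multiplicity functions and the effective order.
Intended instances: the elements of `G = S₄ × C₄` — `permCell σ`, `rotCell` and their composites, with `le_iff` = `le_permCell_iff` ∕
`le_rotCell_iff` — acting on an ORBIT-CONSTANT design (masses constant on `G`-orbits, support `G`-closed). A two-term design `[P → N]` (UP)
is the split design with `mA = mP`, `mC = 0`; DOWN: `mA = 0`, `mC = mP`. -/
structure IsSymmetry (S : SplitDesign) (g : MCell → MCell) : Prop where
  mapsTo : ∀ Z ∈ S.cells, g Z ∈ S.cells
  mN_eq : ∀ Z, S.mN (g Z) = S.mN Z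
  mA_eq : ∀ Z, S.mA (g Z) = S.mA Z
  mC_eq : ∀ Z, S.mC (g Z) = S.mC Z
  le_iff : ∀ P Z, MCell.le (g P) (g Z) ↔ MCell.le P Z

/-- Live-connectedness of two cells (same connected component of the live graph, arrows forgotten) — the relation whose universal
closure on `cells` is `LiveConnected` (§ v1.1). -/
def LiveConn (S : SplitDesign) (X Y : MCell) : Prop :=
  Relation.ReflTransGen (fun a b => S.LiveAdj a b ∨ S.LiveAdj b a) X Y

/-- A symmetry maps live arrows to live arrows (it preserves masses and the effective order). -/
theorem IsSymmetry.liveAdj {S : SplitDesign} {g : MCell → MCell} (hg : S.IsSymmetry g) {X Y : MCell} (h : S.LiveAdj X Y) :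
    S.LiveAdj (g X) (g Y) := by
  unfold LiveAdj at h ⊢
  simpa only [hg.mN_eq, hg.mA_eq, hg.mC_eq, hg.le_iff] using h

/-- … hence components to components: `X ~ Y ⟹ gX ~ gY`. -/
theorem IsSymmetry.liveConn {S : SplitDesign} {g : MCell → MCell} (hg : S.IsSymmetry g) {X Y : MCell} (h : S.LiveConn X Y) :
    S.LiveConn (g X) (g Y) := by
  unfold LiveConn at h ⊢
  induction h with
  | refl => exact Relation.ReflTransGen.refl
  | tail _ hbc ih => exact ih.tail (Or.imp hg.liveAdj hg.liveAdj hbc)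

/-- **ROW X₇ (orbit-stable components), letter level.** Every cell of the design is live-connected to its `g`-translate. For a symmetry
`g` permuting the (finite) support this says exactly that every connected component `Γ` of the live graph is `g`-STABLE (`gΓ = Γ`), i.e.
that every `⟨g⟩`-orbit of cells lies in one component. CERTIFICATE (LAW X₇ above, memo §3): an orbit-constant design that is NOT
`OrbitStable g` for some `g ∈ G` is dead at the door of record `I = {1,2,3,4}` for every realisation (CA1 if the offending component's class
is not (A1), CC = `not_isISemiregular_of_conjugateBlocks` if it is). Engine: `code∕x7orbit.py` (generator test + orbit-split test). -/
def OrbitStable (S : SplitDesign) (g : MCell → MCell) : Prop := ∀ X ∈ S.cells, S.LiveConn X (g X)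

/-- Stability under two symmetries gives stability under their composite — so ROW X₇ for `G = S₄ × C₄` is the three checks
`g ∈ {permCell (swap 0 1), permCell (0 1 2 3), rotCell}` (the engine's «generator test»). -/
theorem OrbitStable.comp {S : SplitDesign} {g g' : MCell → MCell} (hg : S.IsSymmetry g) (h : S.OrbitStable g)
    (h' : S.OrbitStable g') : S.OrbitStable (g' ∘ g) :=
  fun X hX ↦ (h X hX).trans (h' (g X) (hg.mapsTo X hX))

/-- A forced-connected design (ONE live component — every design of record: S′ `ac808a66` ∕ `08162ddb`, S131 `bf2edc09`, M `1840bf64`, the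
g0 THEOREM C table) is orbit-stable under every symmetry: ROW X₇ is vacuous there (honest; memo §4 table). It bites on hub-free ∕ low-rank
designs: the dressers `N12^5 ⊕ P43^2`, `N28^5 ⊕ P45^2` (48 matched components), the ten FLOOR-2 count-survivors (isolated orbit N18 ∕ N47,
QUARTERING by the rotation), live-isolated dressings. -/
theorem orbitStable_of_liveConnected {S : SplitDesign} {g : MCell → MCell} (hg : S.IsSymmetry g) (hS : S.LiveConnected) :
    S.OrbitStable g :=
  fun X hX ↦ hS X hX (g X) (hg.mapsTo X hX)

/-- Conversely a translate outside `X`'s component is an X₇ violation: if `X ∈ cells` is live-connected to nothing but itself (an ISOLATED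
cell: no live arrow at `X`) and `g X ≠ X`, the design is not `OrbitStable g` (the sixteen isolated `N18` cells of the FLOOR-2 survivors; the
LONE-SUMMAND RULE's non-hub case). -/
theorem not_orbitStable_of_isolated {S : SplitDesign} {g : MCell → MCell} {X : MCell} (hX : X ∈ S.cells) (hne : g X ≠ X)
    (hiso : ∀ Y, ¬ (S.LiveAdj X Y ∨ S.LiveAdj Y X)) : ¬ S.OrbitStable g := by
  intro h
  have hc := h X hX
  unfold LiveConn at hc
  rcases hc.cases_head with heq | ⟨Y, hXY, _⟩
  · exact hne heq.symm
  · exact hiso Y hXY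

end SplitDesign

/-! ### The sheaf-level schema of LAW X₇, case (A1): conjugate blocks have equal class data on the door and collide (ROW CC instance) -/

namespace DirectSumDatum

universe u v

open Literature.AlgebraicGeometry.HodgeTheory

variable {𝕜 : Type u} [CommRing 𝕜] {A A₁ A₂ : AtiyahTraceAlgebra.{u, v} 𝕜} (D : DirectSumDatum A A₁ A₂)

/-- **LAW X₇, sheaf-level schema (conjugate blocks collide).** In the notation of `not_isISemiregular_of_scalarCollision` (`s_j β = β·id_{𝓔_j}`,
`σ^{𝓔_j}_k(s_j β) = u_j k · w k β` with `u_j k = c_k(𝓔_j)` the `H^k∕k!`-coefficient, `w k β = β ∧ H^k∕k!`): if the two blocks have EQUAL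
coefficients `u₁ k = u₂ k` for every degree `k ∈ I` — the case `𝓔₂ = g^*𝓔₁` for an automorphism `g` of `(X, H)`, since `c_k` is read against
the `g`-invariant `H` — and `β·id_{𝓔₁} ≠ 0` (a live block, characteristic `0`), then `𝓔 = 𝓔₁ ⊕ 𝓔₂` is not `I`-semiregular:
`x = β·id₁ − β·id₂ ∈ ker σ_I ∖ 0`. [cite: BuchweitzFlenner2003, §3, Def. 4.1, Prop. 4.2] -/
theorem not_isISemiregular_of_conjugateBlocks {I : Set ℕ} {V : Type*} [AddCommGroup V] [Module 𝕜 V]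
    (s₁ : V →ₗ[𝕜] A₁.Ext 2 0) (s₂ : V →ₗ[𝕜] A₂.Ext 2 0) (w : (k : ℕ) → (V →ₗ[𝕜] A.Coh (k + 2) k)) (u₁ u₂ : ℕ → 𝕜)
    (hσ₁ : ∀ k β, D.c₁ k (A₁.semiregularityComponent k (s₁ β)) = u₁ k • w k β)
    (hσ₂ : ∀ k β, D.c₂ k (A₂.semiregularityComponent k (s₂ β)) = u₂ k • w k β)
    (hconj : ∀ k ∈ I, u₁ k = u₂ k) (β : V) (hne : s₁ β ≠ 0) : ¬ A.IsISemiregular I :=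
  D.not_isISemiregular_of_scalarCollision s₁ s₂ w u₁ u₂ hσ₁ hσ₂ 1 (-1)
    (fun k hk ↦ by rw [hconj k hk, one_mul, neg_one_mul, add_neg_cancel]) β (Or.inl (by rwa [one_smul]))

end DirectSumDatum

end OrbitStability

/-!
## v1.8 (g8) — `HubLone`: THEOREM Y (non-polarised tautological classes), the HUB-LONE LAW, ROW CAP-0-ALL
(memo `C4-CAP0-ALL-c4-1-g8.md` §§2–4; engine `code∕hublone.py`; builds on THEOREM CA1 ∕ LEMMA C (§ v1.4), ROW CC (§ v1.6), TDT (§ v1.4))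

HONEST FRAMING (as for the whole file). Nothing below is a theorem about a sheaf or a variety and nothing is a rung toward
`stub_rung_pad4_seedAt` ∕ 18881 ∕ 26512 ∕ №4 ∕ H2 ∕ HC ∕ HC_CM ∕ HC_AV. Kernel-checked: integer ∕ rational arithmetic of the THEOREM-LC frame and
two instances of the abstract block schemas over the tree's `AtiyahTraceAlgebra`; the sheaf-level dictionary is in the docstrings.

THEOREM Y (pen, memo §2; exact engine check on 11 designs, memo §5). `X₀ = E_i^8`, `H = Σ_a dz_a dz̄_a`, Weil classes `w ~ dz_{I₊}dz̄_{I₋}`, `w̄`.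
For an (A1) design (`ch(𝓔) = S(H) + μw + μ̄w̄`, `S(H) = Σ_k q_k H^k∕k!`), any `h`, and any ordered pair `(a,b)` of coordinates of OPPOSITE K-type,
the elementary NON-POLARISED direction `ξ_ab = ∂_a ⊗ dz̄_b ∈ H¹(X,T_X)` (`β_ab := ι_{ξ_ab} H = ±dz̄_a dz̄_b ≠ 0`; the symmetrisation
`ξ_ab + ξ_ba` is the Weil tangent `τ_ab ∈ T_W`, for which `β` cancels) gives the tautological class `y_ab := h·β_ab·id_𝓔 − ob_{ξ_ab}(𝓔)` with
`σ_k(y_ab) = (h q_k − q_{k+1}) · β_ab ∪ H^k∕k!` for every `k` — because `σ_k(β·id) = β∧ch_k`, `σ_k(ob_ξ) = ⟨ξ, ch_{k+1}⟩` for EVERY `ξ ∈ H¹(T_X)`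
(BF03 Def. 4.1, Prop. 4.2), `ι_ξ` is a derivation with `ι_ξ H = β`, and `ι_ξ w = ι_ξ w̄ = 0 = β∧w = β∧w̄` for mixed `(a,b)`. In the THEOREM-LC frame of an
(A1)+LINE-`h` design (`q_k = lcCoeff r m₁ h k = r h^k + k m₁ h^{k−1}`) this is `σ(y_ab) = −m₁ · β_ab ∪ e^{hH}` (`hubLone_sigma_coeff`).

HUB-LONE LAW (memo §3). If `𝓔 ≅ 𝒪(hΘ) ⊕ 𝓔′` (one split hub copy; any room, maps, labels) on an (A1)+LINE-`h` design, then for each of the 16 mixed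
pairs the block-diagonal class `z_ab = y_ab + m₁β_ab·e_hub` (`m₁ ≠ 0`; hub block `m₁β_ab ≠ 0`), resp. `(r−1)β·e_hub − β·(id − e_hub)` (`m₁ = 0`,
`β` mixed), lies in `ker σ_k` for EVERY `k`: `𝓔` is `I`-semiregular for no `I` (`dim ker σ ≥ 16`). With the capacity split (α) of record
((r1): `m_ν − cap_ν ≥ 1 ⟹ L_ν^{m_ν − cap_ν}` splits off) and THEOREM CA1 on one split CHARGED copy (every non-hub LINE letter is moved by a
Weil tangent; memo §4 (ii)) this gives ROW CAP-0-ALL: `m_ν ≤ cap_ν` for EVERY `N`-cell, rhs `0` everywhere (was rhs `−1` = X₁ «CAP-1» off the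
self-Ext² orbits (X₁⁺) and off the FLOOR-context hub (X₁⁺⁺)). General (A1) designs: the same construction kills the door `I` iff
`D_k = (q_{k+1} − h q_k)∕h^k` is constant on `I` (`HubLoneDoorDead`); the BAND design M of record fails it already on `{0,1}` (certificate below).
-/

section HubLone

/-! ### The arithmetic heart: THEOREM-LC coefficients and the `σ`-coefficient of the non-polarised tautological class -/

/-- THEOREM-LC numerators: for an (A1)-clean LINE-`h` design of rank `r` and charge imbalance `m₁ = q₁ − r h`,
`ch_k(𝓔) = lcCoeff r m₁ h k · H^k∕k!` with `lcCoeff r m₁ h k = r h^k + k m₁ h^{k−1}` (`= ` the `H^k∕k!`-coefficient of `e^{hH}(r + m₁H)`).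
(MEMO-05 (1.1) ∕ THEOREM LC of the cell; g4 memo §1.) -/
def lcCoeff (r m₁ h : ℤ) (k : ℕ) : ℤ := r * h ^ k + k * m₁ * h ^ (k - 1)

theorem lcCoeff_zero (r m₁ h : ℤ) : lcCoeff r m₁ h 0 = r := by simp [lcCoeff]

theorem lcCoeff_one (r m₁ h : ℤ) : lcCoeff r m₁ h 1 = r * h + m₁ := by simp [lcCoeff]

/-- The LC recursion `q_{k+1} − h q_k = m₁ h^k` (so `D_k := (q_{k+1} − h q_k)∕h^k = m₁` is constant — the HUB-LONE criterion holds at every door). -/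
theorem lcCoeff_succ_sub (r m₁ h : ℤ) (k : ℕ) : lcCoeff r m₁ h (k + 1) - h * lcCoeff r m₁ h k = m₁ * h ^ k := by
  cases k with
  | zero => simp [lcCoeff]; ring
  | succ k =>
    simp only [lcCoeff, Nat.add_sub_cancel, pow_succ]
    push_cast
    ring

/-- **THEOREM Y, LC form, in coefficients.** The `β_ab ∪ H^k∕k!`-coefficient of `σ_k(h·β_ab·id_𝓔 − ob_{ξ_ab}(𝓔))` is `h q_k − q_{k+1}`
(`σ_k(β·id) = β ∧ ch_k` contributes `h q_k`; `σ_k(ob_ξ) = ⟨ξ, ch_{k+1}⟩ = q_{k+1}·ι_ξ(H^{k+1})∕(k+1)! = q_{k+1} β∧H^k∕k!` contributes `−q_{k+1}`;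
the Weil part drops out for mixed `(a,b)`), and in the LC frame it equals `−m₁ h^k` = `−m₁ ×` the coefficient of `σ_k(β·e_hub) = β ∧ ch_k(𝒪(hΘ))`.
[cite: BuchweitzFlenner2003, Def. 4.1, Prop. 4.2] -/
theorem hubLone_sigma_coeff (r m₁ h : ℤ) (k : ℕ) : h * lcCoeff r m₁ h k - lcCoeff r m₁ h (k + 1) = -(m₁ * h ^ k) := by
  rw [← lcCoeff_succ_sub]; ring

/-- HUB-LONE cancellation in coefficients: `σ_k(y_ab) + m₁ · σ_k(β_ab·e_hub) = 0` for every `k` (both read against `β_ab ∧ H^k∕k!`). -/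
theorem hubLone_cancel (r m₁ h : ℤ) (k : ℕ) : (h * lcCoeff r m₁ h k - lcCoeff r m₁ h (k + 1)) + m₁ * h ^ k = 0 := by
  rw [hubLone_sigma_coeff]; ring

/-- Numeric certificates against the cell's tables (g3 §5 ∕ g4 §1 `q_k`): TW-32b (`r = 32`, `m₁ = 0`, `h = 14`): `q₃ = 87808`;
RB16 (`r = 16`, `m₁ = 4`, `h = 14`): `q₁, q₂, q₃ = 228, 3248, 46256`; S′ monad ac808a66 (`r = 4`, `m₁ = −1704`): `q₁ = 56 − 1704 = −1648 = s(𝓔)`. -/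
example : lcCoeff 32 0 14 3 = 87808 := by decide
example : lcCoeff 16 4 14 1 = 228 ∧ lcCoeff 16 4 14 2 = 3248 ∧ lcCoeff 16 4 14 3 = 46256 := by decide
example : lcCoeff 4 (-1704) 14 1 = -1648 := by decide

/-! ### The general (A1) criterion and its certificates -/

/-- **HUB-LONE door criterion for a general (A1) design** (memo §3.1): with scalar class `Σ_k q k · H^k∕k!` and a hub of height `hgt`, a split copy
of `𝒪(hgt·Θ)` kills the door `I` as soon as `D_k := (q (k+1) − hgt·q k)∕hgt^k` takes ONE value `c` on all `k ∈ I` (then `y_ab + c·β_ab·e_hub ∈ ker σ_I ∖ 0`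
for `c ≠ 0`, and the scalar collision does it for `c = 0`). Stated multiplicatively (no division). -/
def HubLoneDoorDead (hgt : ℤ) (q : ℕ → ℤ) (I : Set ℕ) : Prop :=
  ∃ c : ℚ, ∀ k ∈ I, ((q (k + 1) - hgt * q k : ℤ) : ℚ) = c * (hgt : ℚ) ^ k

/-- In the THEOREM-LC frame the criterion holds at EVERY door, with `c = m₁`. -/
theorem hubLoneDoorDead_of_lcFrame (r m₁ h : ℤ) (I : Set ℕ) : HubLoneDoorDead h (lcCoeff r m₁ h) I :=
  ⟨m₁, fun k _ ↦ by rw [lcCoeff_succ_sub]; push_cast; ring⟩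

/-- The scalar class of M BAND-4@12 (1840bf64; `c4class` ∕ `tautfloor` table): `q₀, q₁, q₂ = 4, 327480, 10925136` (higher `q_k` irrelevant here). -/
def qBand4At12 : ℕ → ℤ := fun k ↦ if k = 0 then 4 else if k = 1 then 327480 else if k = 2 then 10925136 else 0

/-- COUNTER-CERTIFICATE (memo §3.1 ∕ §5): on M BAND-4@12 the criterion fails already on `{0,1}` for the hub height `12`
(`D₀ = 327432 ≠ D₁ = 582948`): THEOREM Y gives no hub-lone kill there (and none is claimed). -/
example : ¬ HubLoneDoorDead 12 qBand4At12 {k | k ≤ 1} := by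
  rintro ⟨c, hc⟩
  have h0 := hc 0 (by simp)
  have h1 := hc 1 (by simp)
  simp [qBand4At12] at h0 h1
  linarith

/-- … while any LC-frame design passes at the same door (here TW-32b's `(r, m₁, h) = (32, 0, 14)` and RB16's `(16, 4, 14)`). -/
example : HubLoneDoorDead 14 (lcCoeff 32 0 14) {k | k ≤ 3} ∧ HubLoneDoorDead 14 (lcCoeff 16 4 14) Set.univ :=
  ⟨hubLoneDoorDead_of_lcFrame 32 0 14 _, hubLoneDoorDead_of_lcFrame 16 4 14 _⟩

/-! ### The rows: hub capacity and CAP-0-ALL (canonical-lift `homDim`) -/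

namespace LetterDesign

/-- The hub letter of height `h`: `(h; 0, 0)` on every factor, `L = 𝒪(hΘ)` (the only LINE-`h` letter with (A1) class `e^{hH}`). -/
def hubOf (h : ℤ) : MCell := fun _ ↦ (h, 0, 0)

/-- Canonical-lift capacity of an `N`-cell `ν`: `cap_ν = Σ_{π} dim Hom(L_π, L_ν) · m_P(π)` — an UPPER bound of the true capacity under any Pic⁰
labelling of `P` (`homDim` is the canonical-lift value, true values are `≤`). -/
def cap (D : LetterDesign) (ν : MCell) : ℤ := ∑ π ∈ D.cells, homDim π ν * D.mP π

/-- `cap` of the hub of height `h`. -/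
def hubCap (D : LetterDesign) (h : ℤ) : ℤ := D.cap (hubOf h)

/-- **ROW CAP-0 at one cell** `m_N(ν) ≤ cap_ν`. CERTIFIES (memo §4): in a plain (cell-constant) UP room `0 → P → N → 𝓔 → 0` on an (A1) design, a
violation forces `𝓔 ≅ L_ν^{d} ⊕ 𝓔″`, `d ≥ 1` ((α), (r1) of record; rooms with copy-dependent Pic⁰ labels are NOT covered — the count is then per label
class), and then no door: for CHARGED `ν` by THEOREM CA1 on the split copy
(`ob_τ(𝓔) ∈ ker σ ∖ 0` for a Weil tangent `τ` moving `[Z_ν]` — every non-hub LINE letter is moved), for the HUB by the HUB-LONE LAW. -/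
def CapZeroRow (D : LetterDesign) (ν : MCell) : Prop := (D.mN ν : ℤ) ≤ D.cap ν

/-- **ROW HUB-CAP-0** = `CapZeroRow` at the hub of height `h` (was X₁⁺⁺, «LAW inside the FLOOR model» only; now unconditional on LINE-`h` supports). -/
def HubCapZeroRow (D : LetterDesign) (h : ℤ) : Prop := (D.mN (hubOf h) : ℤ) ≤ D.hubCap h

/-- **ROW CAP-0-ALL**: `CapZeroRow` at every design cell (rhs `0` everywhere; was X₁ «CAP-1» = `m_N ν ≤ cap_ν + 1` off the self-Ext² orbits). -/
def CapZeroAll (D : LetterDesign) : Prop := ∀ ν ∈ D.cells, D.CapZeroRow ν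

theorem hubCapZeroRow_of_capZeroAll {D : LetterDesign} {h : ℤ} (hD : D.CapZeroAll) (hmem : hubOf h ∈ D.cells) :
    D.HubCapZeroRow h := hD _ hmem

/-- CAP-0-ALL implies the CAP-1 rows of record (X₁). -/
theorem capOne_of_capZeroAll {D : LetterDesign} (hD : D.CapZeroAll) : ∀ ν ∈ D.cells, (D.mN ν : ℤ) ≤ D.cap ν + 1 :=
  fun ν hν ↦ (hD ν hν).trans (by omega)

end LetterDesign

/-! ### The capacity premise (α) in the other rooms (memo §4.5): DOWN rooms and three-term monads

(α-DOWN) `0 → 𝓔 → N →ψ C → 0`: the `m_ν` copies of `L_ν` map to `C` by columns in `⊕_γ Hom(L_ν, L_γ)^{m_γ}`, of dimension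
`ccap_ν = Σ_γ homDim(ν, γ)·m_C(γ)`; `m_ν > ccap_ν` ⟹ `GL(m_ν)` column operations make `d ≥ 1` copies map to zero ⟹ `𝓔 = ker ψ ≅ L_ν^{d} ⊕ ker(ψ|N″)`.
(α-MONAD) `0 → A →φ N →ψ C → 0`, `𝓔 = ker ψ ∕ im φ`: a basis change `g ∈ GL(m_ν)` produces a copy with zero ROW (`(gφ)_i = 0`) and zero COLUMN
(`(ψg⁻¹)^{(i)} = 0`) iff some `λ` in the row left-kernel `K₁ ≤ (k^{m_ν})^∨` and some `w` in the column kernel `K₂ ≤ k^{m_ν}` pair to `λ(w) ≠ 0`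
(then `g⁻¹ = [w | basis of ker λ]`); since `dim K₁ ≥ m_ν − cap_ν` and `dim K₂ ≥ m_ν − ccap_ν`, the pairing lemma below forces this as soon as
`m_ν > cap_ν + ccap_ν`, and such a copy is a direct summand of `𝓔` (`ker ψ = L_ν ⊕ ker(ψ|N″) ⊇ im φ ⊂ N″`). The kills (CA1 ∕ HUB-LONE) are room-free,
so ROW CAP-0-ALL reads `m_ν ≤ cap_ν + ccap_ν` in every plain (cell-constant) room; UP: `ccap = 0`, DOWN: `cap = 0`.
-/

/-- **Pairing lemma behind (α-MONAD)** (kernel-checked linear algebra): subspaces `K₁` of the dual and `K₂` of `V` with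
`dim K₁ + dim K₂ > dim V` contain a pair `φ ∈ K₁`, `w ∈ K₂` with `φ w ≠ 0` (else `K₂ ≤ K₁.dualCoannihilator`, whose dimension is `dim V − dim K₁`). -/
theorem exists_dual_pairing_ne_zero {K V : Type*} [Field K] [AddCommGroup V] [Module K V] [FiniteDimensional K V]
    (K₁ : Subspace K (Module.Dual K V)) (K₂ : Subspace K V)
    (h : Module.finrank K V < Module.finrank K K₁ + Module.finrank K K₂) :
    ∃ φ ∈ K₁, ∃ w ∈ K₂, φ w ≠ 0 := by
  by_contra hcon
  push Not at hcon
  have hle : K₂ ≤ K₁.dualCoannihilator := fun w hw ↦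
    (Submodule.mem_dualCoannihilator _).2 fun φ hφ ↦ hcon φ hφ w hw
  have h1 := Submodule.finrank_mono hle
  have h2 := Subspace.finrank_add_finrank_dualCoannihilator_eq K₁
  omega

/-- The forcing count of (α-MONAD): with `m` copies, row rank `≤ cap` and column rank `≤ ccap`, `m > cap + ccap` gives
`m < (m − cap) + (m − ccap) ≤ dim K₁ + dim K₂` — the hypothesis of `exists_dual_pairing_ne_zero`. -/
theorem monadCapacity_count {m cap ccap k₁ k₂ : ℕ} (hk₁ : m ≤ k₁ + cap) (hk₂ : m ≤ k₂ + ccap) (hviol : cap + ccap < m) :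
    m < k₁ + k₂ := by omega

namespace SplitDesign

/-- Row capacity of an `N`-cell from the SUB term `A` (rows of `φ : A → N` landing in `L_ν^{m_ν}`), canonical lift. -/
def capA (S : SplitDesign) (ν : MCell) : ℤ := ∑ π ∈ S.cells, homDim π ν * S.mA π

/-- Column capacity of an `N`-cell into the QUOTIENT term `C` (columns of `ψ : N → C` out of `L_ν^{m_ν}`), canonical lift. -/
def ccap (S : SplitDesign) (ν : MCell) : ℤ := ∑ γ ∈ S.cells, homDim ν γ * S.mC γ

/-- **ROW CAP-0 (three-term ∕ any room)** `m_N(ν) ≤ cap^A_ν + ccap_ν`: violated ⟹ a split copy `L_ν ⊂⊕ 𝓔` in every plain (cell-constant)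
realisation ((α-MONAD), pairing lemma `exists_dual_pairing_ne_zero`) ⟹ no door (THEOREM CA1 for charged `ν`, HUB-LONE LAW for the hub, on LINE supports).
UP rooms (`mC = 0`): `CapZeroRow` of the underlying `LetterDesign` with `mP = mA`; DOWN rooms (`mA = 0`): `m_N(ν) ≤ ccap_ν`. -/
def CapZeroRowMonad (S : SplitDesign) (ν : MCell) : Prop := (S.mN ν : ℤ) ≤ S.capA ν + S.ccap ν

/-- **ROW CAP-0-ALL (three-term ∕ any room)**: `CapZeroRowMonad` at every design cell. -/
def CapZeroAllMonad (S : SplitDesign) : Prop := ∀ ν ∈ S.cells, S.CapZeroRowMonad ν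

end SplitDesign

/-! ### Sheaf-level schemas of the HUB-LONE LAW over the tree's `AtiyahTraceAlgebra` -/

namespace DirectSumDatum

universe u v

open Literature.AlgebraicGeometry.HodgeTheory

variable {𝕜 : Type u} [CommRing 𝕜] {A A₁ A₂ : AtiyahTraceAlgebra.{u, v} 𝕜} (D : DirectSumDatum A A₁ A₂)

/-- **HUB-LONE, case `m₁ ≠ 0` (block cancellation).** Blocks `𝓔₁ = 𝒪(hΘ)` (one split hub copy), `𝓔₂ = ` the rest. `s₁ β = β·id_{𝒪(hΘ)}` with
`σ^{𝓔₁}_k(s₁ β) = u k · w k β` (`u k = h^k`, `w k β = β ∧ H^k∕k!`: `ch(𝒪(hΘ)) = e^{hH}`); `t₂ β = h·β·id_{𝓔₂} − ob_{ξ(β)}(𝓔₂)`, the NON-POLARISED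
tautological class of the complement for the elementary mixed direction with `ι_ξ H = β` (defined on the 16-dimensional mixed part `V` of `H^{0,2}`),
with `σ^{𝓔₂}_k(t₂ β) = −(m₁ · u k) · w k β` — THEOREM Y in the LC frame applied to `𝓔₂` (`ch(𝓔₂) = ch(𝓔) − e^{hH}` has the same `h S − S′ = −m₁e^{hH}`;
coefficient identity `hubLone_sigma_coeff`). Then for `β` with `s₁(m₁ • β) ≠ 0` (any `β ≠ 0` when `m₁ ≠ 0`, characteristic `0`) the block-diagonal class
`x = ι₁ s₁(m₁β) + ι₂ t₂ β` (= `y_ab + m₁β_ab·e_hub` of the memo) is a non-zero element of `ker σ_k` for every `k`: no door `I`.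
[cite: BuchweitzFlenner2003, §3, Def. 4.1, Prop. 4.2] -/
theorem not_isISemiregular_of_hubLone {V : Type*} [AddCommGroup V] [Module 𝕜 V]
    (s₁ : V →ₗ[𝕜] A₁.Ext 2 0) (t₂ : V →ₗ[𝕜] A₂.Ext 2 0) (w : (k : ℕ) → (V →ₗ[𝕜] A.Coh (k + 2) k)) (u : ℕ → 𝕜) (m₁ : 𝕜)
    (hσ₁ : ∀ k β, D.c₁ k (A₁.semiregularityComponent k (s₁ β)) = u k • w k β)
    (hσ₂ : ∀ k β, D.c₂ k (A₂.semiregularityComponent k (t₂ β)) = -(m₁ * u k) • w k β)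
    (β : V) (hne : s₁ (m₁ • β) ≠ 0) (I : Set ℕ) : ¬ A.IsISemiregular I := by
  refine D.not_isISemiregular_of_blockCancellationOn (s₁ (m₁ • β)) (t₂ β) (fun k _ ↦ ?_) (Or.inl hne)
  have h₁ : D.c₁ k (A₁.semiregularityComponent k (s₁ (m₁ • β))) = (m₁ * u k) • w k β := by
    rw [map_smul, map_smul, map_smul, hσ₁, smul_smul]
  rw [h₁, hσ₂, ← add_smul, add_neg_cancel, zero_smul]

/-- **HUB-LONE, case `m₁ = 0` (scalar collision, Simpson class).** `ch(𝓔₂) = (r−1)e^{hH} + W` and the Weil part is invisible to mixed `β`, so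
`σ^{𝓔₂}_k(β·id_{𝓔₂}) = ((r−1) · u k) · w k β` while `σ^{𝓔₁}_k(β·id_{𝒪(hΘ)}) = u k · w k β`: the collision `a₁ = r−1`, `a₂ = −1` of ROW CC kills every
door as soon as `β·id_{𝓔₂} ≠ 0` (trace `(r−1)β ≠ 0`, `r ≥ 2`, characteristic `0`). [cite: BuchweitzFlenner2003, §3, Def. 4.1] -/
theorem not_isISemiregular_of_hubLone_zero {I : Set ℕ} {V : Type*} [AddCommGroup V] [Module 𝕜 V]
    (s₁ : V →ₗ[𝕜] A₁.Ext 2 0) (s₂ : V →ₗ[𝕜] A₂.Ext 2 0) (w : (k : ℕ) → (V →ₗ[𝕜] A.Coh (k + 2) k)) (u : ℕ → 𝕜) (r' : 𝕜)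
    (hσ₁ : ∀ k β, D.c₁ k (A₁.semiregularityComponent k (s₁ β)) = u k • w k β)
    (hσ₂ : ∀ k β, D.c₂ k (A₂.semiregularityComponent k (s₂ β)) = (r' * u k) • w k β)
    (β : V) (hne : s₂ β ≠ 0) : ¬ A.IsISemiregular I :=
  D.not_isISemiregular_of_scalarCollision s₁ s₂ w u (fun k ↦ r' * u k) hσ₁ hσ₂ r' (-1)
    (fun k _ ↦ by ring) β (Or.inr (by rwa [neg_one_smul, neg_ne_zero]))

end DirectSumDatum

end HubLone

/-!
## v1.9 (g9) — § `CapForest`: ROW CAP-FOREST = NESTED CAPACITY (memo `C4-CAP-FOREST-c4-1-g9.md`)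

HONEST FRAMING. A design-level ∕ class-level LINEAR ROW FAMILY refining ROW CAP-0-ALL (§ `HubLone`) ∕ (r1) CAPACITY, with its kernel-checked
linear-algebra core. Nothing in this section is a theorem about sheaves on `E_i^8`; the sheaf-side steps («a functional on `N` with non-zero constant
part on a copy of `L_c` killing `φ` splits that copy off `𝓔 = coker φ`»; «a split copy kills every door»: THEOREM CA1 for charged `c`, the HUB-LONE LAW
for the hub, X₁⁺ for self-Ext² orbits, THEOREM Y for the neutral reading) are the pen statements of record cited below. Nothing toward
`stmt-18881` ∕ H2 ∕ HC. CANONICAL Pic⁰ LIFT throughout (RULE A): `homDim` is the canonical-lift value and the forest EDGES need it (a non-aligned lift can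
kill an edge `Hom(L_n, L_ν)`; the empty-forest row CAP-0 is lift-robust, the forest rows are canonical-lift ∕ plain-room statements).

THEOREM CAP-FOREST (pen; memo §2). Plain UP room `0 → P →φ N → 𝓔 → 0` on a letter design (cell-constant labels, canonical lift), ANY `φ`,
`𝓔 := coker φ`, `X` integral. Fix an `N`-cell `ν`; `cap_ν = Σ_π homDim(π, ν) · m_P(π)` (`LetterDesign.cap`). A `ν`-FOREST is a finite set `F` of
`N`-cells with a parent map `F → {ν} ∪ F`, every node LIVE-BELOW its parent (`homDim(n, parent n) ≠ 0`, `n ≠ parent n`), chains ending at `ν`, and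
SIBLINGS `P`-DISJOINT: no `P`-cell of the design is live-below two distinct children of one parent (`LetterDesign.CapForest`). THEN
`m_N(ν) + Σ_{n ∈ F} m_N(n) > cap_ν ⟹ 𝓔 ≅ L_c ⊕ 𝓔′` for some `c ∈ {ν} ∪ F`.
PROOF. `C(ν) := ⊕_π Hom(P_π, L_ν)`, `dim C(ν) = cap_ν`; `R_ν :=` the `ℂ`-span of the `m_ν` rows `φ_{ν,i} ∈ C(ν)` — if `dim R_ν < m_ν` a constant
left-kernel vector `λ ∈ ℂ^{m_ν} ∖ 0` gives the functional `(λ, 0) : N → L_ν` killing `φ`, which descends to `𝓔 → L_ν` and is split by the copy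
`L_ν ↪ N → 𝓔` on which `λ ≠ 0`: `𝓔 ≅ L_ν ⊕ 𝓔′`. For a child `n` of `c` and `0 ≠ t ∈ Hom(L_n, L_c)`, multiplication by `t` is INJECTIVE
`Hom(P_π, L_n) → Hom(P_π, L_c)` (`X` integral), so `t · R̂_n ≤ C(c)` has `dim = dim R̂_n`, where recursively `R̂_n := R_n + Σ_{children n′ of n} t_{n′} R̂_{n′}`
(`kernel: capChain_finrank_map_eq`); P-DISJOINT siblings land in DISJOINT coordinate blocks of `C(c)`, so their images are independent and dimensions ADD
(`finrank_sup_eq_add_of_disjoint`, `finrank_biSup_eq_sum_of_iSupIndep`); a collision `R_n ∩ Σ t_{n′} R̂_{n′} ≠ 0` at any node is a functional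
`(λ_n, −μ) : N → L_n` killing `φ` with CONSTANT non-zero part `λ_n` on the copies of `L_n` — a split copy of `L_n` (same splitting as above). If no node
splits, `dim R̂_ν ≥ m_N(ν) + Σ_F m_N(n) > cap_ν = dim C(ν)` — impossible (`exists_ne_zero_mem_inf_of_finrank_lt` is the collision form used at each node). ∎
SHARPENING CAP-FOREST♯ (pen; memo §2.3): by Hopf's theorem on nonsingular bilinear maps over `ℂ` (`dim span(T · R) ≥ dim T + dim R − 1` for the
multiplication `H⁰(L_c L_n⁻¹) ⊗ R̂_n → C(c)`, injective in each variable; [Shapiro, *Compositions of quadratic forms*, Ch. 14; Hopf 1940∕41]) every forest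
node with `R̂_n ≠ 0` contributes `h⁰(n, parent n) − 1` more: `m_N(ν) + Σ_F (m_N(n) + homDim(n, parent n) − 1) > cap_ν ⟹` split (`CapForestSharpRow`;
used design-level only; the class-level rows of record stay Hopf-free).
DOWN ROOM `0 → 𝓔 → N →ψ P → 0` (transpose; memo §2.5): `dcap_ν = Σ_γ homDim(ν, γ) · m_P(γ)`, forests of `N`-cells ABOVE `ν`, each node above its
parent, siblings `P`-disjoint from above (`CapForestDown`, `CapForestDownRow`).
DOOR READING ∕ THE ROW (memo §3): a split copy `L_c` kills every door when `status(c) = KILL` (charged: CA1; hub: HUB-LONE; X₁⁺ self-Ext² orbit: CAP-0 of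
record); otherwise (`CAP1`) one lone copy is door-neutral (THEOREM Y) and each extraction lowers the left side by exactly one, so the LAW-LEVEL ROW is
`m_N(ν) + Σ_F m_N(n) ≤ cap_ν + t`, `t := #{c ∈ {ν} ∪ F : status(c) = CAP1}` (`CapForestRow … t`). On the 22 ALIVE keys of record every `N`-orbit has
status KILL, so `t = 0` there (`CapForestAll`); CAP-0-ALL is the empty-forest case (`capForestRow_empty_iff`, `capZeroAll_of_capForestAll`).
DATA (memo §4; engines `code∕capforest.py`, `cfroot.py`, `cfdesign.py`, `certcheck.py`). ROOT SWEEP in the PREREG «RB-MILP-FLOOR-ALIVE22» frame (orbit-constant two-term UP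
designs, `(H1)` + `σ·μ′ ≥ g` + the capacity statics of record + `rank ≥ 8`, exact ℚ LP with CAP-FOREST separation): **9 of the 22 ALIVE keys go ROOT-EMPTY**
(sup-045∕047∕049∕052∕054∕056, sup-391∕393∕395), each with a 4-row exact Farkas certificate = one `(H1)` class row + the sign row + ONE X₁⁺ CAP-0 row of
record + ONE CAP-FOREST pair row `ν ⊃ {n}` (both cells charged, `t = 0` by CA1), independently re-verified at cell level; the certificates do not use
the rank row (the kill is rank-free), and the CONTROL with CAP-0-ALL at every orbit but no forest row stays feasible (the pair row is essential).
13 keys stay ROOT-ALIVE (sup-033…044: two pair rows cut the vertex, the LP re-optimises; sup-213…224 and d16sup-009: no violated forest row at the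
vertex). Design level: every integer design of record is already CAP-0-dead; forest rows add CAP-0-independent kills (S131 j335419: hub forest
`17 + 16 > 32` on plain-K1, `19 + 48 > 48` on pp0-K3). A pen theorem awaiting its ×2 critic; evidence, not a rung.
-/

section CapForest

/-! ### Kernel-checked linear algebra: collision, injective transport, additivity over disjoint blocks -/

/-- **Collision.** Two subspaces whose dimensions add up to more than the ambient dimension share a non-zero vector
(the form in which every node of the forest argument produces its splitting functional). -/
theorem exists_ne_zero_mem_inf_of_finrank_lt {K V : Type*} [DivisionRing K] [AddCommGroup V] [Module K V] [FiniteDimensional K V]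
    (U W : Submodule K V) (h : Module.finrank K V < Module.finrank K U + Module.finrank K W) :
    ∃ v ∈ U ⊓ W, v ≠ 0 := by
  have hsup := Submodule.finrank_sup_add_finrank_inf_eq U W
  have hle : Module.finrank K ↥(U ⊔ W) ≤ Module.finrank K V := Submodule.finrank_le _
  have hne : U ⊓ W ≠ ⊥ := by
    intro hbot
    rw [hbot, finrank_bot] at hsup
    omega
  exact Submodule.exists_mem_ne_zero_of_ne_bot hne

/-- **Injective transport** (`t · R̂_n ≅ R̂_n`): an injective linear map (multiplication by `0 ≠ t ∈ H⁰(L_c L_n⁻¹)`, `X` integral) preserves the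
dimension of every subspace. -/
theorem capChain_finrank_map_eq {K C C' : Type*} [DivisionRing K] [AddCommGroup C] [Module K C] [AddCommGroup C'] [Module K C']
    (t : C' →ₗ[K] C) (ht : Function.Injective t) (R : Submodule K C') :
    Module.finrank K ↥(R.map t) = Module.finrank K R :=
  (LinearEquiv.finrank_eq (Submodule.equivMapOfInjective t ht R)).symm

/-- **CAP-CHAIN step** (one child): `R_ν ≤ C` with `dim R_ν ≥ m_ν` (else `ν` itself splits), a child space `R̂_n ≤ C'` with `dim ≥ β`, transported
injectively into `C`, and `dim C ≤ cap < m_ν + β` ⟹ `R_ν ∩ t·R̂_n ≠ 0` (the splitting functional `(λ_ν, −μ)`). -/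
theorem capChain_collision {K C C' : Type*} [DivisionRing K] [AddCommGroup C] [Module K C] [FiniteDimensional K C]
    [AddCommGroup C'] [Module K C'] (Rν : Submodule K C) (Rn : Submodule K C') (t : C' →ₗ[K] C) (ht : Function.Injective t)
    {mν β cap : ℕ} (hν : mν ≤ Module.finrank K Rν) (hn : β ≤ Module.finrank K Rn) (hcap : Module.finrank K C ≤ cap)
    (hviol : cap < mν + β) : ∃ v ∈ Rν ⊓ Rn.map t, v ≠ 0 := by
  have hmap := capChain_finrank_map_eq t ht Rn
  exact exists_ne_zero_mem_inf_of_finrank_lt _ _ (by omega)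

/-- **Additivity over disjoint blocks** (two P-disjoint siblings): disjoint subspaces add their dimensions. -/
theorem finrank_sup_eq_add_of_disjoint {K V : Type*} [DivisionRing K] [AddCommGroup V] [Module K V] [FiniteDimensional K V]
    (U W : Submodule K V) (h : Disjoint U W) :
    Module.finrank K ↥(U ⊔ W) = Module.finrank K U + Module.finrank K W := by
  have hsup := Submodule.finrank_sup_add_finrank_inf_eq U W
  rw [h.eq_bot, finrank_bot] at hsup
  omega

/-- **Additivity over an independent family** (any number of P-disjoint siblings: their images in the distinct coordinate blocks of `C(c)` form an
independent family). -/
theorem finrank_biSup_eq_sum_of_iSupIndep {K V ι : Type*} [DivisionRing K] [AddCommGroup V] [Module K V] [FiniteDimensional K V]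
    {W : ι → Submodule K V} (hW : iSupIndep W) (s : Finset ι) :
    Module.finrank K ↥(⨆ i ∈ s, W i) = ∑ i ∈ s, Module.finrank K (W i) := by
  classical
  induction s using Finset.induction_on with
  | empty => simp
  | insert a s ha ih =>
    rw [Finset.iSup_insert, Finset.sum_insert ha, finrank_sup_eq_add_of_disjoint, ih]
    exact hW.disjoint_biSup (y := (↑s : Set ι)) (by simpa using ha)

/-- **CAP-FOREST step with two P-disjoint children** (the shape of every node of the recursion): root rows `R_ν` (`dim ≥ m_ν`), children images
`W₁`, `W₂` DISJOINT with `dim W_i ≥ β_i`, all inside `C` with `dim C ≤ cap`; `cap < m_ν + β₁ + β₂` ⟹ `R_ν` meets `W₁ ⊔ W₂` non-trivially. -/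
theorem capForest_collision₂ {K C : Type*} [DivisionRing K] [AddCommGroup C] [Module K C] [FiniteDimensional K C]
    (Rν W₁ W₂ : Submodule K C) (hdis : Disjoint W₁ W₂) {mν β₁ β₂ cap : ℕ}
    (hν : mν ≤ Module.finrank K Rν) (h₁ : β₁ ≤ Module.finrank K W₁) (h₂ : β₂ ≤ Module.finrank K W₂)
    (hcap : Module.finrank K C ≤ cap) (hviol : cap < mν + β₁ + β₂) : ∃ v ∈ Rν ⊓ (W₁ ⊔ W₂), v ≠ 0 := by
  have hadd := finrank_sup_eq_add_of_disjoint W₁ W₂ hdis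
  exact exists_ne_zero_mem_inf_of_finrank_lt _ _ (by omega)

/-- **CAP-FOREST step with an independent family of children.** -/
theorem capForest_collision {K C ι : Type*} [DivisionRing K] [AddCommGroup C] [Module K C] [FiniteDimensional K C]
    (Rν : Submodule K C) {W : ι → Submodule K C} (hW : iSupIndep W) (s : Finset ι) (β : ι → ℕ) {mν cap : ℕ}
    (hν : mν ≤ Module.finrank K Rν) (hβ : ∀ i ∈ s, β i ≤ Module.finrank K (W i))
    (hcap : Module.finrank K C ≤ cap) (hviol : cap < mν + ∑ i ∈ s, β i) : ∃ v ∈ Rν ⊓ ⨆ i ∈ s, W i, v ≠ 0 := by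
  have hsum := finrank_biSup_eq_sum_of_iSupIndep hW s
  have hle : ∑ i ∈ s, β i ≤ ∑ i ∈ s, Module.finrank K (W i) := Finset.sum_le_sum hβ
  exact exists_ne_zero_mem_inf_of_finrank_lt _ _ (by omega)

/-- If no node splits, the subtree dimension dominates the subtree mass: the root count `dim C(ν) ≥ dim R̂_ν ≥ m_ν + Σ_F m_n` contradicts a violated row
(the numeric skeleton of the induction; `β` = subtree bound of the children). -/
theorem capForest_count {mν βF cap dimC dimR : ℕ} (hR : mν + βF ≤ dimR) (hRC : dimR ≤ dimC) (hC : dimC ≤ cap) (hviol : cap < mν + βF) : False := by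
  omega

/-! ### The rows (canonical lift; `LetterDesign` = UP room `P → N`, or DOWN room `N → P` read transposed) -/

namespace LetterDesign

/-- A `ν`-FOREST of a letter design (UP room): finitely many `N`-cells `nodes`, a parent map into `{ν} ∪ nodes`, every node live-below its parent under
the canonical lift (`homDim n (parent n) ≠ 0`, `n ≠ parent n`) and strictly below the root, and SIBLINGS `P`-DISJOINT: no `P`-cell of the design is
live-below two distinct children of the same parent. (Acyclicity is automatic: `homDim ≠ 0` forces `MCell.le`, a partial order.) -/
structure CapForest (D : LetterDesign) (ν : MCell) where
  nodes : Finset MCell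
  parent : MCell → MCell
  parent_mem : ∀ n ∈ nodes, parent n = ν ∨ parent n ∈ nodes
  live : ∀ n ∈ nodes, homDim n (parent n) ≠ 0 ∧ n ≠ parent n
  below_root : ∀ n ∈ nodes, homDim n ν ≠ 0 ∧ n ≠ ν
  sibling_disjoint : ∀ n ∈ nodes, ∀ n' ∈ nodes, n ≠ n' → parent n = parent n' →
    ∀ π ∈ D.cells, 0 < D.mP π → homDim π n = 0 ∨ homDim π n' = 0

/-- The empty `ν`-forest (its row is CAP-0 at `ν`). -/
def CapForest.empty (D : LetterDesign) (ν : MCell) : D.CapForest ν where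
  nodes := ∅
  parent := fun n ↦ n
  parent_mem := by simp
  live := by simp
  below_root := by simp
  sibling_disjoint := by simp

/-- Forest mass `Σ_{n ∈ F} m_N(n)`. -/
def CapForest.mass {D : LetterDesign} {ν : MCell} (F : D.CapForest ν) : ℤ := ∑ n ∈ F.nodes, (D.mN n : ℤ)

/-- Hopf-sharpened mass `Σ_{n ∈ F} (m_N(n) + homDim(n, parent n) − 1)` (CAP-FOREST♯; meaningful when every node has `m_N(n) ≥ 1`). -/
def CapForest.sharpMass {D : LetterDesign} {ν : MCell} (F : D.CapForest ν) : ℤ :=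
  ∑ n ∈ F.nodes, ((D.mN n : ℤ) + homDim n (F.parent n) - 1)

/-- **ROW CAP-FOREST** at `ν` along the forest `F` with tolerance `t` (= number of CAP1-status cells in `{ν} ∪ F`; `0` when all are KILL):
`m_N(ν) + Σ_F m_N(n) ≤ cap_ν + t`. -/
def CapForestRow (D : LetterDesign) (ν : MCell) (F : D.CapForest ν) (t : ℕ) : Prop := (D.mN ν : ℤ) + F.mass ≤ D.cap ν + t

/-- **ROW CAP-FOREST♯** (Hopf sharpening; design-level use only). -/
def CapForestSharpRow (D : LetterDesign) (ν : MCell) (F : D.CapForest ν) (t : ℕ) : Prop := (D.mN ν : ℤ) + F.sharpMass ≤ D.cap ν + t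

/-- **ROW CAP-FOREST-ALL** (all statuses KILL, `t = 0`): every forest row at every design cell — the form valid on the 22 ALIVE keys of record. -/
def CapForestAll (D : LetterDesign) : Prop := ∀ ν ∈ D.cells, ∀ F : D.CapForest ν, D.CapForestRow ν F 0

theorem CapForest.mass_empty (D : LetterDesign) (ν : MCell) : (CapForest.empty D ν).mass = 0 := by
  simp [CapForest.mass, CapForest.empty]

/-- The empty forest row is ROW CAP-0. -/
theorem capForestRow_empty_iff (D : LetterDesign) (ν : MCell) : D.CapForestRow ν (CapForest.empty D ν) 0 ↔ D.CapZeroRow ν := by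
  simp [CapForestRow, CapForest.mass_empty, CapZeroRow]

/-- CAP-FOREST-ALL refines CAP-0-ALL. -/
theorem capZeroAll_of_capForestAll {D : LetterDesign} (h : D.CapForestAll) : D.CapZeroAll :=
  fun ν hν ↦ (capForestRow_empty_iff D ν).1 (h ν hν _)

/-- A larger tolerance only weakens the row (the CAP1 reading is the conservative one). -/
theorem capForestRow_mono {D : LetterDesign} {ν : MCell} {F : D.CapForest ν} {t t' : ℕ} (htt : t ≤ t') (h : D.CapForestRow ν F t) :
    D.CapForestRow ν F t' := by
  unfold CapForestRow at *
  omega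

/-- DOWN-room capacity of an `N`-cell from the `P`-cells ABOVE it: `dcap_ν = Σ_γ homDim(ν, γ) · m_P(γ)` (columns of `ψ : N → P` leaving `L_ν^{m_ν}`). -/
def dcap (D : LetterDesign) (ν : MCell) : ℤ := ∑ γ ∈ D.cells, homDim ν γ * D.mP γ

/-- A DOWN `ν`-forest (transpose of `CapForest`): nodes ABOVE the root, each node above its parent, siblings `P`-disjoint from above. -/
structure CapForestDown (D : LetterDesign) (ν : MCell) where
  nodes : Finset MCell
  parent : MCell → MCell
  parent_mem : ∀ n ∈ nodes, parent n = ν ∨ parent n ∈ nodes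
  live : ∀ n ∈ nodes, homDim (parent n) n ≠ 0 ∧ n ≠ parent n
  above_root : ∀ n ∈ nodes, homDim ν n ≠ 0 ∧ n ≠ ν
  sibling_disjoint : ∀ n ∈ nodes, ∀ n' ∈ nodes, n ≠ n' → parent n = parent n' →
    ∀ γ ∈ D.cells, 0 < D.mP γ → homDim n γ = 0 ∨ homDim n' γ = 0

/-- DOWN forest mass. -/
def CapForestDown.mass {D : LetterDesign} {ν : MCell} (F : D.CapForestDown ν) : ℤ := ∑ n ∈ F.nodes, (D.mN n : ℤ)

/-- **ROW CAP-FOREST (DOWN room)**: `m_N(ν) + Σ_F m_N(n) ≤ dcap_ν + t`. -/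
def CapForestDownRow (D : LetterDesign) (ν : MCell) (F : D.CapForestDown ν) (t : ℕ) : Prop :=
  (D.mN ν : ℤ) + F.mass ≤ D.dcap ν + t

end LetterDesign

/-! ### Numeric certificates of record (memo §4) -/

/-- S131 j335419 `S131-plain-K1` (rank 17): hub `N57 × 17`, the 24-node hub forest carries mass `16`, `cap_hub = 32`, all statuses KILL (`t = 0`):
the HUB forest row is violated (`17 + 16 > 32`) although CAP-0 at the hub holds (`17 ≤ 32`). -/
example : ¬ ((17 : ℤ) + 16 ≤ 32 + (0 : ℕ)) ∧ ((17 : ℤ) ≤ 32) := by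
  refine ⟨by omega, by omega⟩

/-- sup-045 root-LP vertex (it 1, exact ℚ): `ν = N27`, `m_ν = cap_ν = 5∕36` (CAP-0 tight), child `N21` of mass `1∕12`: the pair row is cut by `1∕12`;
after adding it the LP is infeasible (certificate multipliers `128 · E4 + 1 · sign + 64 · CAP-0(N21) + 192 · CAP-FOREST(N27 ⊃ N21)`, rhs `16 > 0`). -/
example : ¬ ((5 : ℚ) / 36 + 1 / 12 ≤ 5 / 36) ∧ ((5 : ℚ) / 36 ≤ 5 / 36) := by norm_num

end CapForest

/-! # § DMass — ROW FAMILY «D-MASS»: the diagonal criterion (RULE D) WITH MULTIPLICITIES (g10; memo `C4-DMASS-c4-1-g10.md`)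

HONEST FRAMING. Typed predicates + two kernel-checked linear-algebra kernels + numeric certificates. The LAW they transcribe (memo §1) is a
statement BEHIND THE DOOR (H2) (`ob_κ(𝓔) = 0` for every `κ ∈ T_W ≅ M₄(ℂ)`, `T_W` full) for the cohomology sheaf `𝓔` of a plain TWO-TERM UP room
`0 → E₊ →φ E₋ → 𝓔 → 0` on a LINE support, read through THEOREM P (`TwoLevelObstructionFactorisation.exists_lower_of_comp_g_eq_zero` ∕
`exists_upper_of_extClass_comp_eq_zero`) in the row-716 model dictionary (`ob = κ ∪ c₁`, Künneth–Leray images; memo §1.2–1.4 = paper part, pen).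
Nothing in this section is a theorem about sheaves, nothing is proved toward HC ∕ HC_CM ∕ HC_AV ∕ №4 ∕ 26512 ∕ 18881 ∕ H2; LETTER designs ≠ designs-with-φ ≠
sheaves ≠ SEED. No `sorry`, no instance, no notation.

THE MODEL (memo §1.1). A cell `ν : MCell` = four balanced factor points `(a_f; β_f = x_f + i y_f)`; `V_f = H^{0,1}(S_f) = ⟨ē_{A_f}, ē_{B_f}⟩`; the
`(g,j)`-block (`g < j`) of `H^{0,2}(X) ⊃ V_g ⊗ V_j` is a `2 × 2` matrix (rows `ē_{A_g}, ē_{B_g}`, columns `ē_{A_j}, ē_{B_j}`). For `κ ∈ T_W` with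
coordinates `k ∈ M₄(ℂ)` (`κ(dz_{A_g}) = Σ_j k_{jg} dz̄_{B_j}`, `κ(dz_{B_j}) = Σ_g k_{jg} dz̄_{A_g}`) the `(g,j)`-block of `ob_κ(L_ν) = κ ⌟ c₁(L_ν)` is
`k_{jg} · blockM₁ ν g j + k_{gj} · blockM₂ ν g j`. Behind (H2), THEOREM P (lower level) with multiplicities gives, for EACH `i ∈ {1,2}` separately
(`k_{jg}`, `k_{gj}` are free since `T_W` is full), `blockMᵢ ⊗ Id_{m_ν} ∈ Σ_p Image_p ⊗ Hom(ℂ^{m_ν}, U_p)` with `dim U_p ≤ h⁰(ν − p) · m_p` and `Image_p ⊂ V_g ⊗ V_j`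
= `ξ̄_δ ⊗ V_j` (LEG on `g`: `ν − p` null of direction `δ` on `g`, zero elsewhere; `ξ̄_δ ∝ a_δ ē_A + β_δ ē_B`), `V_g ⊗ ξ̄_δ` (leg on `j`), `ξ̄ ⊗ ξ̄′` ((r2a):
null on `g` and `j` only), the whole block (identical class), `0` otherwise (a timelike factor difference or ≥ 3 null factors). Applying `λ ⊗ μ ⊗ id`
(`dmass_functional_push`): ROW D-MASS-N. The P-side row is the mirror through THEOREM P's upper level. -/

section DMass

/-! ### Kernel-checked linear algebra: the functional push (memo §1.4) -/

/-- **Functional push (the count behind every D-MASS row).** If a FIXED non-zero scalar multiple of every vector of `W` lies in `⨆_{p ∈ s} U_p`, then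
`dim W ≤ Σ_{p ∈ s} dim U_p`. (Apply `λ ⊗ μ ⊗ id` to `Mᵢ ⊗ Id_{m_ν} ∈ Σ_p Image_p ⊗ Hom(ℂ^{m_ν}, U_p)`: the suppliers annihilated by `λ ⊗ μ` drop out and
`c = (λ ⊗ μ)(Mᵢ) ≠ 0` multiplies `Id`; `W = ℂ^{m_ν}`, `s` = the non-annihilated suppliers, `dim U_p ≤ h⁰(ν − p) · m_p`.) -/
theorem dmass_functional_push {K W ι : Type*} [Field K] [AddCommGroup W] [Module K W] [FiniteDimensional K W]
    (U : ι → Submodule K W) (s : Finset ι) {c : K} (hc : c ≠ 0) (h : ∀ w : W, c • w ∈ ⨆ p ∈ s, U p) :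
    Module.finrank K W ≤ ∑ p ∈ s, Module.finrank K ↥(U p) := by
  have htop : (⨆ p ∈ s, U p) = ⊤ := by
    rw [eq_top_iff]
    intro w _
    have hw : w = c⁻¹ • (c • w) := by rw [smul_smul, inv_mul_cancel₀ hc, one_smul]
    rw [hw]
    exact Submodule.smul_mem _ _ (h w)
  have hle := Literature.LinearAlgebra.finrank_biSup_le_sum_finrank U s
  rw [htop, finrank_top] at hle
  exact hle

/-- The same with the dimension bounds `dim U_p ≤ u_p` (`u_p = h⁰(ν − p) · m_p`) substituted: `dim W ≤ Σ_{p ∈ s} u_p`. -/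
theorem dmass_functional_push_le {K W ι : Type*} [Field K] [AddCommGroup W] [Module K W] [FiniteDimensional K W]
    (U : ι → Submodule K W) (s : Finset ι) (u : ι → ℕ) (hu : ∀ p ∈ s, Module.finrank K ↥(U p) ≤ u p) {c : K} (hc : c ≠ 0)
    (h : ∀ w : W, c • w ∈ ⨆ p ∈ s, U p) : Module.finrank K W ≤ ∑ p ∈ s, u p :=
  (dmass_functional_push U s hc h).trans (Finset.sum_le_sum hu)

/-- **Annihilated suppliers drop out (the tensor step of memo §1.4).** `Φ = λ ⊗ μ : V_g ⊗ V_j → ℂ` a functional on the block space `V`, `S_p ⊂ V`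
the image line ∕ plane of the supplier `p`, `U_p ⊂ W = ℂ^{m_ν}` its column space; if `M ⊗ w` lies in `Σ_{p ∈ s} S_p ⊗ U_p` for every `w` (THEOREM P with
multiplicities) and `Φ(M) ≠ 0`, then `dim W ≤ Σ dim U_p` over the suppliers `p ∈ s` NOT annihilated by `Φ` (`good`). -/
theorem dmass_push_through_functional {K V W ι : Type*} [DecidableEq ι] [Field K] [AddCommGroup V] [Module K V] [AddCommGroup W] [Module K W]
    [FiniteDimensional K W] (Φ : V →ₗ[K] K) (S : ι → Submodule K V) (U : ι → Submodule K W) (s good : Finset ι)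
    (hkill : ∀ p ∈ s, p ∉ good → ∀ v ∈ S p, Φ v = 0) {M : V} (hM : Φ M ≠ 0)
    (h : ∀ w : W, M ⊗ₜ[K] w ∈ ⨆ p ∈ s, Submodule.map₂ (TensorProduct.mk K V W) (S p) (U p)) :
    Module.finrank K W ≤ ∑ p ∈ s.filter (· ∈ good), Module.finrank K ↥(U p) := by
  let ψ : TensorProduct K V W →ₗ[K] W := TensorProduct.lift ((LinearMap.lsmul K W).comp Φ)
  have hψ : ∀ (v : V) (w : W), ψ (v ⊗ₜ[K] w) = Φ v • w := fun v w => by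
    simp only [ψ, TensorProduct.lift.tmul, LinearMap.comp_apply, LinearMap.lsmul_apply]
  have hle : (⨆ p ∈ s, Submodule.map₂ (TensorProduct.mk K V W) (S p) (U p)) ≤
      Submodule.comap ψ (⨆ p ∈ s.filter (· ∈ good), U p) := by
    refine iSup₂_le fun p hp => ?_
    refine Submodule.map₂_le.mpr fun v hv w hw => ?_
    rw [Submodule.mem_comap, TensorProduct.mk_apply, hψ]
    by_cases hg : p ∈ good
    · have hp' : p ∈ s.filter (· ∈ good) := Finset.mem_filter.mpr ⟨hp, hg⟩
      exact Submodule.mem_iSup_of_mem p (Submodule.mem_iSup_of_mem hp' (Submodule.smul_mem _ _ hw))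
    · rw [hkill p hp hg v hv, zero_smul]
      exact Submodule.zero_mem _
  refine dmass_functional_push U (s.filter (· ∈ good)) hM fun w => ?_
  have hw := hle (h w)
  rw [Submodule.mem_comap, hψ] at hw
  exact hw

/-- **P-side count (memo §1.5, ROW D-MASS-P).** If `c • id_W = Σ_{ν ∈ s} f_ν` with `c ≠ 0` (`c = (λ⊗μ)(Mᵢ)`, `W = ℂ^{m_π}`) and `rank f_ν ≤ d ν`
(`f_ν` factors through `ℂ^{m_ν} ⊗ H⁰(ν − π)`, so `d ν = h⁰(ν − π)·m_ν`), then `dim W ≤ Σ_{ν ∈ s} d ν`, i.e. `m_π ≤ Σ_{good ν} h⁰(ν − π)·m_ν`. -/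
theorem dmass_rank_push {K W ι : Type*} [Field K] [AddCommGroup W] [Module K W] [FiniteDimensional K W]
    (f : ι → (W →ₗ[K] W)) (s : Finset ι) (d : ι → ℕ) (hd : ∀ p ∈ s, Module.finrank K ↥(LinearMap.range (f p)) ≤ d p)
    {c : K} (hc : c ≠ 0) (h : ∀ w : W, c • w = ∑ p ∈ s, f p w) :
    Module.finrank K W ≤ ∑ p ∈ s, d p := by
  refine dmass_functional_push_le (fun p => LinearMap.range (f p)) s d hd hc fun w => ?_
  rw [h w]
  exact Submodule.sum_mem _ fun p hp =>
    Submodule.mem_iSup_of_mem p (Submodule.mem_iSup_of_mem hp (LinearMap.mem_range_self (f p) w))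

/-- The rank bound used in `dmass_rank_push`: a map factoring through `M` (`= ℂ^{m_ν} ⊗ H⁰(ν − π)`) has rank `≤ dim M`. -/
theorem finrank_range_comp_le {K W M : Type*} [Field K] [AddCommGroup W] [Module K W] [AddCommGroup M] [Module K M]
    [FiniteDimensional K M] (A : W →ₗ[K] M) (B : M →ₗ[K] W) :
    Module.finrank K ↥(LinearMap.range (B.comp A)) ≤ Module.finrank K M :=
  (Submodule.finrank_mono (LinearMap.range_comp_le_range A B)).trans (LinearMap.finrank_range_le B)

/-- **ROW D-MASS-P assembled:** `c • id = Σ_ν B_ν ∘ A_ν` through spaces `M_ν` of dimension `≤ d ν` and `c ≠ 0` ⟹ `dim W ≤ Σ d ν`. -/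
theorem dmass_rank_push_factoring {K W ι : Type*} [Field K] [AddCommGroup W] [Module K W] [FiniteDimensional K W]
    (M : ι → Type*) [∀ p, AddCommGroup (M p)] [∀ p, Module K (M p)] [∀ p, FiniteDimensional K (M p)]
    (A : ∀ p, W →ₗ[K] M p) (B : ∀ p, M p →ₗ[K] W) (s : Finset ι) (d : ι → ℕ) (hd : ∀ p ∈ s, Module.finrank K (M p) ≤ d p)
    {c : K} (hc : c ≠ 0) (h : ∀ w : W, c • w = ∑ p ∈ s, B p (A p w)) :
    Module.finrank K W ≤ ∑ p ∈ s, d p :=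
  dmass_rank_push (fun p => (B p).comp (A p)) s d (fun p hp => (finrank_range_comp_le (A p) (B p)).trans (hd p hp)) hc
    (fun w => by simpa only [LinearMap.comp_apply] using h w)

/-! ### Letters as Gaussian integers; the two block matrices (memo §1.2) -/

/-- `β = x + i·y ∈ ℤ[i]` of a balanced factor point `(α, x, y)`. -/
def betaG (b : BPoint) : GaussianInt := ⟨b.2.1, b.2.2⟩

/-- an integer as a Gaussian integer. -/
def intG (n : ℤ) : GaussianInt := ⟨n, 0⟩

/-- **`M₁`**: the coefficient of `k_{jg}` in the `(g,j)`-block of `ob_κ(L_ν) = κ ⌟ c₁(L_ν)`: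
`[[conj β_j, a_j − a_g], [0, −β_g]]` (rows `ē_{A_g}, ē_{B_g}`; columns `ē_{A_j}, ē_{B_j}`). Memo §1.2 (sign convention forced by the hub being unobstructed). -/
def blockM₁ (ν : MCell) (g j : Fin 4) : Matrix (Fin 2) (Fin 2) GaussianInt :=
  !![star (betaG (ν j)), intG ((ν j).1 - (ν g).1); 0, -betaG (ν g)]

/-- **`M₂`**: the coefficient of `k_{gj}`: `[[−conj β_g, 0], [a_j − a_g, β_j]]`. -/
def blockM₂ (ν : MCell) (g j : Fin 4) : Matrix (Fin 2) (Fin 2) GaussianInt :=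
  !![-star (betaG (ν g)), 0; intG ((ν j).1 - (ν g).1), betaG (ν j)]

/-! ### Factor differences, leg directions, covectors (memo §1.3) -/

/-- a factor difference `Δ = ν_f − p_f` is NULL and future (a positive multiple of a fibre class: `x² + y² = α²`, `α > 0`). -/
abbrev IsNullDiff (Δ : BPoint) : Prop := 0 < Δ.1 ∧ Δ.2.1 ^ 2 + Δ.2.2 ^ 2 = Δ.1 ^ 2

/-- a factor difference is TIMELIKE future (positive definite: `x² + y² < α²`, `α > 0`). -/
abbrev IsTimelikeDiff (Δ : BPoint) : Prop := 0 < Δ.1 ∧ Δ.2.1 ^ 2 + Δ.2.2 ^ 2 < Δ.1 ^ 2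

/-- the line `ξ̄_Δ ∝ a_Δ ē_A + β_Δ ē_B ⊂ V_f` of a null difference `Δ` (coordinates `(ē_A, ē_B)`; a positive multiple of the primitive direction spans the
same line, so no normalisation is needed for annihilation tests). -/
def lineVec (Δ : BPoint) : Fin 2 → GaussianInt := ![intG Δ.1, betaG Δ]

/-- the bilinear pairing `⟨λ, v⟩ = λ_A v_A + λ_B v_B` of a covector with a vector of `V_f` (coordinates over `ℤ[i]`). -/
def gPairing (l v : Fin 2 → GaussianInt) : GaussianInt := l 0 * v 0 + l 1 * v 1

/-- the canonical ANNIHILATOR covector of the line of `Δ`: `λ = (β_Δ, −a_Δ)`. -/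
def annCovec (Δ : BPoint) : Fin 2 → GaussianInt := ![betaG Δ, -intG Δ.1]

/-- `λ` annihilates the line `ξ̄_Δ`. -/
abbrev Annihilates (l : Fin 2 → GaussianInt) (Δ : BPoint) : Prop := gPairing l (lineVec Δ) = 0

/-- `(λ ⊗ μ)(M) = Σ_{r,s} λ_r M_{rs} μ_s ≠ 0`: the functional DETECTS the block matrix. -/
abbrev Detects (l m : Fin 2 → GaussianInt) (M : Matrix (Fin 2) (Fin 2) GaussianInt) : Prop :=
  l 0 * M 0 0 * m 0 + l 0 * M 0 1 * m 1 + l 1 * M 1 0 * m 0 + l 1 * M 1 1 * m 1 ≠ 0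

/-- a D-MASS functional `(g, j; λ, μ)` is VALID for the cell `ν`: `g < j` and `λ ⊗ μ` detects `M₁` OR `M₂` (each `Mᵢ ⊗ Id_{m_ν}` lies in the supplied
space separately, because `k_{jg}` and `k_{gj}` are independent coordinates of the FULL `T_W ≅ M₄(ℂ)`). -/
abbrev DMassValid (ν : MCell) (g j : Fin 4) (l m : Fin 2 → GaussianInt) : Prop :=
  g < j ∧ (Detects l m (blockM₁ ν g j) ∨ Detects l m (blockM₂ ν g j))

/-- the canonical annihilator does annihilate. [`ring`] -/
theorem annihilates_annCovec (Δ : BPoint) : Annihilates (annCovec Δ) Δ := by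
  have h1 : annCovec Δ 0 = betaG Δ := rfl
  have h2 : annCovec Δ 1 = -intG Δ.1 := rfl
  have h3 : lineVec Δ 0 = intG Δ.1 := rfl
  have h4 : lineVec Δ 1 = betaG Δ := rfl
  show annCovec Δ 0 * lineVec Δ 0 + annCovec Δ 1 * lineVec Δ 1 = 0
  rw [h1, h2, h3, h4]
  ring

/-! ### Supplier kinds of a pair `lower ≤ upper` of cells (UP room: `lower` = a `P`-cell, `upper` = an `N`-cell; memo §1.3) -/

/-- **LEG on `g`**: `upper − lower` is null on the factor `g` and zero on the other three factors (`Image = ξ̄_δ ⊗ V_j` in every block `(g, j)`,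
`V_j ⊗ ξ̄_δ`-mirror in blocks `(j, g)`). -/
abbrev IsLegBelow (lower upper : MCell) (g : Fin 4) : Prop :=
  IsNullDiff (bsub (upper g) (lower g)) ∧ ∀ f, f ≠ g → lower f = upper f

/-- **(r2a) partner on `(g, j)`**: null on `g` and on `j`, zero elsewhere (`Image = ξ̄ ⊗ ξ̄′` in the block `(g, j)` only). -/
abbrev IsR2aBelow (lower upper : MCell) (g j : Fin 4) : Prop :=
  g ≠ j ∧ IsNullDiff (bsub (upper g) (lower g)) ∧ IsNullDiff (bsub (upper j) (lower j)) ∧ ∀ f, f ≠ g → f ≠ j → lower f = upper f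

/-- the pair `lower ≤ upper` SUPPLIES the block `(g, j)` under the functional `(λ, μ)`: identical class (whole block), a leg on `g` whose line `λ` does
not annihilate, a leg on `j` whose line `μ` does not annihilate, or an (r2a) partner on `(g, j)` with neither line annihilated. Every other live pair
(a timelike factor, a leg on a third factor, ≥ 3 null factors) has image `0` in the block `(g, j)` and never counts. -/
abbrev DMassCounts (lower upper : MCell) (g j : Fin 4) (l m : Fin 2 → GaussianInt) : Prop :=
  lower = upper ∨
  (IsLegBelow lower upper g ∧ ¬ Annihilates l (bsub (upper g) (lower g))) ∨
  (IsLegBelow lower upper j ∧ ¬ Annihilates m (bsub (upper j) (lower j))) ∨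
  (IsR2aBelow lower upper g j ∧ ¬ Annihilates l (bsub (upper g) (lower g)) ∧ ¬ Annihilates m (bsub (upper j) (lower j)))

/-! ### The rows (memo §1.4; canonical lift: `h⁰(ν − p) = homDim p ν`) -/

namespace LetterDesign

/-- N-side D-MASS capacity of the `N`-cell `ν` for `(g, j; λ, μ)`: `Σ_{p counted} h⁰(ν − p) · m_P(p)` over the `P`-cells below `ν`. -/
def dmassCapN (D : LetterDesign) (ν : MCell) (g j : Fin 4) (l m : Fin 2 → GaussianInt) : ℤ :=
  ∑ p ∈ D.cells, if DMassCounts p ν g j l m then homDim p ν * D.mP p else 0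

/-- P-side D-MASS capacity of the `P`-cell `π` for `(g, j; λ, μ)`: `Σ_{ν counted} h⁰(ν − π) · m_N(ν)` over the `N`-cells above `π` (servers). -/
def dmassCapP (D : LetterDesign) (π : MCell) (g j : Fin 4) (l m : Fin 2 → GaussianInt) : ℤ :=
  ∑ ν ∈ D.cells, if DMassCounts π ν g j l m then homDim π ν * D.mN ν else 0

/-- **ROW D-MASS-N** `(ν; g, j; λ, μ)`: a valid functional forces `m_N(ν) ≤ Σ_{p counted} h⁰(ν − p) · m_P(p)` (THEOREM P, lower level, behind (H2)). -/
def DMassRowN (D : LetterDesign) (ν : MCell) (g j : Fin 4) (l m : Fin 2 → GaussianInt) : Prop :=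
  DMassValid ν g j l m → (D.mN ν : ℤ) ≤ D.dmassCapN ν g j l m

/-- **ROW D-MASS-P** `(π; g, j; λ, μ)`: a valid functional forces `m_P(π) ≤ Σ_{ν counted} h⁰(ν − π) · m_N(ν)` (THEOREM P, upper level, behind (H2)). -/
def DMassRowP (D : LetterDesign) (π : MCell) (g j : Fin 4) (l m : Fin 2 → GaussianInt) : Prop :=
  DMassValid π g j l m → (D.mP π : ℤ) ≤ D.dmassCapP π g j l m

/-- all N-side rows of a design. -/
def DMassN (D : LetterDesign) : Prop := ∀ ν ∈ D.cells, ∀ g j : Fin 4, ∀ l m : Fin 2 → GaussianInt, D.DMassRowN ν g j l m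

/-- all P-side rows of a design. -/
def DMassP (D : LetterDesign) : Prop := ∀ π ∈ D.cells, ∀ g j : Fin 4, ∀ l m : Fin 2 → GaussianInt, D.DMassRowP π g j l m

/-- **D-MASS (both levels)** — the design-level certificate: violated ⟹ behind (H2) NO two-term UP room with these cell multiplicities (any `φ`, canonical
lift; memo §1.6 for the Pic⁰-twist robustness) has `ob_κ(𝓔) = 0` for all `κ ∈ T_W`. -/
def DMassAll (D : LetterDesign) : Prop := D.DMassN ∧ D.DMassP

end LetterDesign

/-! ### Numeric certificates of record (memo §4–§5) -/

/-- the cell `N25 = [12,-2,0|12,-2,0|13,-1,0|13,0,-1]` of the ALIVE22 key sup-040 (orbit size 48). -/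
def cellN25sup040 : MCell := ![((12 : ℤ), (-2 : ℤ), (0 : ℤ)), (12, -2, 0), (13, -1, 0), (13, 0, -1)]

/-- its `(0,1)`-blocks: `M₁ = diag(−2, 2)`, `M₂ = diag(2, −2)` (`β₀ = β₁ = −2`, `a₁ − a₀ = 0`). [`decide`] -/
example : blockM₁ cellN25sup040 0 1 = !![⟨-2, 0⟩, ⟨0, 0⟩; 0, ⟨2, 0⟩] ∧ blockM₂ cellN25sup040 0 1 = !![⟨2, 0⟩, 0; ⟨0, 0⟩, ⟨-2, 0⟩] := by decide

/-- the killer functional of sup-040 (memo §4.2): `λ` generic (here `λ = (1, 0)`), `μ = annCovec (1; 1 + 0i) = (1, −1)` (annihilates the line of the two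
factor-1 legs of direction `(1; 1 + 0i)`); it detects `M₁`: `(λ ⊗ μ)(M₁) = λ_A · (−2) · μ_A = −2 ≠ 0`. [`decide`] -/
example : DMassValid cellN25sup040 0 1 ![1, 0] (annCovec (1, 1, 0)) := by decide

/-- `μ = annCovec (1; 1 + 0i)` annihilates the direction `(1; 1 + 0i)` but NOT the direction `(1; 0 − 1i)` (so a factor-1 leg of direction `(1; −i)` would
still count). [`decide`] -/
example : Annihilates (annCovec (1, 1, 0)) (1, 1, 0) ∧ ¬ Annihilates (annCovec (1, 1, 0)) (1, 0, -1) := by decide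

/-- sup-040, N-side rows only (memo §4.2; exact ℚ Farkas certificate, 5 rows, NO rank row, NO X6-LIN row): multipliers `128 · (H1)E4 + 1 · sign(+im) +
256 · CAP-0(N23) + 96 · CAP-0(N25) + 288 · D-MASS-N(N25; (0,1); gen, ann(1;1+0i))` combine to `−672·m57 − 160·m62 − 672·m63 ≥ 32`, impossible for
masses `≥ 0`. The arithmetic of the combination on the seven orbits involved (`m23, m25, m56, m57, m62, m63, m65`): -/
example (m23 m25 m56 m57 m62 m63 m65 : ℚ)
    (hE4 : m23 + 3 / 2 * m25 - 9 / 2 * m56 - 9 / 2 * m57 - 2 * m62 - 3 * m63 - 1 / 4 * m65 = 0)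
    (hsign : 128 * m23 + 192 * m25 - 576 * m56 - 576 * m57 - 256 * m62 - 384 * m63 + 32 * m65 ≥ 32)
    (hcap23 : 3 * m56 + m62 - m23 ≥ 0) (hcap25 : 4 * m56 + 2 * m57 + m62 + m63 - m25 ≥ 0) (hdm : m57 - m25 ≥ 0)
    (h57 : 0 ≤ m57) (h62 : 0 ≤ m62) (h63 : 0 ≤ m63) : False := by
  linarith

/-- d16-sup-009 (`σ = −im`), N-side rows only (memo §4.2): `(H1)E4 × 96 + sign × 3 + CAP-0(N18) × 160 + D-MASS-N(N18; (0,1); ann(1;1+0i), gen) × 32`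
combine to `−640·m46 ≥ 48`: impossible. -/
example (m46 : ℚ) (h : 0 ≤ m46) : ¬ (-640 * m46 ≥ 48) := by
  intro h'
  linarith

end DMass

/-! ## § TwoDoor (v1.12, c4-1 g11; memo `C4-2DMASS-c4-1-g11.md`) — LAW «2D-MASS»: the two-door D-MASS rows of a THREE-TERM box monad behind (H2)

HONEST FRAMING. Evidence-level typing for the cell `pub-hsemireg`; designs ≠ sheaves ≠ a SEED; nothing below is a rung toward `BlochSeedDiscOne` ∕ 18881 ∕
H2 ∕ №4 ∕ 26512 ∕ HC_AV ∕ HC_CM ∕ HC. The categorical ∕ counting lemmas are kernel-checked homological ∕ linear algebra; the design-level `def`s are PREDICATES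
whose sheaf-level meaning (memo THEOREM 2D, pen) is: for a box monad `A —i→ N —q→ C` (`i` a sub-bundle, `q` onto, `E = ker q ∕ im i`) with display
`S₂ : 0 → A → K → E → 0`, `S₁ : 0 → K → N → C → 0`, `S_Q : 0 → A → N → Q → 0`, `S_E : 0 → E → Q → C → 0`, `ob_κ(E) = 0` (`κ ∈ T_W`, behind (H2)) forces
(I) `j ≫ ω_N = η ≫ i` (`twoDoor_lower`) ⟹ ROW (N-i) `m_N(ν) ≤ dcap^A_ν(λ,μ) + ccap_ν` (`twoDoor_row_Ni`); (II) `ω_N ≫ π = q ≫ θ` (`twoDoor_upper`) ⟹ ROW (N-ii)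
`m_N(ν) ≤ cap^A_ν + dcap^C_ν(λ,μ)` (`twoDoor_row_Nii`); (III) behind the SWITCH `Ext³(C, A) = 0` only: `ω_N = η̃ ≫ i + q ≫ ζ`, `ω_A = i ≫ η′`, `ω_C = ζ′ ≫ q`
(`twoDoor_both` ∕ `_sub` ∕ `_quot`) ⟹ ROWS (N-iii), (A), (C) — without the switch the lift is obstructed by the Massey class `[S₁] ≫ η ∈ Ext³(C, A)`, so only
their door-free shadows (Hall, CAP-3 = `CapZeroRowMonad`) are unconditional. «Good» suppliers and valid functionals are EXACTLY § `DMass`'s (`DMassCounts`,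
`DMassValid`); `h⁰` at maximal alignment is an upper bound at every twist (memo §2.5). Two-term UP rooms: (N-i) = D-MASS-N, (N-ii) = CAP-0, (A) = D-MASS-P.
-/

section TwoDoor

section TwoDoorCategorical

open CategoryTheory CategoryTheory.Abelian CategoryTheory.Limits

universe w v u

variable {C : Type u} [Category.{v} C] [Abelian C] [HasExt.{w} C] {n : ℕ}

/-- **kernel of ROW (N-i).** `S₂ : 0 → A → K → E → 0` short exact, `j : K → N`; `ωK, ωN, ωE` natural along `S₂.g` and `j`; `ωE = 0` ⟹ `j ≫ ωN = η ≫ (S₂.f ≫ j)`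
for some `η ∈ Extⁿ(K, A)` (one step of the covariant long exact sequence of `Hom(K, −)` on `S₂`). -/
theorem twoDoor_lower {S₂ : ShortComplex C} (hS₂ : S₂.ShortExact) {N : C} (j : S₂.X₂ ⟶ N)
    (ωK : Ext S₂.X₂ S₂.X₂ n) (ωN : Ext N N n) (ωE : Ext S₂.X₃ S₂.X₃ n)
    (comm_p : (Ext.mk₀ S₂.g).comp ωE (zero_add n) = ωK.comp (Ext.mk₀ S₂.g) (add_zero n))
    (comm_j : (Ext.mk₀ j).comp ωN (zero_add n) = ωK.comp (Ext.mk₀ j) (add_zero n)) (h : ωE = 0) :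
    ∃ η : Ext S₂.X₂ S₂.X₁ n, (Ext.mk₀ j).comp ωN (zero_add n) = η.comp (Ext.mk₀ (S₂.f ≫ j)) (add_zero n) := by
  have hK : ωK.comp (Ext.mk₀ S₂.g) (add_zero n) = 0 := by rw [← comm_p, h, Ext.comp_zero]
  obtain ⟨η, hη⟩ := Ext.covariant_sequence_exact₂ (hS := hS₂) (X := S₂.X₂) ωK hK
  refine ⟨η, ?_⟩
  rw [comm_j, ← hη, Ext.comp_assoc_of_third_deg_zero, Ext.mk₀_comp_mk₀]

/-- **kernel of ROW (N-ii).** `S : 0 → E → Q → C → 0` short exact (`q̄ = S.g` onto), `π : N → Q`; `ωE, ωQ, ωN` natural along `S.f` and `π`; `ωE = 0` ⟹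
`ωN ≫ π = (π ≫ S.g) ≫ θ` for some `θ ∈ Extⁿ(C, Q)` (one step of the contravariant long exact sequence of `Hom(−, Q)` on `S`). -/
theorem twoDoor_upper {S : ShortComplex C} (hS : S.ShortExact) {N : C} (π : N ⟶ S.X₂)
    (ωE : Ext S.X₁ S.X₁ n) (ωQ : Ext S.X₂ S.X₂ n) (ωN : Ext N N n)
    (comm_e : (Ext.mk₀ S.f).comp ωQ (zero_add n) = ωE.comp (Ext.mk₀ S.f) (add_zero n))
    (comm_π : (Ext.mk₀ π).comp ωQ (zero_add n) = ωN.comp (Ext.mk₀ π) (add_zero n)) (h : ωE = 0) :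
    ∃ θ : Ext S.X₃ S.X₂ n, ωN.comp (Ext.mk₀ π) (add_zero n) = (Ext.mk₀ (π ≫ S.g)).comp θ (zero_add n) := by
  have hQ : (Ext.mk₀ S.f).comp ωQ (zero_add n) = 0 := by rw [comm_e, h, Ext.zero_comp]
  obtain ⟨θ, hθ⟩ := Ext.contravariant_sequence_exact₂ (hS := hS) (Y := S.X₂) ωQ hQ
  refine ⟨θ, ?_⟩
  rw [← comm_π, ← hθ, ← Ext.mk₀_comp_mk₀]
  exact (Ext.comp_assoc (Ext.mk₀ π) (Ext.mk₀ S.g) θ (add_zero 0) (zero_add n) (by omega)).symm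

/-- **the Ext switch.** `S₁ : 0 → K → N → C → 0` short exact: every `η ∈ Extⁿ(K, A)` lifts to `Extⁿ(N, A)` once `Extⁿ⁺¹(C, A) = 0` (the obstruction is `[S₁] ≫ η`). -/
theorem twoDoor_lift_of_ext_succ_eq_zero {S₁ : ShortComplex C} (hS₁ : S₁.ShortExact) {A : C} (η : Ext S₁.X₁ A n)
    (h0 : ∀ x : Ext S₁.X₃ A (n + 1), x = 0) :
    ∃ η' : Ext S₁.X₂ A n, (Ext.mk₀ S₁.f).comp η' (zero_add n) = η :=
  Ext.contravariant_sequence_exact₁ (hS := hS₁) (Y := A) η (add_comm 1 n) (h0 _)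

/-- **kernel of ROW (N-iii) (conditional).** `S₁ : 0 → K →j N →q C → 0` short exact, `i : A → N`; if `j ≫ ωN = η ≫ i` (`twoDoor_lower`) and `η` lifts along `j^*`
(`twoDoor_lift_of_ext_succ_eq_zero`) then `ωN = η̃ ≫ i + q ≫ ζ`: a class through the SUB door plus a class through the QUOTIENT door. -/
theorem twoDoor_both {S₁ : ShortComplex C} (hS₁ : S₁.ShortExact) {A : C} (i : A ⟶ S₁.X₂) (ωN : Ext S₁.X₂ S₁.X₂ n)
    (η : Ext S₁.X₁ A n) (hη : (Ext.mk₀ S₁.f).comp ωN (zero_add n) = η.comp (Ext.mk₀ i) (add_zero n))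
    (hlift : ∃ η' : Ext S₁.X₂ A n, (Ext.mk₀ S₁.f).comp η' (zero_add n) = η) :
    ∃ (η' : Ext S₁.X₂ A n) (ζ : Ext S₁.X₃ S₁.X₂ n),
      ωN = η'.comp (Ext.mk₀ i) (add_zero n) + (Ext.mk₀ S₁.g).comp ζ (zero_add n) := by
  obtain ⟨η', hη'⟩ := hlift
  have hx : (Ext.mk₀ S₁.f).comp (ωN - η'.comp (Ext.mk₀ i) (add_zero n)) (zero_add n) = 0 := by
    rw [sub_eq_add_neg, Ext.comp_add, Ext.comp_neg, hη, ← hη', Ext.comp_assoc_of_third_deg_zero, add_neg_cancel]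
  obtain ⟨ζ, hζ⟩ := Ext.contravariant_sequence_exact₂ (hS := hS₁) (Y := S₁.X₂) _ hx
  exact ⟨η', ζ, by rw [hζ]; abel⟩

/-- **kernel of ROW (A) (conditional).** `S : 0 → A →i N →π Q → 0` short exact, `ωA, ωQ` natural along `[S]` up to the sign `ε` (THEOREM P's `comm_δ`),
`ωQ = q̄ ≫ θ` (`twoDoor_upper`'s first step) and `Extⁿ⁺¹(C, A) = 0` ⟹ `ωA = i ≫ η′` for some `η′ ∈ Extⁿ(N, A)`. -/
theorem twoDoor_sub {S : ShortComplex C} (hS : S.ShortExact) {Cq : C} (qbar : S.X₃ ⟶ Cq)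
    (ωA : Ext S.X₁ S.X₁ n) (ωQ : Ext S.X₃ S.X₃ n) (ε : ℤˣ)
    (comm_δ : hS.extClass.comp ωA (add_comm 1 n) = (ε : ℤ) • ωQ.comp hS.extClass rfl)
    (hQ : ∃ θ : Ext Cq S.X₃ n, ωQ = (Ext.mk₀ qbar).comp θ (zero_add n)) (h0 : ∀ x : Ext Cq S.X₁ (n + 1), x = 0) :
    ∃ η' : Ext S.X₂ S.X₁ n, (Ext.mk₀ S.f).comp η' (zero_add n) = ωA := by
  obtain ⟨θ, hθ⟩ := hQ
  have hz : ωQ.comp hS.extClass (rfl : n + 1 = n + 1) = 0 := by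
    rw [hθ, Ext.comp_assoc (Ext.mk₀ qbar) θ hS.extClass (zero_add n) rfl (by omega), h0 (θ.comp hS.extClass rfl),
      Ext.comp_zero]
  have hA : hS.extClass.comp ωA (add_comm 1 n) = 0 := by rw [comm_δ, hz, smul_zero]
  exact Ext.contravariant_sequence_exact₁ (hS := hS) (Y := S.X₁) ωA (add_comm 1 n) hA

/-- **kernel of ROW (C) (conditional).** `S₁ : 0 → K →j N →q C → 0` short exact, `ωK, ωC` natural along `[S₁]` up to `ε`, `ωK = η ≫ i′` (`i′ : A → K`,
`twoDoor_lower`'s first step) and `Extⁿ⁺¹(C, A) = 0` ⟹ `ωC = ζ′ ≫ q` for some `ζ′ ∈ Extⁿ(C, N)`. -/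
theorem twoDoor_quot {S₁ : ShortComplex C} (hS₁ : S₁.ShortExact) {A : C} (i' : A ⟶ S₁.X₁)
    (ωK : Ext S₁.X₁ S₁.X₁ n) (ωC : Ext S₁.X₃ S₁.X₃ n) (ε : ℤˣ)
    (comm_δ : hS₁.extClass.comp ωK (add_comm 1 n) = (ε : ℤ) • ωC.comp hS₁.extClass rfl)
    (hK : ∃ η : Ext S₁.X₁ A n, ωK = η.comp (Ext.mk₀ i') (add_zero n)) (h0 : ∀ x : Ext S₁.X₃ A (n + 1), x = 0) :
    ∃ ζ' : Ext S₁.X₃ S₁.X₂ n, ζ'.comp (Ext.mk₀ S₁.g) (add_zero n) = ωC := by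
  obtain ⟨η, hη⟩ := hK
  have hz : hS₁.extClass.comp ωK (add_comm 1 n) = 0 := by
    rw [hη, ← Ext.comp_assoc_of_third_deg_zero, h0 (hS₁.extClass.comp η (add_comm 1 n)), Ext.zero_comp]
  have hC : ωC.comp hS₁.extClass (rfl : n + 1 = n + 1) = 0 := by
    have h1 : (ε : ℤ) • ωC.comp hS₁.extClass rfl = 0 := by rw [← comm_δ, hz]
    rcases Int.units_eq_one_or ε with h | h
    · simpa [h] using h1
    · simpa [h] using h1
  exact Ext.covariant_sequence_exact₃ (hS := hS₁) (X := S₁.X₃) ωC rfl hC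

end TwoDoorCategorical

section TwoDoorCounting

/-- **count of ROW (N-i).** `W ⊂ V` (the joint kernel of the `C`-coordinate maps); `c • w ∈ ⨆_{p ∈ s} U_p` for all `w ∈ W`, `c ≠ 0` ⟹ `dim W ≤ Σ dim U_p`. -/
theorem twoDoor_count_sub {K V ι : Type*} [Field K] [AddCommGroup V] [Module K V] [FiniteDimensional K V]
    (W : Submodule K V) (U : ι → Submodule K V) (s : Finset ι) {c : K} (hc : c ≠ 0)
    (h : ∀ w ∈ W, c • w ∈ ⨆ p ∈ s, U p) : Module.finrank K W ≤ ∑ p ∈ s, Module.finrank K ↥(U p) := by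
  have hle : W ≤ ⨆ p ∈ s, U p := fun w hw => by
    have hw' : w = c⁻¹ • (c • w) := by rw [smul_smul, inv_mul_cancel₀ hc, one_smul]
    rw [hw']
    exact Submodule.smul_mem _ _ (h w hw)
  exact (Submodule.finrank_mono hle).trans (Literature.LinearAlgebra.finrank_biSup_le_sum_finrank U s)

/-- **ROW (N-i) assembled:** `m ≤ dim W + ccap` (codimension of the joint kernel), `dim U_p ≤ u p` ⟹ `m ≤ Σ u + ccap`. -/
theorem twoDoor_row_Ni {K V ι : Type*} [Field K] [AddCommGroup V] [Module K V] [FiniteDimensional K V]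
    (W : Submodule K V) (U : ι → Submodule K V) (s : Finset ι) (u : ι → ℕ) (hu : ∀ p ∈ s, Module.finrank K ↥(U p) ≤ u p)
    {m ccap : ℕ} (hW : m ≤ Module.finrank K W + ccap) {c : K} (hc : c ≠ 0) (h : ∀ w ∈ W, c • w ∈ ⨆ p ∈ s, U p) :
    m ≤ (∑ p ∈ s, u p) + ccap :=
  hW.trans (Nat.add_le_add_right ((twoDoor_count_sub W U s hc h).trans (Finset.sum_le_sum hu)) ccap)

/-- **count of ROW (N-ii).** `U ⊂ V` (the span of the `A`-coordinate images); `c • (v mod U) = Σ_{p ∈ s} f_p v` with `rank f_p ≤ d p`, `c ≠ 0` ⟹ `dim (V ∕ U) ≤ Σ d p`. -/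
theorem twoDoor_count_quot {K V ι : Type*} [Field K] [AddCommGroup V] [Module K V] [FiniteDimensional K V]
    (U : Submodule K V) (f : ι → (V →ₗ[K] V ⧸ U)) (s : Finset ι) (d : ι → ℕ)
    (hd : ∀ p ∈ s, Module.finrank K ↥(LinearMap.range (f p)) ≤ d p) {c : K} (hc : c ≠ 0)
    (h : ∀ v : V, c • Submodule.Quotient.mk v = ∑ p ∈ s, f p v) :
    Module.finrank K (V ⧸ U) ≤ ∑ p ∈ s, d p := by
  refine dmass_functional_push_le (fun p => LinearMap.range (f p)) s d hd hc fun x => ?_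
  obtain ⟨v, rfl⟩ := Submodule.Quotient.mk_surjective U x
  rw [h v]
  exact Submodule.sum_mem _ fun p hp =>
    Submodule.mem_iSup_of_mem p (Submodule.mem_iSup_of_mem hp (LinearMap.mem_range_self (f p) v))

/-- **ROW (N-ii) assembled:** `dim V = dim U + dim (V ∕ U)`, `dim U ≤ capA` ⟹ `m = dim V ≤ capA + Σ d`. -/
theorem twoDoor_row_Nii {K V ι : Type*} [Field K] [AddCommGroup V] [Module K V] [FiniteDimensional K V]
    (U : Submodule K V) (f : ι → (V →ₗ[K] V ⧸ U)) (s : Finset ι) (d : ι → ℕ)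
    (hd : ∀ p ∈ s, Module.finrank K ↥(LinearMap.range (f p)) ≤ d p) {capA : ℕ} (hU : Module.finrank K U ≤ capA)
    {c : K} (hc : c ≠ 0) (h : ∀ v : V, c • Submodule.Quotient.mk v = ∑ p ∈ s, f p v) :
    Module.finrank K V ≤ capA + ∑ p ∈ s, d p := by
  have := Submodule.finrank_quotient_add_finrank U
  have hq := twoDoor_count_quot U f s d hd hc h
  omega

/-- **count of ROW (N-iii).** `c • id_V = Σ_{a ∈ sA} g_a + Σ_{p ∈ sC} f_p` with `rank g_a ≤ u a`, `rank f_p ≤ d p`, `c ≠ 0` ⟹ `dim V ≤ Σ u + Σ d`. -/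
theorem twoDoor_count_both {K V ιA ιC : Type*} [Field K] [AddCommGroup V] [Module K V] [FiniteDimensional K V]
    (g : ιA → (V →ₗ[K] V)) (sA : Finset ιA) (u : ιA → ℕ) (hu : ∀ a ∈ sA, Module.finrank K ↥(LinearMap.range (g a)) ≤ u a)
    (f : ιC → (V →ₗ[K] V)) (sC : Finset ιC) (d : ιC → ℕ) (hd : ∀ p ∈ sC, Module.finrank K ↥(LinearMap.range (f p)) ≤ d p)
    {c : K} (hc : c ≠ 0) (h : ∀ v : V, c • v = (∑ a ∈ sA, g a v) + ∑ p ∈ sC, f p v) :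
    Module.finrank K V ≤ (∑ a ∈ sA, u a) + ∑ p ∈ sC, d p := by
  classical
  let F : ιA ⊕ ιC → (V →ₗ[K] V) := fun x => Sum.elim g f x
  let s : Finset (ιA ⊕ ιC) := sA.disjSum sC
  let e : ιA ⊕ ιC → ℕ := fun x => Sum.elim u d x
  have key : Module.finrank K V ≤ ∑ x ∈ s, e x := by
    refine dmass_functional_push_le (fun x => LinearMap.range (F x)) s e ?_ hc fun v => ?_
    · intro x hx
      rcases Finset.mem_disjSum.mp hx with ⟨a, ha, rfl⟩ | ⟨p, hp, rfl⟩
      · exact hu a ha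
      · exact hd p hp
    · rw [h v]
      refine Submodule.add_mem _ (Submodule.sum_mem _ fun a ha => ?_) (Submodule.sum_mem _ fun p hp => ?_)
      · exact Submodule.mem_iSup_of_mem (Sum.inl a)
          (Submodule.mem_iSup_of_mem (Finset.inl_mem_disjSum.mpr ha) (LinearMap.mem_range_self (g a) v))
      · exact Submodule.mem_iSup_of_mem (Sum.inr p)
          (Submodule.mem_iSup_of_mem (Finset.inr_mem_disjSum.mpr hp) (LinearMap.mem_range_self (f p) v))
  simpa [s, e, Finset.sum_disjSum] using key

end TwoDoorCounting

section TwoDoorDesign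

/-! ### Letter cohomology in all degrees at maximal alignment (memo §2.3: the Ext³ switch) -/

/-- `(h⁰, h¹, h²)` of ONE factor class `Δ` on `E_i × E_i` at MAXIMAL ALIGNMENT (canonical lift; an upper bound at every lift): `𝒪 ↦ (1,2,1)`; ample `(n,0,0)`,
anti-ample `(0,0,n)` (`n = |Δα² − Δx² − Δy²|`); indefinite `(0, Δx² + Δy² − Δα², 0)`; null future `(k,k,0)`, null past `(0,k,k)`, `k = gcd(Δα, Δx, Δy)`. -/
def hVec (Δ : BPoint) : ℤ × ℤ × ℤ :=
  if Δ = (0, 0, 0) then (1, 2, 1)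
  else if Δ.2.1 ^ 2 + Δ.2.2 ^ 2 < Δ.1 ^ 2 then
    (if 0 < Δ.1 then (Δ.1 ^ 2 - Δ.2.1 ^ 2 - Δ.2.2 ^ 2, 0, 0) else (0, 0, Δ.1 ^ 2 - Δ.2.1 ^ 2 - Δ.2.2 ^ 2))
  else if Δ.1 ^ 2 < Δ.2.1 ^ 2 + Δ.2.2 ^ 2 then (0, Δ.2.1 ^ 2 + Δ.2.2 ^ 2 - Δ.1 ^ 2, 0)
  else (if 0 < Δ.1 then ((Int.gcd (Int.gcd Δ.1 Δ.2.1 : ℤ) Δ.2.2 : ℤ), (Int.gcd (Int.gcd Δ.1 Δ.2.1 : ℤ) Δ.2.2 : ℤ), 0)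
    else (0, (Int.gcd (Int.gcd Δ.1 Δ.2.1 : ℤ) Δ.2.2 : ℤ), (Int.gcd (Int.gcd Δ.1 Δ.2.1 : ℤ) Δ.2.2 : ℤ)))

/-- the Poincaré polynomial `h⁰ + h¹ t + h² t²` of a factor class as a coefficient list. -/
def hList (Δ : BPoint) : List ℤ := [(hVec Δ).1, (hVec Δ).2.1, (hVec Δ).2.2]

/-- coefficientwise sum of two coefficient lists. -/
def polyAdd : List ℤ → List ℤ → List ℤ
  | [], q => q
  | p, [] => p
  | a :: p, b :: q => (a + b) :: polyAdd p q

/-- product of two coefficient lists (convolution). -/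
def polyMul : List ℤ → List ℤ → List ℤ
  | [], _ => []
  | a :: p, q => polyAdd (q.map (a * ·)) (0 :: polyMul p q)

/-- KÜNNETH: the Poincaré polynomial `Σ_d h^d(X, L_Z ⊗ L_P⁻¹) t^d` of the cell difference `Z − P` on `X = ∏_f (E_i × E_i)` at maximal alignment. -/
def hPoly (P Z : MCell) : List ℤ :=
  polyMul (hList (bsub (Z 0) (P 0))) (polyMul (hList (bsub (Z 1) (P 1))) (polyMul (hList (bsub (Z 2) (P 2))) (hList (bsub (Z 3) (P 3)))))

/-- `hDim P Z d = h^d(X, L_Z ⊗ L_P⁻¹) = dim Ext^d(L_P, L_Z)` at maximal alignment (`hDim P Z 0 = homDim P Z` on live pairs). -/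
def hDim (P Z : MCell) (d : ℕ) : ℤ := (hPoly P Z).getD d 0

namespace SplitDesign

/-- `dim Ext³(C, A) = Σ_{a, c} h³(X, L_a ⊗ L_c⁻¹) · m_A(a) · m_C(c)` at maximal alignment (an upper bound at every Pic⁰ twist). -/
def ext3Dim (S : SplitDesign) : ℤ := ∑ a ∈ S.cells, ∑ c ∈ S.cells, hDim c a 3 * S.mA a * S.mC c

/-- **the Ext³ SWITCH** (memo §2.3): `Ext³(C, A) = 0` — then the lift along `j^*` in `twoDoor_both` ∕ `twoDoor_sub` ∕ `twoDoor_quot` is automatic and the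
conditional rows (N-iii), (A), (C) are in force at every twist. OFF on all three designs of record (memo TABLE 1). -/
def Ext3Switch (S : SplitDesign) : Prop := S.ext3Dim = 0

/-! ### The two-door capacities and rows (memo §2.2; canonical lift: `h⁰(ν − a) = homDim a ν`, `h⁰(c − ν) = homDim ν c`) -/

/-- A-door capacity of the `N`-cell `ν` for `(g, j; λ, μ)`: `Σ_{a counted} h⁰(ν − a) · m_A(a)` over the GOOD `A`-suppliers below `ν`. -/
def dcapA (S : SplitDesign) (ν : MCell) (g j : Fin 4) (l m : Fin 2 → GaussianInt) : ℤ :=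
  ∑ a ∈ S.cells, if DMassCounts a ν g j l m then homDim a ν * S.mA a else 0

/-- C-door capacity of the `N`-cell `ν` for `(g, j; λ, μ)`: `Σ_{c counted} h⁰(c − ν) · m_C(c)` over the GOOD `C`-absorbers above `ν`. -/
def dcapC (S : SplitDesign) (ν : MCell) (g j : Fin 4) (l m : Fin 2 → GaussianInt) : ℤ :=
  ∑ c ∈ S.cells, if DMassCounts ν c g j l m then homDim ν c * S.mC c else 0

/-- N-capacity seen from an `A`-cell `a` through the door `(g, j; λ, μ)`: `Σ_{ν counted} h⁰(ν − a) · m_N(ν)`. -/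
def dcapNA (S : SplitDesign) (a : MCell) (g j : Fin 4) (l m : Fin 2 → GaussianInt) : ℤ :=
  ∑ ν ∈ S.cells, if DMassCounts a ν g j l m then homDim a ν * S.mN ν else 0

/-- N-capacity seen from a `C`-cell `c` through the door `(g, j; λ, μ)`: `Σ_{ν counted} h⁰(c − ν) · m_N(ν)`. -/
def dcapNC (S : SplitDesign) (c : MCell) (g j : Fin 4) (l m : Fin 2 → GaussianInt) : ℤ :=
  ∑ ν ∈ S.cells, if DMassCounts ν c g j l m then homDim ν c * S.mN ν else 0

/-- **ROW (N-i)** [`i` a sub-bundle, `q ∘ i = 0`]: `m_N(ν) ≤ dcap^A_ν(λ, μ) + ccap_ν` (A-door + C-Hall; `twoDoor_lower`, `twoDoor_row_Ni`). Unconditional behind (H2). -/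
def TwoDoorRowNi (S : SplitDesign) (ν : MCell) (g j : Fin 4) (l m : Fin 2 → GaussianInt) : Prop :=
  DMassValid ν g j l m → (S.mN ν : ℤ) ≤ S.dcapA ν g j l m + S.ccap ν

/-- **ROW (N-ii)** [+ `q` onto]: `m_N(ν) ≤ cap^A_ν + dcap^C_ν(λ, μ)` (A-Hall + C-door; `twoDoor_upper`, `twoDoor_row_Nii`). Unconditional behind (H2). -/
def TwoDoorRowNii (S : SplitDesign) (ν : MCell) (g j : Fin 4) (l m : Fin 2 → GaussianInt) : Prop :=
  DMassValid ν g j l m → (S.mN ν : ℤ) ≤ S.capA ν + S.dcapC ν g j l m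

/-- **ROW (N-iii)** [+ the Ext³ switch]: `m_N(ν) ≤ dcap^A_ν(λ, μ) + dcap^C_ν(λ, μ)`, ONE block and ONE functional for both doors (`twoDoor_both`). CONDITIONAL. -/
def TwoDoorRowNiii (S : SplitDesign) (ν : MCell) (g j : Fin 4) (l m : Fin 2 → GaussianInt) : Prop :=
  DMassValid ν g j l m → (S.mN ν : ℤ) ≤ S.dcapA ν g j l m + S.dcapC ν g j l m

/-- **ROW (A)** [+ `q` onto + the switch]: `m_A(a) ≤ Σ_{ν counted} h⁰(ν − a) · m_N(ν)` (`twoDoor_sub`). CONDITIONAL; door-free shadow = Hall `m_A(a) ≤ cap^N_a`. -/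
def TwoDoorRowA (S : SplitDesign) (a : MCell) (g j : Fin 4) (l m : Fin 2 → GaussianInt) : Prop :=
  DMassValid a g j l m → (S.mA a : ℤ) ≤ S.dcapNA a g j l m

/-- **ROW (C)** [+ the switch]: `m_C(c) ≤ Σ_{ν counted} h⁰(c − ν) · m_N(ν)` (`twoDoor_quot`). CONDITIONAL; door-free shadow = Hall `m_C(c) ≤ cap^N_c`. -/
def TwoDoorRowC (S : SplitDesign) (c : MCell) (g j : Fin 4) (l m : Fin 2 → GaussianInt) : Prop :=
  DMassValid c g j l m → (S.mC c : ℤ) ≤ S.dcapNC c g j l m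

/-- **2D-MASS (unconditional part)**: every (N-i) and (N-ii) row — violated ⟹ behind (H2) NO box monad with these cell multiplicities (`A` a sub-bundle, `q` onto,
any maps, any twist) has `ob_κ(E) = 0` for all `κ ∈ T_W` (memo THEOREM 2D). -/
def TwoDoorN (S : SplitDesign) : Prop :=
  ∀ ν ∈ S.cells, ∀ g j : Fin 4, ∀ l m : Fin 2 → GaussianInt, S.TwoDoorRowNi ν g j l m ∧ S.TwoDoorRowNii ν g j l m

/-- **2D-MASS (conditional part, behind the Ext³ switch)** — every (N-iii), (A), (C) row. -/
def TwoDoorSwitched (S : SplitDesign) : Prop :=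
  ∀ Z ∈ S.cells, ∀ g j : Fin 4, ∀ l m : Fin 2 → GaussianInt, S.TwoDoorRowNiii Z g j l m ∧ S.TwoDoorRowA Z g j l m ∧ S.TwoDoorRowC Z g j l m

/-- **2D-MASS (all rows)**: the unconditional rows, and the conditional ones whenever the switch is ON. -/
def TwoDoorAll (S : SplitDesign) : Prop := S.TwoDoorN ∧ (S.Ext3Switch → S.TwoDoorSwitched)

/-- a door capacity never exceeds the full capacity: `dcapA ≤ capA` (termwise, `homDim ≥ 0` on the cells). -/
theorem dcapA_le_capA (S : SplitDesign) (ν : MCell) (g j : Fin 4) (l m : Fin 2 → GaussianInt)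
    (hnn : ∀ a ∈ S.cells, 0 ≤ homDim a ν) : S.dcapA ν g j l m ≤ S.capA ν := by
  unfold dcapA capA
  refine Finset.sum_le_sum fun a ha => ?_
  split_ifs with h
  · exact le_rfl
  · exact mul_nonneg (hnn a ha) (by exact_mod_cast Nat.zero_le _)

theorem capZeroRowMonad_of_twoDoorRowNi (S : SplitDesign) (ν : MCell) (g j : Fin 4) (l m : Fin 2 → GaussianInt)
    (hv : DMassValid ν g j l m) (hnn : ∀ a ∈ S.cells, 0 ≤ homDim a ν) (h : S.TwoDoorRowNi ν g j l m) : S.CapZeroRowMonad ν := by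
  have h1 := h hv
  have h2 := S.dcapA_le_capA ν g j l m hnn
  unfold CapZeroRowMonad
  omega

end SplitDesign

/-! ### Numeric certificates of record (memo §3, TABLE 1–4; all `decide`) -/

/-- the CARRIER cell of `S′` (LINE 14; famdesign orbit `N18`, 16 cells): `[12,-2,0|12,-2,0|12,-2,0|13,0,1]` — charged on all four factors. -/
def cellN18Sp : MCell := ![((12 : ℤ), (-2 : ℤ), (0 : ℤ)), (12, -2, 0), (12, -2, 0), (13, 0, 1)]

/-- the only `C`-cell of `ac808a66` live above the `S′` carrier: a LEG on factor `3` (direction `(1; 0 − 1i)`, `h⁰ = 1`, `m_C = 189`). -/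
def cellC69Sp : MCell := ![((12 : ℤ), (-2 : ℤ), (0 : ℤ)), (12, -2, 0), (12, -2, 0), (14, 0, 0)]

/-- one of the four `A`-cells of `ac808a66` live below the `S′` carrier: a LEG on factor `0` (direction `(1; 1 + 0i)`, `h⁰ = 1`, `m_A = 54`). -/
def cellA58Sp : MCell := ![((11 : ℤ), (-3 : ℤ), (0 : ℤ)), (12, -2, 0), (12, -2, 0), (13, 0, 1)]

/-- the generic functional `λ = μ = (1, 0)` on the block `(0, 1)` of the carrier is VALID (`M₁(0,1) = diag(−2, 2)`: `(λ ⊗ μ)(M₁) = −2`). [`decide`] -/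
example : DMassValid cellN18Sp 0 1 ![1, 0] ![1, 0] := by decide

/-- the factor-`3` leg `C`-cell does NOT count on the block `(0, 1)` (a leg on a third factor has image `0` there): `dcap^C_{N18} = 0` on `(0, 1)` for every
functional, so ROW (N-ii) at the `S′` carrier reads `m_N(N18) ≤ cap^A_{N18}`. [`decide`] -/
example : ¬ DMassCounts cellN18Sp cellC69Sp 0 1 ![1, 0] ![1, 0] ∧ IsLegBelow cellN18Sp cellC69Sp 3 := by decide

/-- the `A`-cell `[11,-3,0|12,-2,0|12,-2,0|13,0,1]` IS a factor-`0` leg below the carrier: it counts on the block `(0, 1)` under the generic functional, but NOT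
under `λ = annCovec (1; 1 + 0i)` (which annihilates its line and is still valid) — the A-door witness of TABLE 1 (`dcap^A_{N18} = 54`: only the factor-`1` leg
survives `(ann, gen)` on `(0, 1)`). [`decide`] -/
example : DMassCounts cellA58Sp cellN18Sp 0 1 ![1, 0] ![1, 0] := by decide
example : ¬ DMassCounts cellA58Sp cellN18Sp 0 1 (annCovec (1, 1, 0)) ![1, 0] := by decide
example : DMassValid cellN18Sp 0 1 (annCovec (1, 1, 0)) ![1, 0] := by decide

/-- ROW (N-ii) at the `S′` carrier on `ac808a66` (TABLE 1): `405 > 4 · 1 · 54 + 0`; on the standing `S′` corpus (TABLE 4: no `A`-cell live below the carrier)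
the row reads `m_N(N18) ≤ 0`. -/
example : ¬ ((405 : ℤ) ≤ 4 * 1 * 54 + 0) := by decide

/-- the CARRIER cell of `S131` (LINE 16; famdesign orbit `N47`, 16 cells): `[14,-2,0|15,0,1|15,0,1|15,0,1]`. -/
def cellN47S131 : MCell := ![((14 : ℤ), (-2 : ℤ), (0 : ℤ)), (15, 0, 1), (15, 0, 1), (15, 0, 1)]

/-- the two `C`-cells of `bf2edc09` live above the `S131` carrier: `[14,-2,0|16,0,0³]` (three null factors: irrelevant to every block) and the factor-`0` leg
`[16,0,0|15,0,1³]` (difference `(2; 2 + 0i)`, `h⁰ = 2`). -/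
def cellC3nullS131 : MCell := ![((14 : ℤ), (-2 : ℤ), (0 : ℤ)), (16, 0, 0), (16, 0, 0), (16, 0, 0)]
def cellCleg0S131 : MCell := ![((16 : ℤ), (0 : ℤ), (0 : ℤ)), (15, 0, 1), (15, 0, 1), (15, 0, 1)]

/-- block `(1, 2)` of the `S131` carrier: the generic functional is valid and NEITHER `C`-cell counts, so ROW (N-ii) reads `m_N(N47) ≤ cap^A_{N47}`;
on `bf2edc09`: `51624 > 28680 = 2 · 5736 + 3 · 1 · 5736` (TABLE 1). [`decide`] -/
example : DMassValid cellN47S131 1 2 ![1, 0] ![1, 0] := by decide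
example : ¬ DMassCounts cellN47S131 cellC3nullS131 1 2 ![1, 0] ![1, 0] := by decide
example : ¬ DMassCounts cellN47S131 cellCleg0S131 1 2 ![1, 0] ![1, 0] := by decide

example : ¬ ((51624 : ℤ) ≤ 2 * 5736 + 3 * 1 * 5736 + 0) := by decide

/-- the Ext³ switch is OFF on the designs of record, e.g. on `S′`: `h³(X, L_a ⊗ L_c⁻¹) = 2520 ≠ 0` for the `A`-cell `a = [7,-7,0|14,0,0|14,0,0|14,0,0]`
(`m_A = 54`) and the `C`-cell `c = [11,3,0|11,3,0|14,0,0|14,0,0]` (`m_C = 2592`): `a − c = (−4; −10 + 0i | 3; −3 + 0i | 0 | 0)` = indefinite `(0, 84, 0)` ×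
null future `(3, 3, 0)` × `𝒪 (1, 2, 1)` twice; `h³` = coefficient of `t³` in `84t · (3 + 3t) · (1 + 2t + t²)² = 2520`. [`decide`] -/
example : hDim ![((11 : ℤ), (3 : ℤ), (0 : ℤ)), (11, 3, 0), (14, 0, 0), (14, 0, 0)] ![((7 : ℤ), (-7 : ℤ), (0 : ℤ)), (14, 0, 0), (14, 0, 0), (14, 0, 0)] 3 = 2520 := by
  decide

/-- sanity of `hVec` on the four kinds: `𝒪`, a null future step, an ample class `(3; 1 + 1i)` (`n = 7`), an indefinite class `(1; 2 + 0i)`. [`decide`] -/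
example : hVec (0, 0, 0) = (1, 2, 1) ∧ hVec (2, 2, 0) = (2, 2, 0) ∧ hVec (-2, -2, 0) = (0, 2, 2) ∧ hVec (3, 1, 1) = (7, 0, 0) ∧ hVec (-3, 1, 1) = (0, 0, 7) ∧
    hVec (1, 2, 0) = (0, 3, 0) := by decide

/-- `hDim P Z 0 = homDim P Z` on a live pair (here the factor-`0` leg below the `S′` carrier: both `1`) and the full Poincaré list of that difference
(`(1,1,0)·(1,2,1)³`). [`decide`] -/
example : hDim cellA58Sp cellN18Sp 0 = 1 ∧ homDim cellA58Sp cellN18Sp = 1 ∧ hPoly cellA58Sp cellN18Sp = [1, 7, 21, 35, 35, 21, 7, 1, 0] := by decide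

end TwoDoorDesign

end TwoDoor

end Summit.Ventures.HSemireg.Pad4Tower.C4Stability
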